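import Literature.MathematicalPhysics.QuantumFieldTheory.BalabanImbrieJaffe1984to88.BIJ88NeumannPropagatorFlatClose231

/-!
# `BalabanImbrieJaffe1984to88.BIJ88DeltaLocFlatClose235` — T. Bałaban, J. Imbrie, A. Jaffe, *Effective action and cluster properties of the
abelian Higgs model*, Commun. Math. Phys. **114** (1988) 257–315 [BalabanImbrieJaffe1988], Sect. 2 p. 263 [PDF 7], **(2.35), (2.36) AND
(2.37) AT EVERY PURE-GAUGE BACKGROUND `u = 1^h` FOR THE TORUS OBJECTS OF RECORD** — the kernel of gen 15's localized scalar form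
`Δ_{k,loc}(u) = a_kI − a_k²Q_k(u)G_{k,loc}(u)Q_k^*(u)` (2.34) against the region form `Δ_k(Ω₀,u)` deep inside a box `Ω₀`, its decay in the
printed unit-lattice distance, and its finite range, hypothesis-free in [6], constants depending on `(d, L, a)` only (uniform in the volume,
in `1 ≤ k ≤ K` and in `h`), in the counting normalization of gen 15 made explicit.

statement-level skeleton of published theorems with citation tags; proofs where landed; nothing here is a claim about the Yang–Mills mass gap

PDF held: `paper:balaban1988-cmp114-bij-abelian-higgs-effective-action` (journal page = PDF page + 256); p. 263–264 [PDF 7–8] re-read this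
session from the text layer (`lit read … --pages 6-9`); [I] = [BalabanImbrieJaffe1985] (CMP **97**) p. 302–303 (2.4)/(2.6) as quoted in p11's
`BIJ85BlockAveragesTorusK` / p33's `BIJ85BlockKPoincare`; [6] = [Balaban1983RegularityDecay] (CMP **89**) p. 573 as transcribed in the tree's
`Balaban1983to89.B4Thm110ZeroBox` / `B4Delta112ZeroBox`.

CITATION HEADER (lean-in-tree rule).  Part of the lit-balaban TYPED SKELETON (HOME `run/shared/lean/pub/lit-balaban/`), PHASE-2 proof seat
p31 gen 17 (unit `lit-balaban-p31-g17`; TAKING lines HOME/STATUS.md 2026-08-22T15:27:51Z and the follow-up of this file; free-target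
protocol G.5-34(d) — item 2 (ii) of the owner's `HOME/lit-balaban-r18/C2S14-CLOSURE.md` §5, *"the DECAY inputs (2.30)/(2.31) ⟹
(2.35)/(2.36)/… as torus theorems"*, FLAT-BACKGROUND case, the (2.35)/(2.36)/(2.37) step).  WHAT IS REPRODUCED: rows **C2.Eq2.35**,
**C2.Eq2.36**, **C2.Eq2.37** (`HOME/lit-balaban-r18/ROWS-C2.md`, owner r18; heads «proved (p02)» = p02's abstract real-kernel hence-steps
`BIJ88Close235Proof.close235_of_opClose231` / `decay236_of_opDecay` / `vanishes237_of_zeta229`, whose (2.30)/(2.31) inputs `OpDecay` /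
`OpClose231` are displayed hypotheses) for the CONCRETE torus objects WITH BODIES — gen 15's `BIJ88DeltaLoc234Torus.deltaLocT` (2.34) and
`deltaRegion` (Δ_k(Ω,u), [I] (4.6.4)) over gen 15's `gLocT` / `gBox` — at pure-gauge backgrounds, from the companion file's (2.30)/(2.31)
for the same objects and [6]'s zero-field theorems.  Kind «model-level theorems only» (no new definition, no `Prop`-valued fact introduced).

THE PRINTED TEXT (verbatim).  p. 263 [PDF 7]: *"We use G_{k,loc} to define a localized quadratic form for scalar fields, Δ_{k,loc}(u) = a_kI
− a_k²Q_k(u)G_{k,loc}(u)Q_k^*(u). (2.34) Here we have simply replaced G_k(Ω,u) with G_{k,loc} in the definition of Δ_k(Ω,u); see (I.4.6.4).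
Hence |Δ_{k,loc}(u;x₁,x₂) − Δ_k(Ω,u;x₁,x₂)| ≦ e^{−cr(e_k)}e^{−c|x₁−x₂|} for dist({x₁,x₂},Ω^c) > O(r(e_k)), (2.35) |Δ_{k,loc}(u;x₁,x₂)| ≦
ce^{−c|x₁−x₂|}, (2.36) Δ_{k,loc}(u;x₁,x₂) = 0 if |x₁ − x₂| ≧ (1/2L) r(e_{k−1}). (2.37)"*; p. 264 [PDF 8]: *"Again we assume u is smooth in the
relevant regions; Δ_{k,loc}(u;x₁,x₂) depends on u only in an O(r(e_k))-neighborhood of x₁, x₂."*  [I] p. 303 (2.6): *"The average Qφ of φ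
is defined by (Qφ)_y = Σ_{x∈B(y)} L^{−d}u(Γ_{yx})φ_x."*

THE OBJECTS AND THE NORMALIZATION (made explicit; nothing in gen 15's definitions is changed).  `Δ_{k,loc}(1^h)` = gen 15's
`deltaLocT A ε⁻¹ (gaugeAct h 1) k cube lam ζ″ = A·1 − A²·Q_k(1^h)G_{k,loc}(1^h)Q_k(1^h)ᴴ` on `ℓ²(T^{(k)})` and `Δ_k(Ω₀,1^h)` = gen 15's
`deltaRegion A ε⁻¹ (gaugeAct h 1) k Ω₀`, with the parameter of gen 16's flat bridge `A = α_kL^{kd}` (`α_k = a_k(L^kε)^{−2}` = pv07's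
`B1RG242Torus.α`, `a_k = B1.aSeq a L k`, `d` = `P.d` directions), `Q_k(u)` = gen 15's `qMatT` (entries `L^{−kd}u(Γ^{(k)})` on the block, (2.6)),
`G_{k,loc}` / `G_k(Ω₀,·)` = gen 15's `gLocT` / `gBox` on a no-wrap box `Ω₀ = cubeT hPd (L^k) c (L^kM₀)` and cubes NESTED in it (companion file
§1), weights `λ_α` and cut-off `ζ″` DATA.  In this COUNTING normalization (plain conjugate transposes for `Q_k^*`, gen 15: *"uniform lattice
weights absorbed into a, c, L^{−kd}"*) the matrix `deltaLocT` is `A/a_k = (L^kε)^{−2}L^{kd}` times the printed kernel of (2.34) (at the unit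
block lattice `k = K`: `η^{−d}Δ_{k,loc}`, since print's `Q_k^* = L^{kd}Q_kᴴ` by [I] (2.9) `QQ^* = I` and print's `G_k` is the `η`-weighted
kernel); accordingly EVERY BOUND BELOW IS STATED AS `A·(…)` with a `k`-UNIFORM bracket — the bracket is the printed right-hand side.  The
fine-lattice distances of the companion file are converted to the printed unit-lattice distance `L^kε·|y₁−y₂|_{T^{(k)}}` (`P.spacing k *
B5Ineq137Torus.T P (0+k) y₁ y₂`) by §2.

THE MECHANISM (the printed hence-step *"Here we have simply replaced G_k(Ω,u) with G_{k,loc} … Hence"*, p02's kernel algebra, for the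
concrete complex torus objects).  (§1) THE [6]-INPUTS WITH THEIR SCALE: gen 16's `G_k(□,1) = (L^kε)²·boxOpR⁻¹` through the chart
(`gBox_cube_eq`) carries the factor `(L^kε)²`, which gen 16's `decay110_flat_cube` and the companion's `close112_flat_cube` weaken to `1`;
here the same two proofs are run KEEPING it (`decay110_flat_cube_scaled`, `close112_flat_cube_scaled`, from p38's `B4Thm110ZeroBox` /
r01's `B4Delta112ZeroBox` by name), and the companion's operator forms of (2.30)/(2.31) follow with it (`opDecay230_flat_scaled`,
`opClose231_flat_scaled`, same assembly over the companion's identities `gLocT_mulVec_apply` / `gLocT_sub_mulVec_apply`) — this factor is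
what cancels the `L^{kd}(L^kε)^{−2}` of `A` (`scale_identity`: `A²·L^{−kd}·(L^kε)² = A·a_k`).  (§2) THE BLOCK METRIC: for `x ∈ B^k(y₁)`,
`x′ ∈ B^k(y₂)`, `L^k|y₁−y₂|_{T^{(k)}} ≤ |x−x′|_{T^{(0)}} + (L^k − 1)` (`pow_mul_T_block_le`, coordinatewise `circAbs_block_le` on the labels
`x_μ = L^ky_μ + r_μ` of p33's `val_blkIter`, periods `|T^{(0)}| = L^k|T^{(k)}|`), so a fine decay `e^{−δε·max(0, L^k|y₁−y₂| − (L^k−1))}` is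
`≤ e^{δ}e^{−δ(L^kε)|y₁−y₂|_{T^{(k)}}}` (`exp_blockLower_le`).  (§3) THE SANDWICH: `(QMQᴴ)(y₁,y₂) = Σ_x Q(y₁,x)(Mg_{y₂})(x)` with the row
source `g_{y₂} = conj Q(y₂,·)` (`qMq_apply`; `‖g_{y₂}‖_∞ ≤ L^{−kd}`, `supp g_{y₂} ⊆ B^k(y₂)`, `norm_qMatT_apply`), whence a bound
`‖(Mg_{y₂})(x)‖ ≤ B` on the block `B^k(y₁)` gives `‖(QMQᴴ)(y₁,y₂)‖ ≤ B` (`norm_qMq_apply_le`: `L^{kd}` points × weight `L^{−kd}`, p11's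
`card_blockK`).  (§4) (2.36): `Δ = A·1 − A²·QGQᴴ` entrywise (`deltaRegion_apply`/`deltaLocT_apply`); the sandwich of `G_k(Ω₀,1^h)` is
bounded through §1's (1.10) operator form at the block lower bound of §2 (`decay236_region_flat`, ALL `y₁, y₂`, no depth condition), that of
`G_{k,loc}(1^h)` through §1's (2.30) (`decay236_flat`, multiplicity `#S` of the cubes active on the rows of the block).  (§5) (2.35):
`Δ_{k,loc} − Δ_k(Ω₀) = −A²Q(G_{k,loc} − G_k(Ω₀))Qᴴ` (`deltaLocT_sub_deltaRegion_apply`, print's *"simply replaced"*), §1's (2.31) operator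
form on every row `x ∈ B^k(y₁)` under the companion's row hypotheses (i)–(iii) (*"for dist({x₁,x₂},Ω^c) > O(r(e_k))"*), §3, §2:
`close235_flat`.  (§6) (2.37): gen 15's combinatorial core `deltaLocT_apply_eq_zero` + §2: the kernel vanishes one block beyond the fine
range `R₀` of `ζ″` (`vanishes237_metric`, ANY background `u`).  (§7, v1.1) LEVEL-`k` UNITS (the owner's UNITS NOTE, r18 2026-08-22T16:02Z:
print's `G_k(Ω,u)` lives on `T_η`, `η = L^{−k}`, so [6]'s exponent `e^{−δ₀D/(ℓ+1)^k}` IS the printed `e^{−δ₀ dist_η}` at every level, and the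
`ε`-forms of §1–§5 / the companion file are its weakening by `1/L^k ≥ ε`, sharp only at `k = K`): the same proofs are re-run WITHOUT
`exp_level_le_exp_eps`, giving every member with the exponent `e^{−δ₀D/L^k}` and — through `exp_blockLower_level_le`
(`e^{−δ·max(0, L^k|y₁−y₂| − (L^k−1))/L^k} ≤ e^{δ}e^{−δ|y₁−y₂|_{T^{(k)}}}`) — the kernels of `Δ_k(Ω₀,1^h)`, `Δ_{k,loc}(1^h)` and their difference
decaying in the unit-lattice distance `|y₁−y₂|_{T^{(k)}}` itself, constants from `(d, ℓ, a)` only.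

WHAT IS PROVED (theorems only; 0 `sorry`; standard axioms; no new definition, no `Prop`-valued fact).
* §1 **`decay110_flat_cube_scaled`**, **`close112_flat_cube_scaled`**, **`opDecay230_flat_scaled`**, **`opClose231_flat_scaled`** — the
  companion file's / gen 16's (1.10), (1.11)–(1.12), (2.30), (2.31) at `u = 1^h` with the right-hand sides multiplied by `(L^kε)² ≤ 1`
  (sharper; same hypotheses verbatim).
* §2 `circAbs_block_le`, **`pow_mul_T_block_le`**, `blockLower_le_T`, `exp_blockLower_le`.
* §3 `qMq_apply`, `norm_qMatT_apply`, `norm_qMatT_apply_le`, `norm_conj_qMatT_le`, `conj_qMatT_ne_zero`, **`norm_qMq_apply_le`**,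
  `scale_identity`.
* §4 `norm_coe_mul_one_apply`, `deltaRegion_apply`, `deltaLocT_apply`, `deltaLocT_sub_deltaRegion_apply`, **`decay236_region_flat`** —
  `∃ δ₀ c₀ > 0` (from `(d, ℓ, a)`) ∀ volumes `P` (`P.d = d+1`, `P.L = ℓ+1`) ∀ `1 ≤ k ≤ K` ∀ boxes `Ω₀` fitting and shorter than the torus ∀ `h`
  ∀ `y₁ y₂`: `‖Δ_k(Ω₀,1^h;y₁,y₂)‖ ≤ A·([y₁ = y₂] + a_kc₀e^{−δ₀(L^kε)|y₁−y₂|_{T^{(k)}}})`; **`decay236_flat`** — for `Δ_{k,loc}(1^h)` over ANY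
  finite family of no-wrap cubes, `Σ_α|λ_α| ≤ 1`, `|ζ″| ≤ 1`, `S ⊇` the cubes active on the rows `x ∈ B^k(y₁)`:
  `‖Δ_{k,loc}(1^h;y₁,y₂)‖ ≤ A·([y₁ = y₂] + #S·a_kc₀e^{−δ₀(L^kε)|y₁−y₂|_{T^{(k)}}})`.
* §5 **`close235_flat`** — for cubes nested in `Ω₀`, `Σ|λ_α| ≤ 1`, `0 ≤ ζ″ ≤ 1`, `R, R₁ ≥ 0`, the row hypotheses (i)–(iii) of the companion's
  (2.31) on every `x ∈ B^k(y₁)` and `S` as above: `‖Δ_{k,loc}(1^h;y₁,y₂) − Δ_k(Ω₀,1^h;y₁,y₂)‖ ≤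
  A·a_kc₀(#S·e^{−2δ₀εR} + e^{−(δ₀/2)εR₁})·e^{−(δ₀/2)(L^kε)|y₁−y₂|_{T^{(k)}}}`.
* §6 **`vanishes237_metric`** — any `u`: `ζ″(x,x′) = 0` for `|x−x′|_{T^{(0)}} ≥ R₀ > 0` ⟹ `Δ_{k,loc}(u;y₁,y₂) = 0` for
  `L^k|y₁−y₂|_{T^{(k)}} ≥ R₀ + (L^k − 1)`.
* §7 (v1.1, level-`k` units) **`decay110_flat_cube_level`**, **`close112_flat_cube_level`** ([6] (1.10), (1.11)–(1.12) at `A = 0`: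
  `(L^kε)²·c₀e^{−δ₀D/L^k}F`, resp. `·e^{−δ₀(D_b+D_f)/L^k}`, any dominated reals `D, D_b, D_f`), **`opDecay230_flat_level`**,
  **`opClose231_flat_level`** ((2.30)/(2.31) operator forms: `(L^kε)²·#S·c₀e^{−δ₀D/L^k}‖f‖_∞`, resp.
  `(L^kε)²·c₀(#S·e^{−2δ₀R/L^k} + e^{−(δ₀/2)R₁/L^k})e^{−(δ₀/2)D/L^k}‖f‖_∞`), the kernel forms **`decay110_flat_cube_kernel_level`**,
  **`close112_flat_cube_kernel_level`**, **`close231_flat_kernel_level`** ((2.31) kernel: `(L^kε)²·c₀(e^{−2δ₀R/L^k} + e^{−(δ₀/2)R₁/L^k})·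
  e^{−(δ₀/2)|x−y|_T/L^k}`), `exp_blockLower_level_le`, **`decay236_region_flat_level`**, **`decay236_flat_level`** ((2.36):
  `A·([y₁ = y₂] + a_kc₀e^{−δ₀|y₁−y₂|_{T^{(k)}}})`, resp. with `#S`), **`close235_flat_level`** ((2.35):
  `A·a_kc₀(#S·e^{−2δ₀R/L^k} + e^{−(δ₀/2)R₁/L^k})·e^{−(δ₀/2)|y₁−y₂|_{T^{(k)}}}`) — same hypotheses as the `ε`-forms (minus the nonnegativity of the
  dominated reals, no longer needed); at the printed radii `R, R₁ = r(e_k)L^k` the brackets are `e^{−c r(e_k)}` AT EVERY LEVEL `k ≤ K`;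
  (v1.2) the covariant-derivative members **`decay110_flat_cube_deriv_level`**, **`close112_flat_cube_deriv_level`** (`(L^kε)·c₀e^{−δ₀D/L^k}F`,
  resp. `·e^{−δ₀(D_b+D_f)/L^k}`: p38's / r01's `η`-difference-quotient box theorems with `ε⁻¹(L^kε)² = (L^kε)·L^k` and no weakening) and the
  kernel decay of (2.27)/(2.28) **`decay_gTilde_flat_kernel_level`**, **`decay_gLocT_flat_kernel_level`** (`(L^kε)²·c₀e^{−δ₀|x₁−x₂|_T/L^k}`, any
  finite family of no-wrap cubes, `Σ|λ_α| ≤ 1`, `|ζ″| ≤ 1`).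
HONEST SCOPE.  (i) FLAT BACKGROUNDS ONLY for (2.35)/(2.36) (the general (2.32)-smooth `u` stays XL — staircase vs composite contours, gen 16);
(2.37) for every `u`.  (ii) `Ω` of (2.35) = a no-wrap box `Ω₀` shorter than the torus (the tree's zero-field `δG` theorem is for nested boxes).
(iii) The radii `R, R₁, R₀` and the multiplicity `#S` are properties of the DATA `λ_α`, `ζ″` (a torus instance of p13's `ℤ^d` constructions is
not in the tree) and enter row by row; with `R, R₁ = O(r(e_k))/ε` the brackets are the printed `e^{−cr(e_k)}e^{−c|x₁−x₂|}` / `ce^{−c|x₁−x₂|}` —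
except for the DIAGONAL term `A·[y₁ = y₂]` of (2.36), kept separate (print absorbs `a_k` into `c`).  (iv) The normalization factor `A/a_k` of
the counting matrices is explicit, not hidden: the printed kernel is `(a_k/A)·deltaLocT`.  (v) Value statements only; (2.38) (the lower
bound, (I.7.3.2) + (2.35)) and the `u`-locality sentence of p. 264 are not in this file.  (vi) `j = 0`, `1 ≤ k ≤ K`, `m² = 0`, window
`a₋ = a₊ = a`, constants `2c₀e^{δ₀}` of the zero-field theorems.
Imports: the companion `BIJ88NeumannPropagatorFlatClose231` (this seat, same gen; → gen 16 `BIJ88NeumannPropagatorFlatDecayCube`, gen 15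
`BIJ88DeltaLoc234Torus`, r01 `B4Delta112ZeroBox`, p38 `B4Thm110ZeroBox`, b04 `B4TorusKernel.MultiPeriod`).  Literature + Mathlib only.
Unit `lit-balaban-p31` (literature-prover-lit-balaban-p31-g17-0), 2026-08-22; v1.1 (p334603) = APPEND-ONLY §7 (level-`k` units, the owner's
UNITS NOTE), §1–§6 byte-identical to v1 (p333751); v1.2 = APPEND-ONLY inside §7 (derivative members and the (2.27)/(2.28) kernels in level-`k`
units), everything before byte-identical to v1.1.  NOT summit progress.
-/

open scoped BigOperators Matrix ComplexConjugate
open Finset Matrix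

namespace Literature.MathematicalPhysics.QuantumFieldTheory.BalabanImbrieJaffe1984to88.BIJ88DeltaLocFlatClose235

open Literature.MathematicalPhysics.QuantumFieldTheory.Balaban1983to89
open BIJ88Sect3Statements (U1 toC cfg covD starB mem_starB toC_mul toC_one toC_inv norm_toC)
open BIJ85BlockAveragesTorus BIJ85BlockAveragesTorusK
open BIJ85BlockKPoincare (val_blkIter sitesPerDir_eq_mul_pow)
open BIJ88NeumannNoZeroModesTorus (IsBlockUnion)
open BIJ88NeumannPropagator227Torus
open BIJ88DeltaLoc234Torus (mulOp mulOpK gBox_gaugeAct gTilde gLocT gTilde_apply gLocT_apply qMatT qMatT_apply deltaLocT deltaRegion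
  deltaLocT_apply_eq_zero)
open BIJ88NeumannPropagatorFlatDecay
open BIJ88NeumannPropagatorFlatDecayCube
open BIJ88NeumannPropagatorFlatClose231
open B4Reflection242 (boxDom mem_boxDom)
open B4ContourShift (supNorm abs_le_supNorm supNorm_nonneg)
open B4BoxCov237 (boxOpR)
open B4TwoBox120 (Fits emb emb_val add_mem_boxDom)
open B4Delta112ZeroBox (ext dG delta112_zero_box_value)
open B4TorusKernel.MultiPeriod (circAbs centre circAbs_add_mul circAbs_le_abs abs_add_mul_centre circAbs_nonneg)
open GaugeField (gaugeAct)

noncomputable section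

variable {d : ℕ} {P : Params}

/-! ## §1 [6]'s (1.10) and (1.11)–(1.12) at `A = 0` for the torus cubes WITH THE SCALE FACTOR `(L^kε)²` of `G_k(□,1) = (L^kε)²·boxOpR⁻¹` kept -/

section ScaledInputs

/-- kernel: the real part of a real matrix applied to a complex vector is the matrix applied to the real part. [folklore] -/
private theorem re_map_mulVec₂ {m q : Type*} [Fintype q] (G : Matrix m q ℝ) (g : q → ℂ) (x : m) :
    ((G.map Complex.ofRealHom *ᵥ g) x).re = (G *ᵥ fun y => (g y).re) x := by
  simp only [mulVec, dotProduct, map_apply, Complex.ofRealHom_eq_coe, Complex.re_sum, Complex.re_ofReal_mul]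

/-- kernel: the same for the imaginary part. [folklore] -/
private theorem im_map_mulVec₂ {m q : Type*} [Fintype q] (G : Matrix m q ℝ) (g : q → ℂ) (x : m) :
    ((G.map Complex.ofRealHom *ᵥ g) x).im = (G *ᵥ fun y => (g y).im) x := by
  simp only [mulVec, dotProduct, map_apply, Complex.ofRealHom_eq_coe, Complex.im_sum, Complex.im_ofReal_mul]

/-- kernel: `‖(G g)(x)‖ ≤ |(G Re g)(x)| + |(G Im g)(x)|` for a real matrix `G`. [folklore] -/
private theorem norm_map_mulVec_le₂ {m q : Type*} [Fintype q] (G : Matrix m q ℝ) (g : q → ℂ) (x : m) :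
    ‖(G.map Complex.ofRealHom *ᵥ g) x‖ ≤ |(G *ᵥ fun y => (g y).re) x| + |(G *ᵥ fun y => (g y).im) x| := by
  rw [← re_map_mulVec₂, ← im_map_mulVec₂]
  exact Complex.norm_le_abs_re_add_abs_im _

/-- kernel: `‖(Ag)(x) − (Bg)(x)‖ ≤ |(A Re g − B Re g)(x)| + |(A Im g − B Im g)(x)|` for real matrices `A`, `B`. [folklore] -/
private theorem norm_sub_map_mulVec_le₂ {m q : Type*} [Fintype q] (A B : Matrix m q ℝ) (g : q → ℂ) (x : m) :
    ‖(A.map Complex.ofRealHom *ᵥ g) x - (B.map Complex.ofRealHom *ᵥ g) x‖ ≤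
      |(A *ᵥ fun y => (g y).re) x - (B *ᵥ fun y => (g y).re) x| + |(A *ᵥ fun y => (g y).im) x - (B *ᵥ fun y => (g y).im) x| := by
  rw [← re_map_mulVec₂, ← re_map_mulVec₂, ← im_map_mulVec₂, ← im_map_mulVec₂, ← Complex.sub_re, ← Complex.sub_im]
  exact Complex.norm_le_abs_re_add_abs_im _

/-- **[6] (1.10), VALUE MEMBER, FOR THE TORUS CUBE PROPAGATORS AT `u = 1^h`, WITH THE SCALE FACTOR `(L^kε)²`** — gen 16's
`decay110_flat_cube` before the weakening `(L^kε)² ≤ 1`: `‖(G_k(□,1^h)f)(x)‖ ≤ (L^kε)²·c₀e^{−δ₀εD}F` (the factor converting [6]'s lattice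
units into the `ε`-units of the torus operator, `G_k(□,1) = (L^kε)²·boxOpR⁻¹` through the chart, `gBox_cube_eq`); it is what makes the
(2.35)/(2.36) constants uniform in `k` in the counting normalization of gen 15's `Δ_{k,loc}`. [cite: Balaban1983RegularityDecay, (1.10) p.573] -/
theorem decay110_flat_cube_scaled (d ℓ : ℕ) (hℓ : 1 ≤ ℓ) {a : ℝ} (ha : 0 < a) :
    ∃ δ₀ c₀ : ℝ, 0 < δ₀ ∧ 0 < c₀ ∧ ∀ (P : Params) (hPd : P.d = d + 1), P.L = ℓ + 1 →
      ∀ k : ℕ, 1 ≤ k → k ≤ P.K → ∀ (c M : Fin (d + 1) → ℕ), (∀ i, 1 ≤ M i) →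
        (∀ i, c i * P.L ^ k + P.L ^ k * M i ≤ P.sitesPerDir 0) → (∀ i, P.L ^ k * M i < P.sitesPerDir 0) →
        ∀ (h : GaugeTransf P 0 U1) (x : Balaban1983to89.Site P 0) (f : Balaban1983to89.Site P 0 → ℂ) (F D : ℝ),
          (∀ y, ‖f y‖ ≤ F) → 0 ≤ D → (∀ y, f y ≠ 0 → D ≤ B5Ineq137Torus.T P 0 x y) →
          ‖(gBox (B1RG242Torus.α P a k * (P.L : ℝ) ^ (k * P.d)) P.eps⁻¹ (gaugeAct h (1 : GaugeField P 0 U1)) k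
              (cubeT hPd (P.L ^ k) c fun i => P.L ^ k * M i) *ᵥ f) x‖ ≤ P.spacing k ^ 2 * (c₀ * Real.exp (-(δ₀ * (P.eps * D))) * F) := by
  obtain ⟨δ₀, c₀, hδ₀, hc₀, H⟩ := B4Thm110ZeroBox.thm110_zero_box_value d ℓ hℓ a a 0 ha
  refine ⟨δ₀, 2 * c₀, hδ₀, by positivity, ?_⟩
  intro P hPd hPL k hk1 hkK c M hM hfit hN h x f F D hF hD hsupp
  have hk : k ≤ P.m + P.K := hkK.trans (Nat.le_add_left _ _)
  have e1 : P.L ^ k = (ℓ + 1) ^ k := by rw [hPL]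
  rw [e1] at hfit hN ⊢
  have hn : (ℓ + 1) ^ k = P.L ^ k := e1.symm
  have hF0 : 0 ≤ F := (norm_nonneg _).trans (hF x)
  have hexp : Real.exp (-(δ₀ * D / ((((ℓ + 1) ^ k : ℕ) : ℝ)))) ≤ Real.exp (-(δ₀ * (P.eps * D))) := by
    have h1 := exp_level_le_exp_eps P hkK hδ₀.le hD
    rwa [e1] at h1
  have hLcast : ((ℓ : ℝ) + 1) = (P.L : ℝ) := by rw [hPL]; push_cast; ring
  have H' := H k hk1 a 0 le_rfl le_rfl le_rfl le_rfl M hM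
  rw [hLcast] at H'
  -- the real estimate for a real source `φ` supported like `f`
  have key : ∀ φ : Balaban1983to89.Site P 0 → ℝ, (∀ y, |φ y| ≤ F) → (∀ y, φ y ≠ 0 → D ≤ B5Ineq137Torus.T P 0 x y) →
      |(gCubeR hPd ((ℓ + 1) ^ k) c M (P.spacing k ^ 2) (B1.aSeq a P.L k) *ᵥ φ) x| ≤
        P.spacing k ^ 2 * (c₀ * Real.exp (-(δ₀ * (P.eps * D))) * F) := by
    intro φ hφ hφs
    by_cases hx : x ∈ cubeT hPd ((ℓ + 1) ^ k) c fun i => (ℓ + 1) ^ k * M i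
    · obtain ⟨z, hz, rfl⟩ := (mem_cubeT hPd).1 hx
      rw [gCubeR_mulVec_cubePt hPd hfit _ _ φ hz, abs_mul, abs_of_nonneg (sq_nonneg _)]
      have hB := H' (fun v => φ (cubePt hPd ((ℓ + 1) ^ k) c (v : Fin (d + 1) → ℤ))) F D (fun v => hφ _) ⟨z, hz⟩
        (fun v hv => (hφs _ hv).trans (T_cubePt_le hPd hfit hz v.2))
      exact mul_le_mul_of_nonneg_left (hB.trans (mul_le_mul_of_nonneg_right (mul_le_mul_of_nonneg_left hexp hc₀.le) hF0)) (sq_nonneg _)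
    · rw [gCubeR_mulVec_of_not_mem hPd _ _ φ hx, abs_zero]
      positivity
  rw [gBox_cube_pureGauge hPd hk1 hk hn hfit hN hM ha h, ← mulVec_mulVec, ← mulVec_mulVec, mulOp_conjTranspose_mulVec, mulOp_mulVec,
    norm_mul, norm_toC, one_mul]
  set g : Balaban1983to89.Site P 0 → ℂ := fun y => (starRingEnd ℂ) (toC (h y)) * f y with hg
  have hgR : ∀ y, |(g y).re| ≤ F := fun y => ((Complex.abs_re_le_norm _).trans_eq (norm_rot h f y)).trans (hF y)
  have hgI : ∀ y, |(g y).im| ≤ F := fun y => ((Complex.abs_im_le_norm _).trans_eq (norm_rot h f y)).trans (hF y)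
  have hsR : ∀ y, (g y).re ≠ 0 → D ≤ B5Ineq137Torus.T P 0 x y := fun y hy =>
    hsupp y fun hf => hy (by simp only [hg, hf, mul_zero, Complex.zero_re])
  have hsI : ∀ y, (g y).im ≠ 0 → D ≤ B5Ineq137Torus.T P 0 x y := fun y hy =>
    hsupp y fun hf => hy (by simp only [hg, hf, mul_zero, Complex.zero_im])
  have hE2 : P.spacing k ^ 2 * (2 * c₀ * Real.exp (-(δ₀ * (P.eps * D))) * F) =
      P.spacing k ^ 2 * (c₀ * Real.exp (-(δ₀ * (P.eps * D))) * F) + P.spacing k ^ 2 * (c₀ * Real.exp (-(δ₀ * (P.eps * D))) * F) := by ring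
  rw [hE2]
  exact (norm_map_mulVec_le₂ _ g x).trans (add_le_add (key _ hgR hsR) (key _ hgI hsI))

/-- **[6] (1.11)–(1.12) AT `A = 0`, VALUE MEMBER, FOR THE NESTED TORUS CUBES AT `u = 1^h`, WITH THE SCALE FACTOR `(L^kε)²`** — the companion
file's `close112_flat_cube` before the weakening `(L^kε)² ≤ 1`: for `x ∈ □ ⊂ Ω₀`, `f` supported in `□`,
`‖(G_k(□,1^h)f)(x) − (G_k(Ω₀,1^h)f)(x)‖ ≤ (L^kε)²·c₀e^{−δ₀εD}e^{−δ₀ε(D_b+D_f)}F`. [cite: Balaban1983RegularityDecay, (1.11)–(1.12) p.573] -/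
theorem close112_flat_cube_scaled (d ℓ : ℕ) (hℓ : 1 ≤ ℓ) {a : ℝ} (ha : 0 < a) :
    ∃ δ₀ c₀ : ℝ, 0 < δ₀ ∧ 0 < c₀ ∧ ∀ (P : Params) (hPd : P.d = d + 1), P.L = ℓ + 1 →
      ∀ k : ℕ, 1 ≤ k → k ≤ P.K → ∀ (c M0 t M : Fin (d + 1) → ℕ), (∀ i, 1 ≤ M i) → (∀ i, t i + M i ≤ M0 i) →
        (∀ i, c i * P.L ^ k + P.L ^ k * M0 i ≤ P.sitesPerDir 0) → (∀ i, P.L ^ k * M0 i < P.sitesPerDir 0) →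
        ∀ (h : GaugeTransf P 0 U1) (x : Balaban1983to89.Site P 0), x ∈ cubeT hPd (P.L ^ k) (c + t) (fun i => P.L ^ k * M i) →
        ∀ (f : Balaban1983to89.Site P 0 → ℂ) (F D Db Df : ℝ), (∀ y, ‖f y‖ ≤ F) →
          (∀ y, y ∉ cubeT hPd (P.L ^ k) (c + t) (fun i => P.L ^ k * M i) → f y = 0) →
          0 ≤ D → (∀ y, f y ≠ 0 → D ≤ B5Ineq137Torus.T P 0 x y) →
          0 ≤ Db → (∀ w ∈ cubeT hPd (P.L ^ k) c (fun i => P.L ^ k * M0 i), w ∉ cubeT hPd (P.L ^ k) (c + t) (fun i => P.L ^ k * M i) →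
            Db ≤ B5Ineq137Torus.T P 0 x w) →
          0 ≤ Df → (∀ y, f y ≠ 0 → ∀ w ∈ cubeT hPd (P.L ^ k) c (fun i => P.L ^ k * M0 i),
            w ∉ cubeT hPd (P.L ^ k) (c + t) (fun i => P.L ^ k * M i) → Df ≤ B5Ineq137Torus.T P 0 y w) →
          ‖(gBox (B1RG242Torus.α P a k * (P.L : ℝ) ^ (k * P.d)) P.eps⁻¹ (gaugeAct h (1 : GaugeField P 0 U1)) k
                (cubeT hPd (P.L ^ k) (c + t) fun i => P.L ^ k * M i) *ᵥ f) x -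
            (gBox (B1RG242Torus.α P a k * (P.L : ℝ) ^ (k * P.d)) P.eps⁻¹ (gaugeAct h (1 : GaugeField P 0 U1)) k
                (cubeT hPd (P.L ^ k) c fun i => P.L ^ k * M0 i) *ᵥ f) x‖ ≤
            P.spacing k ^ 2 * (c₀ * Real.exp (-(δ₀ * (P.eps * D))) * Real.exp (-(δ₀ * (P.eps * (Db + Df)))) * F) := by
  obtain ⟨δ₀, c₀, hδ₀, hc₀, H⟩ := delta112_zero_box_value d ℓ hℓ a a 0 ha
  refine ⟨δ₀, 2 * c₀, hδ₀, by positivity, ?_⟩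
  intro P hPd hPL k hk1 hkK c M0 t M hM hnest hfit0 hN0 h x hx f F D Db Df hF hfs hD hsD hDb hsDb hDf hsDf
  have hk : k ≤ P.m + P.K := hkK.trans (Nat.le_add_left _ _)
  have e1 : P.L ^ k = (ℓ + 1) ^ k := by rw [hPL]
  rw [e1] at hfit0 hN0 hx hfs hsDb hsDf ⊢
  have hn : (ℓ + 1) ^ k = P.L ^ k := e1.symm
  have hfit := fit_of_nested hnest hfit0
  have hN := short_of_nested hnest hN0
  have hM0 := one_le_of_nested hnest hM
  have hF0 : 0 ≤ F := (norm_nonneg _).trans (hF x)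
  have hexp : ∀ E : ℝ, 0 ≤ E → Real.exp (-(δ₀ * E / ((((ℓ + 1) ^ k : ℕ) : ℝ)))) ≤ Real.exp (-(δ₀ * (P.eps * E))) := fun E hE => by
    have h1 := exp_level_le_exp_eps P hkK hδ₀.le hE
    rwa [e1] at h1
  have hLcast : ((ℓ : ℝ) + 1) = (P.L : ℝ) := by rw [hPL]; push_cast; ring
  have H' := H k hk1 a 0 le_rfl le_rfl le_rfl le_rfl M M0 (fun i => (t i : ℤ)) (fits_of_nested hnest) hM
  rw [hLcast] at H'
  obtain ⟨z, hz, rfl⟩ := (mem_cubeT hPd).1 hx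
  have hz0 := add_mem_boxDom_nested (n := (ℓ + 1) ^ k) hnest hz
  have key : ∀ φ : Balaban1983to89.Site P 0 → ℝ, (∀ y, |φ y| ≤ F) →
      (∀ y, y ∉ cubeT hPd ((ℓ + 1) ^ k) (c + t) (fun i => (ℓ + 1) ^ k * M i) → φ y = 0) →
      (∀ y, φ y ≠ 0 → D ≤ B5Ineq137Torus.T P 0 (cubePt hPd ((ℓ + 1) ^ k) (c + t) z) y) →
      (∀ y, φ y ≠ 0 → ∀ w ∈ cubeT hPd ((ℓ + 1) ^ k) c (fun i => (ℓ + 1) ^ k * M0 i),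
        w ∉ cubeT hPd ((ℓ + 1) ^ k) (c + t) (fun i => (ℓ + 1) ^ k * M i) → Df ≤ B5Ineq137Torus.T P 0 y w) →
      |(gCubeR hPd ((ℓ + 1) ^ k) (c + t) M (P.spacing k ^ 2) (B1.aSeq a P.L k) *ᵥ φ) (cubePt hPd ((ℓ + 1) ^ k) (c + t) z) -
          (gCubeR hPd ((ℓ + 1) ^ k) c M0 (P.spacing k ^ 2) (B1.aSeq a P.L k) *ᵥ φ) (cubePt hPd ((ℓ + 1) ^ k) (c + t) z)| ≤
        P.spacing k ^ 2 * (c₀ * Real.exp (-(δ₀ * (P.eps * D))) * Real.exp (-(δ₀ * (P.eps * (Db + Df)))) * F) := by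
    intro φ hφ hφ0 hφD hφDf
    rw [gCubeR_sub_nested_cubePt hPd hfit0 hnest _ _ φ hφ0 hz, abs_mul, abs_of_nonneg (sq_nonneg _)]
    have hB := H' (fun w => φ (cubePt hPd ((ℓ + 1) ^ k) (c + t) (w : Fin (d + 1) → ℤ))) F (fun w => hφ _) ⟨z, hz⟩ D Db Df
      (fun w hw => (hφD _ hw).trans (T_cubePt_le hPd hfit hz w.2))
      (fun y' hy' => by
        have hw : cubePt hPd ((ℓ + 1) ^ k) c (y' : Fin (d + 1) → ℤ) ∈ cubeT hPd ((ℓ + 1) ^ k) c (fun i => (ℓ + 1) ^ k * M0 i) :=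
          cubePt_mem_cubeT hPd y'.2
        have hw' : cubePt hPd ((ℓ + 1) ^ k) c (y' : Fin (d + 1) → ℤ) ∉ cubeT hPd ((ℓ + 1) ^ k) (c + t) (fun i => (ℓ + 1) ^ k * M i) :=
          fun hm => hy' (sub_mem_of_cubePt_mem hPd hfit0 hnest y'.2 hm)
        have h1 := hsDb _ hw hw'
        rw [cubePt_nested hPd] at h1
        exact h1.trans (T_cubePt_le hPd hfit0 hz0 y'.2))
      (fun w hw y' hy' => by
        have hv : cubePt hPd ((ℓ + 1) ^ k) c (y' : Fin (d + 1) → ℤ) ∈ cubeT hPd ((ℓ + 1) ^ k) c (fun i => (ℓ + 1) ^ k * M0 i) :=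
          cubePt_mem_cubeT hPd y'.2
        have hv' : cubePt hPd ((ℓ + 1) ^ k) c (y' : Fin (d + 1) → ℤ) ∉ cubeT hPd ((ℓ + 1) ^ k) (c + t) (fun i => (ℓ + 1) ^ k * M i) :=
          fun hm => hy' (sub_mem_of_cubePt_mem hPd hfit0 hnest y'.2 hm)
        have h1 := hφDf _ hw _ hv hv'
        rw [cubePt_nested hPd] at h1
        exact h1.trans (T_cubePt_le hPd hfit0 (add_mem_boxDom_nested hnest w.2) y'.2))
    have hE : Real.exp (-(δ₀ * Db / ((((ℓ + 1) ^ k : ℕ) : ℝ)) + δ₀ * Df / ((((ℓ + 1) ^ k : ℕ) : ℝ)))) ≤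
        Real.exp (-(δ₀ * (P.eps * (Db + Df)))) := by
      have h1 := hexp Db hDb
      have h2 := hexp Df hDf
      have e2 : -(δ₀ * Db / ((((ℓ + 1) ^ k : ℕ) : ℝ)) + δ₀ * Df / ((((ℓ + 1) ^ k : ℕ) : ℝ))) =
          -(δ₀ * Db / ((((ℓ + 1) ^ k : ℕ) : ℝ))) + -(δ₀ * Df / ((((ℓ + 1) ^ k : ℕ) : ℝ))) := by ring
      have e3 : -(δ₀ * (P.eps * (Db + Df))) = -(δ₀ * (P.eps * Db)) + -(δ₀ * (P.eps * Df)) := by ring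
      rw [e2, e3, Real.exp_add, Real.exp_add]
      exact mul_le_mul h1 h2 (Real.exp_pos _).le (Real.exp_pos _).le
    refine mul_le_mul_of_nonneg_left (hB.trans ?_) (sq_nonneg _)
    refine mul_le_mul_of_nonneg_right ?_ hF0
    exact mul_le_mul (mul_le_mul_of_nonneg_left (hexp D hD) hc₀.le) hE (Real.exp_pos _).le (by positivity)
  rw [gBox_cube_pureGauge hPd hk1 hk hn hfit hN hM ha h, gBox_cube_pureGauge hPd hk1 hk hn hfit0 hN0 hM0 ha h, ← mulVec_mulVec,
    ← mulVec_mulVec, ← mulVec_mulVec, ← mulVec_mulVec, mulOp_conjTranspose_mulVec, mulOp_mulVec, mulOp_mulVec, ← mul_sub, norm_mul,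
    norm_toC, one_mul]
  set g : Balaban1983to89.Site P 0 → ℂ := fun y => (starRingEnd ℂ) (toC (h y)) * f y with hg
  have hgR : ∀ y, |(g y).re| ≤ F := fun y => ((Complex.abs_re_le_norm _).trans_eq (norm_rot h f y)).trans (hF y)
  have hgI : ∀ y, |(g y).im| ≤ F := fun y => ((Complex.abs_im_le_norm _).trans_eq (norm_rot h f y)).trans (hF y)
  have hg0 : ∀ y, f y = 0 → g y = 0 := fun y hf => by simp only [hg, hf, mul_zero]
  have hR0 : ∀ y, y ∉ cubeT hPd ((ℓ + 1) ^ k) (c + t) (fun i => (ℓ + 1) ^ k * M i) → (g y).re = 0 := fun y hy => by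
    rw [hg0 y (hfs y hy), Complex.zero_re]
  have hI0 : ∀ y, y ∉ cubeT hPd ((ℓ + 1) ^ k) (c + t) (fun i => (ℓ + 1) ^ k * M i) → (g y).im = 0 := fun y hy => by
    rw [hg0 y (hfs y hy), Complex.zero_im]
  have hRne : ∀ y, (g y).re ≠ 0 → f y ≠ 0 := fun y hy hf => hy (by rw [hg0 y hf, Complex.zero_re])
  have hIne : ∀ y, (g y).im ≠ 0 → f y ≠ 0 := fun y hy hf => hy (by rw [hg0 y hf, Complex.zero_im])
  have hE2 : P.spacing k ^ 2 * (2 * c₀ * Real.exp (-(δ₀ * (P.eps * D))) * Real.exp (-(δ₀ * (P.eps * (Db + Df)))) * F) =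
      P.spacing k ^ 2 * (c₀ * Real.exp (-(δ₀ * (P.eps * D))) * Real.exp (-(δ₀ * (P.eps * (Db + Df)))) * F) +
        P.spacing k ^ 2 * (c₀ * Real.exp (-(δ₀ * (P.eps * D))) * Real.exp (-(δ₀ * (P.eps * (Db + Df)))) * F) := by ring
  rw [hE2]
  exact (norm_sub_map_mulVec_le₂ _ _ g _).trans (add_le_add
    (key _ hgR hR0 (fun y hy => hsD y (hRne y hy)) (fun y hy => hsDf y (hRne y hy)))
    (key _ hgI hI0 (fun y hy => hsD y (hIne y hy)) (fun y hy => hsDf y (hIne y hy))))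


/-- **(2.30) AT `u = 1^h`, OPERATOR FORM, WITH THE SCALE FACTOR `(L^kε)²`** (the companion file's `opDecay230_flat` before `(L^kε)² ≤ 1`):
`‖(G_{k,loc}(1^h)f)(x)‖ ≤ (L^kε)²·#S·c₀e^{−δ₀εD}‖f‖_∞`. [cite: BalabanImbrieJaffe1988, (2.30) p.263] -/
theorem opDecay230_flat_scaled (d ℓ : ℕ) (hℓ : 1 ≤ ℓ) {a : ℝ} (ha : 0 < a) :
    ∃ δ₀ c₀ : ℝ, 0 < δ₀ ∧ 0 < c₀ ∧ ∀ (P : Params) (hPd : P.d = d + 1), P.L = ℓ + 1 →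
      ∀ k : ℕ, 1 ≤ k → k ≤ P.K → ∀ (ι : Type) [Fintype ι] (cube : ι → Finset (Balaban1983to89.Site P 0))
        (lam : ι → Balaban1983to89.Site P 0 → Balaban1983to89.Site P 0 → ℝ)
        (ζ'' : Balaban1983to89.Site P 0 → Balaban1983to89.Site P 0 → ℝ),
        (∀ α, ∃ c M : Fin (d + 1) → ℕ, (∀ i, 1 ≤ M i) ∧ (∀ i, c i * P.L ^ k + P.L ^ k * M i ≤ P.sitesPerDir 0) ∧
            (∀ i, P.L ^ k * M i < P.sitesPerDir 0) ∧ cube α = cubeT hPd (P.L ^ k) c fun i => P.L ^ k * M i) →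
        (∀ x y, ∑ α, |lam α x y| ≤ 1) → (∀ x y, |ζ'' x y| ≤ 1) →
      ∀ (h : GaugeTransf P 0 U1) (x : Balaban1983to89.Site P 0) (f : Balaban1983to89.Site P 0 → ℂ) (F D : ℝ),
        (∀ y, ‖f y‖ ≤ F) → 0 ≤ D → (∀ y, f y ≠ 0 → D ≤ B5Ineq137Torus.T P 0 x y) →
      ∀ S : Finset ι, (∀ α y, ζ'' x y * lam α x y ≠ 0 → f y ≠ 0 → α ∈ S) →
        ‖(gLocT (B1RG242Torus.α P a k * (P.L : ℝ) ^ (k * P.d)) P.eps⁻¹ (gaugeAct h (1 : GaugeField P 0 U1)) k cube lam ζ'' *ᵥ f) x‖ ≤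
          P.spacing k ^ 2 * (S.card * (c₀ * Real.exp (-(δ₀ * (P.eps * D))) * F)) := by
  obtain ⟨δ₀, c₀, hδ₀, hc₀, H⟩ := decay110_flat_cube_scaled d ℓ hℓ ha
  refine ⟨δ₀, c₀, hδ₀, hc₀, ?_⟩
  intro P hPd hPL k hk1 hkK ι _ cube lam ζ hcube hlam hζ h x f F D hF hD hsupp S hS
  rw [gLocT_mulVec_apply]
  have hterm : ∀ α, ‖(gBox (B1RG242Torus.α P a k * (P.L : ℝ) ^ (k * P.d)) P.eps⁻¹ (gaugeAct h (1 : GaugeField P 0 U1)) k (cube α) *ᵥ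
      fun y => (ζ x y : ℂ) * (lam α x y : ℂ) * f y) x‖ ≤ P.spacing k ^ 2 * (c₀ * Real.exp (-(δ₀ * (P.eps * D))) * F) := by
    intro α
    obtain ⟨c', M, hM, hfit, hN, hc⟩ := hcube α
    rw [hc]
    exact H P hPd hPL k hk1 hkK c' M hM hfit hN h x _ F D (fun y => norm_rowSource_le (hζ x y) (abs_lam_le_one hlam α x y) hF y) hD
      (fun y hy => hsupp y (rowSource_ne_zero hy).2)
  have hzero : ∀ α, α ∉ S → (gBox (B1RG242Torus.α P a k * (P.L : ℝ) ^ (k * P.d)) P.eps⁻¹ (gaugeAct h (1 : GaugeField P 0 U1)) k (cube α) *ᵥ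
      fun y => (ζ x y : ℂ) * (lam α x y : ℂ) * f y) x = 0 := by
    intro α hα
    have h0 : (fun y => (ζ x y : ℂ) * (lam α x y : ℂ) * f y) = 0 := by
      funext y
      by_contra hne
      exact hα (hS α y (rowSource_ne_zero hne).1 (rowSource_ne_zero hne).2)
    rw [h0, mulVec_zero, Pi.zero_apply]
  rw [← Finset.sum_subset (Finset.subset_univ S) (fun α _ hα => hzero α hα)]
  calc ‖∑ α ∈ S, (gBox (B1RG242Torus.α P a k * (P.L : ℝ) ^ (k * P.d)) P.eps⁻¹ (gaugeAct h (1 : GaugeField P 0 U1)) k (cube α) *ᵥ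
          fun y => (ζ x y : ℂ) * (lam α x y : ℂ) * f y) x‖
      ≤ ∑ α ∈ S, ‖(gBox (B1RG242Torus.α P a k * (P.L : ℝ) ^ (k * P.d)) P.eps⁻¹ (gaugeAct h (1 : GaugeField P 0 U1)) k (cube α) *ᵥ
          fun y => (ζ x y : ℂ) * (lam α x y : ℂ) * f y) x‖ := norm_sum_le _ _
    _ ≤ ∑ α ∈ S, P.spacing k ^ 2 * (c₀ * Real.exp (-(δ₀ * (P.eps * D))) * F) := Finset.sum_le_sum fun α _ => hterm α
    _ = P.spacing k ^ 2 * (S.card * (c₀ * Real.exp (-(δ₀ * (P.eps * D))) * F)) := by rw [Finset.sum_const, nsmul_eq_mul]; ring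

/-- kernel: slower rates give larger exponentials, `e^{−δ′E} ≤ e^{−δE}` for `δ ≤ δ′`, `E ≥ 0`. [folklore] -/
private theorem exp_le_exp_of_rate₂ {δ δ' E : ℝ} (hδ : δ ≤ δ') (hE : 0 ≤ E) : Real.exp (-(δ' * E)) ≤ Real.exp (-(δ * E)) :=
  Real.exp_le_exp.2 (neg_le_neg (mul_le_mul_of_nonneg_right hδ hE))

/-- **(2.31) AT `u = 1^h`, OPERATOR FORM, WITH THE SCALE FACTOR `(L^kε)²`** (the companion file's `opClose231_flat` before `(L^kε)² ≤ 1`):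
`‖(G_{k,loc}(1^h)f − G_k(Ω₀,1^h)f)(x)‖ ≤ (L^kε)²·c₀(#S·e^{−2δ₀εR} + e^{−(δ₀/2)εR₁})e^{−(δ₀/2)εD}‖f‖_∞` under the row-`x` hypotheses (i)–(iii).
[cite: BalabanImbrieJaffe1988, (2.31) p.263] -/
theorem opClose231_flat_scaled (d ℓ : ℕ) (hℓ : 1 ≤ ℓ) {a : ℝ} (ha : 0 < a) :
    ∃ δ₀ c₀ : ℝ, 0 < δ₀ ∧ 0 < c₀ ∧ ∀ (P : Params) (hPd : P.d = d + 1), P.L = ℓ + 1 →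
      ∀ k : ℕ, 1 ≤ k → k ≤ P.K → ∀ (c M0 : Fin (d + 1) → ℕ), (∀ i, 1 ≤ M0 i) →
        (∀ i, c i * P.L ^ k + P.L ^ k * M0 i ≤ P.sitesPerDir 0) → (∀ i, P.L ^ k * M0 i < P.sitesPerDir 0) →
      ∀ (ι : Type) [Fintype ι] (cube : ι → Finset (Balaban1983to89.Site P 0))
        (lam : ι → Balaban1983to89.Site P 0 → Balaban1983to89.Site P 0 → ℝ)
        (ζ'' : Balaban1983to89.Site P 0 → Balaban1983to89.Site P 0 → ℝ),
        (∀ α, ∃ t M : Fin (d + 1) → ℕ, (∀ i, 1 ≤ M i) ∧ (∀ i, t i + M i ≤ M0 i) ∧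
            cube α = cubeT hPd (P.L ^ k) (c + t) fun i => P.L ^ k * M i) →
        (∀ x y, ∑ α, |lam α x y| ≤ 1) → (∀ x y, 0 ≤ ζ'' x y ∧ ζ'' x y ≤ 1) →
      ∀ (h : GaugeTransf P 0 U1) (x : Balaban1983to89.Site P 0) (R R₁ : ℝ), 0 ≤ R → 0 ≤ R₁ →
        (∀ y, ζ'' x y ≠ 0 → ∑ α, lam α x y = 1) →
        (∀ α y, ζ'' x y * lam α x y ≠ 0 → x ∈ cube α ∧ y ∈ cube α ∧
            ∀ w ∈ cubeT hPd (P.L ^ k) c (fun i => P.L ^ k * M0 i), w ∉ cube α →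
              R ≤ B5Ineq137Torus.T P 0 x w ∧ R ≤ B5Ineq137Torus.T P 0 y w) →
        (∀ y, B5Ineq137Torus.T P 0 x y ≤ R₁ → ζ'' x y = 1) →
      ∀ (f : Balaban1983to89.Site P 0 → ℂ) (F D : ℝ), (∀ y, ‖f y‖ ≤ F) → 0 ≤ D → (∀ y, f y ≠ 0 → D ≤ B5Ineq137Torus.T P 0 x y) →
      ∀ S : Finset ι, (∀ α y, ζ'' x y * lam α x y ≠ 0 → f y ≠ 0 → α ∈ S) →
        ‖(gLocT (B1RG242Torus.α P a k * (P.L : ℝ) ^ (k * P.d)) P.eps⁻¹ (gaugeAct h (1 : GaugeField P 0 U1)) k cube lam ζ'' *ᵥ f) x -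
            (gBox (B1RG242Torus.α P a k * (P.L : ℝ) ^ (k * P.d)) P.eps⁻¹ (gaugeAct h (1 : GaugeField P 0 U1)) k
              (cubeT hPd (P.L ^ k) c fun i => P.L ^ k * M0 i) *ᵥ f) x‖ ≤
          P.spacing k ^ 2 * (c₀ * (S.card * Real.exp (-(δ₀ * (P.eps * (2 * R)))) + Real.exp (-(δ₀ / 2 * (P.eps * R₁)))) *
            Real.exp (-(δ₀ / 2 * (P.eps * D))) * F) := by
  obtain ⟨δ₁, c₁, hδ₁, hc₁, H1⟩ := close112_flat_cube_scaled d ℓ hℓ ha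
  obtain ⟨δ₂, c₂, hδ₂, hc₂, H2⟩ := decay110_flat_cube_scaled d ℓ hℓ ha
  refine ⟨min δ₁ δ₂, max c₁ c₂, lt_min hδ₁ hδ₂, lt_max_of_lt_left hc₁, ?_⟩
  intro P hPd hPL k hk1 hkK c M0 hM0 hfit0 hN0 ι _ cube lam ζ hcube hlam hζ h x R R₁ hR hR₁ hcomp hdeep hcut f F D hF hD hsupp S hS
  set δ := min δ₁ δ₂ with hδdef
  set C := max c₁ c₂ with hCdef
  have hδ1 : δ ≤ δ₁ := min_le_left _ _
  have hδ2 : δ ≤ δ₂ := min_le_right _ _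
  have hδ0 : 0 ≤ δ := (lt_min hδ₁ hδ₂).le
  have hC1 : c₁ ≤ C := le_max_left _ _
  have hC2 : c₂ ≤ C := le_max_right _ _
  have hC0 : 0 ≤ C := hc₁.le.trans hC1
  have hε : 0 < P.eps := P.eps_pos
  have hF0 : 0 ≤ F := (norm_nonneg _).trans (hF x)
  have hs0 : 0 ≤ P.spacing k ^ 2 := sq_nonneg _
  have hζ1 : ∀ y, |ζ x y| ≤ 1 := fun y => abs_le.2 ⟨by linarith [(hζ x y).1], (hζ x y).2⟩
  set G0 := gBox (B1RG242Torus.α P a k * (P.L : ℝ) ^ (k * P.d)) P.eps⁻¹ (gaugeAct h (1 : GaugeField P 0 U1)) k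
    (cubeT hPd (P.L ^ k) c fun i => P.L ^ k * M0 i) with hG0def
  rw [gLocT_sub_mulVec_apply _ _ _ _ cube lam ζ G0 f x hcomp]
  set B := P.spacing k ^ 2 * (c₁ * Real.exp (-(δ₁ * (P.eps * D))) * Real.exp (-(δ₁ * (P.eps * (R + R)))) * F) with hBdef
  have hB0 : 0 ≤ B := by positivity
  have hterm : ∀ α, ‖((gBox (B1RG242Torus.α P a k * (P.L : ℝ) ^ (k * P.d)) P.eps⁻¹ (gaugeAct h (1 : GaugeField P 0 U1)) k (cube α) - G0) *ᵥ
      fun y => (ζ x y : ℂ) * (lam α x y : ℂ) * f y) x‖ ≤ B := by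
    intro α
    by_cases hex : ∃ y, ζ x y * lam α x y ≠ 0
    · obtain ⟨y₀, hy₀⟩ := hex
      obtain ⟨hxα, -, hwx⟩ := hdeep α y₀ hy₀
      obtain ⟨t, M, hM, hnest, hc⟩ := hcube α
      have hyα : ∀ y, (ζ x y : ℂ) * (lam α x y : ℂ) * f y ≠ 0 → y ∈ cubeT hPd (P.L ^ k) (c + t) (fun i => P.L ^ k * M i) :=
        fun y hy => hc ▸ (hdeep α y (rowSource_ne_zero hy).1).2.1
      have hwy : ∀ y, (ζ x y : ℂ) * (lam α x y : ℂ) * f y ≠ 0 →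
          ∀ w ∈ cubeT hPd (P.L ^ k) c (fun i => P.L ^ k * M0 i), w ∉ cubeT hPd (P.L ^ k) (c + t) (fun i => P.L ^ k * M i) →
            R ≤ B5Ineq137Torus.T P 0 y w :=
        fun y hy w hw hw' => ((hdeep α y (rowSource_ne_zero hy).1).2.2 w hw (hc ▸ hw')).2
      rw [hc] at hxα hwx
      rw [Matrix.sub_mulVec, Pi.sub_apply, hc]
      exact H1 P hPd hPL k hk1 hkK c M0 t M hM hnest hfit0 hN0 h x hxα _ F D R R
        (fun y => norm_rowSource_le (hζ1 y) (abs_lam_le_one hlam α x y) hF y)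
        (fun y hy => by by_contra hne; exact hy (hyα y hne)) hD (fun y hy => hsupp y (rowSource_ne_zero hy).2)
        hR (fun w hw hw' => (hwx w hw hw').1) hR hwy
    · push Not at hex
      have h0 : (fun y => (ζ x y : ℂ) * (lam α x y : ℂ) * f y) = 0 := by
        funext y; rw [← Complex.ofReal_mul, hex y, Complex.ofReal_zero, zero_mul]; rfl
      rw [h0, mulVec_zero, Pi.zero_apply, norm_zero]
      exact hB0
  have hzero : ∀ α, α ∉ S → ((gBox (B1RG242Torus.α P a k * (P.L : ℝ) ^ (k * P.d)) P.eps⁻¹ (gaugeAct h (1 : GaugeField P 0 U1)) k (cube α)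
      - G0) *ᵥ fun y => (ζ x y : ℂ) * (lam α x y : ℂ) * f y) x = 0 := by
    intro α hα
    have h0 : (fun y => (ζ x y : ℂ) * (lam α x y : ℂ) * f y) = 0 := by
      funext y
      by_contra hne
      exact hα (hS α y (rowSource_ne_zero hne).1 (rowSource_ne_zero hne).2)
    rw [h0, mulVec_zero, Pi.zero_apply]
  have hsum : ‖∑ α, ((gBox (B1RG242Torus.α P a k * (P.L : ℝ) ^ (k * P.d)) P.eps⁻¹ (gaugeAct h (1 : GaugeField P 0 U1)) k (cube α) - G0) *ᵥ
      fun y => (ζ x y : ℂ) * (lam α x y : ℂ) * f y) x‖ ≤ S.card * B := by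
    rw [← Finset.sum_subset (Finset.subset_univ S) (fun α _ hα => hzero α hα)]
    calc ‖∑ α ∈ S, ((gBox (B1RG242Torus.α P a k * (P.L : ℝ) ^ (k * P.d)) P.eps⁻¹ (gaugeAct h (1 : GaugeField P 0 U1)) k (cube α) - G0) *ᵥ
            fun y => (ζ x y : ℂ) * (lam α x y : ℂ) * f y) x‖
        ≤ ∑ α ∈ S, ‖((gBox (B1RG242Torus.α P a k * (P.L : ℝ) ^ (k * P.d)) P.eps⁻¹ (gaugeAct h (1 : GaugeField P 0 U1)) k (cube α) - G0) *ᵥ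
            fun y => (ζ x y : ℂ) * (lam α x y : ℂ) * f y) x‖ := norm_sum_le _ _
      _ ≤ ∑ α ∈ S, B := Finset.sum_le_sum fun α _ => hterm α
      _ = S.card * B := by rw [Finset.sum_const, nsmul_eq_mul]
  have htail : ‖(G0 *ᵥ fun y => ((ζ x y : ℂ) - 1) * f y) x‖ ≤ P.spacing k ^ 2 * (c₂ * Real.exp (-(δ₂ * (P.eps * max D R₁))) * F) := by
    refine H2 P hPd hPL k hk1 hkK c M0 hM0 hfit0 hN0 h x _ F (max D R₁) (fun y => ?_) (hD.trans (le_max_left _ _)) (fun y hy => ?_)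
    · have hz1 : ‖(ζ x y : ℂ) - 1‖ ≤ 1 := by
        rw [← Complex.ofReal_one, ← Complex.ofReal_sub, Complex.norm_real, Real.norm_eq_abs, abs_le]
        constructor <;> linarith [(hζ x y).1, (hζ x y).2]
      calc ‖((ζ x y : ℂ) - 1) * f y‖ = ‖(ζ x y : ℂ) - 1‖ * ‖f y‖ := norm_mul _ _
        _ ≤ 1 * F := mul_le_mul hz1 (hF y) (norm_nonneg _) zero_le_one
        _ = F := one_mul F
    · have hf : f y ≠ 0 := fun hf => hy (by rw [hf, mul_zero])
      have hz : ζ x y ≠ 1 := fun h1 => hy (by rw [h1]; push_cast; rw [sub_self, zero_mul])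
      exact max_le (hsupp y hf) (le_of_lt (lt_of_not_ge fun hle => hz (hcut y hle)))
  have hεD : 0 ≤ P.eps * D := mul_nonneg hε.le hD
  have hsum' : (S.card : ℝ) * B ≤
      P.spacing k ^ 2 * (C * (S.card * Real.exp (-(δ * (P.eps * (2 * R))))) * Real.exp (-(δ / 2 * (P.eps * D))) * F) := by
    have h1 : c₁ * Real.exp (-(δ₁ * (P.eps * D))) * Real.exp (-(δ₁ * (P.eps * (R + R)))) * F ≤
        C * Real.exp (-(δ * (P.eps * (2 * R)))) * Real.exp (-(δ / 2 * (P.eps * D))) * F := by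
      rw [mul_assoc c₁, mul_comm (Real.exp _) (Real.exp _), ← mul_assoc c₁]
      refine mul_le_mul_of_nonneg_right (mul_le_mul (mul_le_mul hC1 ?_ (Real.exp_pos _).le hC0) ?_ (Real.exp_pos _).le
        (by positivity)) hF0
      · rw [show R + R = 2 * R by ring]
        exact exp_le_exp_of_rate₂ hδ1 (by positivity)
      · exact exp_le_exp_of_rate₂ (by linarith) hεD
    calc (S.card : ℝ) * B = P.spacing k ^ 2 * (S.card * (c₁ * Real.exp (-(δ₁ * (P.eps * D))) * Real.exp (-(δ₁ * (P.eps * (R + R)))) * F)) := by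
          rw [hBdef]; ring
      _ ≤ P.spacing k ^ 2 * (S.card * (C * Real.exp (-(δ * (P.eps * (2 * R)))) * Real.exp (-(δ / 2 * (P.eps * D))) * F)) :=
          mul_le_mul_of_nonneg_left (mul_le_mul_of_nonneg_left h1 (Nat.cast_nonneg _)) hs0
      _ = P.spacing k ^ 2 * (C * (S.card * Real.exp (-(δ * (P.eps * (2 * R))))) * Real.exp (-(δ / 2 * (P.eps * D))) * F) := by ring
  have htail' : P.spacing k ^ 2 * (c₂ * Real.exp (-(δ₂ * (P.eps * max D R₁))) * F) ≤
      P.spacing k ^ 2 * (C * Real.exp (-(δ / 2 * (P.eps * R₁))) * Real.exp (-(δ / 2 * (P.eps * D))) * F) := by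
    refine mul_le_mul_of_nonneg_left (mul_le_mul_of_nonneg_right ?_ hF0) hs0
    rw [mul_assoc C, ← Real.exp_add]
    refine mul_le_mul hC2 (Real.exp_le_exp.2 ?_) (Real.exp_pos _).le hC0
    have hm1 : D ≤ max D R₁ := le_max_left _ _
    have hm2 : R₁ ≤ max D R₁ := le_max_right _ _
    have hm0 : 0 ≤ P.eps * max D R₁ := mul_nonneg hε.le (hD.trans hm1)
    nlinarith [mul_le_mul_of_nonneg_left hm1 hε.le, mul_le_mul_of_nonneg_left hm2 hε.le, mul_nonneg hδ0 hm0,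
      mul_le_mul_of_nonneg_right hδ2 hm0]
  calc ‖∑ α, ((gBox (B1RG242Torus.α P a k * (P.L : ℝ) ^ (k * P.d)) P.eps⁻¹ (gaugeAct h (1 : GaugeField P 0 U1)) k (cube α) - G0) *ᵥ
            fun y => (ζ x y : ℂ) * (lam α x y : ℂ) * f y) x + (G0 *ᵥ fun y => ((ζ x y : ℂ) - 1) * f y) x‖
      ≤ S.card * B + P.spacing k ^ 2 * (c₂ * Real.exp (-(δ₂ * (P.eps * max D R₁))) * F) :=
        (norm_add_le _ _).trans (add_le_add hsum htail)
    _ ≤ P.spacing k ^ 2 * (C * (S.card * Real.exp (-(δ * (P.eps * (2 * R))))) * Real.exp (-(δ / 2 * (P.eps * D))) * F) +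
        P.spacing k ^ 2 * (C * Real.exp (-(δ / 2 * (P.eps * R₁))) * Real.exp (-(δ / 2 * (P.eps * D))) * F) := add_le_add hsum' htail'
    _ = P.spacing k ^ 2 * (C * (S.card * Real.exp (-(δ * (P.eps * (2 * R)))) + Real.exp (-(δ / 2 * (P.eps * R₁)))) *
        Real.exp (-(δ / 2 * (P.eps * D))) * F) := by ring

end ScaledInputs

/-! ## §2 The `k`-block lattice `T^{(k)}` against the fine torus `T^{(0)}`: `L^k·|y₁ − y₂|_{T^{(k)}} ≤ |x − x′|_{T^{(0)}} + (L^k − 1)` on blocks -/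

section BlockMetric

/-- kernel: **one coordinate** — for labels `v, v′` of the fine torus (period `N·n`) over block labels `v/n, v′/n` (period `N`):
`n·dist(v/n − v′/n, Nℤ) ≤ dist(v − v′, Nnℤ) + (n − 1)`. [cite: BalabanImbrieJaffe1985, (2.4) p.302, dictionary] -/
theorem circAbs_block_le {N n : ℕ} (hN : 1 ≤ N) (hn : 1 ≤ n) (v v' : ℕ) :
    (n : ℤ) * circAbs N (((v / n : ℕ) : ℤ) - ((v' / n : ℕ) : ℤ)) ≤ circAbs (N * n) ((v : ℤ) - (v' : ℤ)) + ((n : ℤ) - 1) := by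
  have hn0 : 0 < n := hn
  have hv : (v : ℤ) = (n : ℤ) * ((v / n : ℕ) : ℤ) + ((v % n : ℕ) : ℤ) := by exact_mod_cast (Nat.div_add_mod v n).symm
  have hv' : (v' : ℤ) = (n : ℤ) * ((v' / n : ℕ) : ℤ) + ((v' % n : ℕ) : ℤ) := by exact_mod_cast (Nat.div_add_mod v' n).symm
  have hr₁ : ((v % n : ℕ) : ℤ) < n := by exact_mod_cast Nat.mod_lt v hn0
  have hr₂ : ((v' % n : ℕ) : ℤ) < n := by exact_mod_cast Nat.mod_lt v' hn0
  have hr₁0 : (0 : ℤ) ≤ ((v % n : ℕ) : ℤ) := Int.natCast_nonneg _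
  have hr₂0 : (0 : ℤ) ≤ ((v' % n : ℕ) : ℤ) := Int.natCast_nonneg _
  have hNn : 1 ≤ N * n := Nat.one_le_iff_ne_zero.2 (Nat.mul_ne_zero (by omega) (by omega))
  set w₁ : ℤ := ((v / n : ℕ) : ℤ)
  set w₂ : ℤ := ((v' / n : ℕ) : ℤ)
  set r₁ : ℤ := ((v % n : ℕ) : ℤ)
  set r₂ : ℤ := ((v' % n : ℕ) : ℤ)
  set m : ℤ := centre (N * n) ((v : ℤ) - (v' : ℤ))
  have hc : |(v : ℤ) - (v' : ℤ) + ((N * n : ℕ) : ℤ) * m| = circAbs (N * n) ((v : ℤ) - (v' : ℤ)) := abs_add_mul_centre hNn _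
  have h1 : circAbs N (w₁ - w₂) ≤ |w₁ - w₂ + (N : ℤ) * m| := by
    rw [← circAbs_add_mul N (w₁ - w₂) m]
    exact circAbs_le_abs hN _
  have h2 : (n : ℤ) * |w₁ - w₂ + (N : ℤ) * m| = |((v : ℤ) - (v' : ℤ) + ((N * n : ℕ) : ℤ) * m) - (r₁ - r₂)| := by
    rw [← abs_of_pos (show (0 : ℤ) < n by exact_mod_cast hn0), ← abs_mul]
    congr 1
    rw [hv, hv']
    push_cast
    ring
  have hr : |r₁ - r₂| ≤ (n : ℤ) - 1 := by
    rw [abs_le]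
    constructor <;> omega
  calc (n : ℤ) * circAbs N (w₁ - w₂) ≤ (n : ℤ) * |w₁ - w₂ + (N : ℤ) * m| := mul_le_mul_of_nonneg_left h1 (Int.natCast_nonneg _)
    _ = |((v : ℤ) - (v' : ℤ) + ((N * n : ℕ) : ℤ) * m) - (r₁ - r₂)| := h2
    _ ≤ |(v : ℤ) - (v' : ℤ) + ((N * n : ℕ) : ℤ) * m| + |r₁ - r₂| := abs_sub _ _
    _ ≤ circAbs (N * n) ((v : ℤ) - (v' : ℤ)) + ((n : ℤ) - 1) := by rw [hc]; exact add_le_add le_rfl hr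

/-- **The `k`-block torus against the fine torus**: for `x ∈ B^k(y₁)`, `x′ ∈ B^k(y₂)` (fine sites over the `k`-block sites `y₁, y₂` of
`T^{(k)}`, p11's `blockK`), `L^k·|y₁ − y₂|_{T^{(k)}} ≤ |x − x′|_{T^{(0)}} + (L^k − 1)` (sup torus metrics in lattice units, p38's
`B5Ineq137Torus.T`) — so `L^kε·|y₁ − y₂|_{T^{(k)}}`, the printed unit-lattice distance of (2.35)–(2.36), is dominated by the fine distance of
any two points of the blocks up to one block. [cite: BalabanImbrieJaffe1985, (2.4) p.302, dictionary] -/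
theorem pow_mul_T_block_le {k : ℕ} (hk : 0 + k ≤ P.m + P.K) {y₁ y₂ : Balaban1983to89.Site P (0 + k)} {x x' : Balaban1983to89.Site P 0}
    (hx : x ∈ blockK k y₁) (hx' : x' ∈ blockK k y₂) :
    ((P.L : ℝ) ^ k) * B5Ineq137Torus.T P (0 + k) y₁ y₂ ≤ B5Ineq137Torus.T P 0 x x' + (((P.L : ℝ) ^ k) - 1) := by
  have hLk : 1 ≤ P.L ^ k := Nat.one_le_pow _ _ P.L_pos
  have hNk : 1 ≤ P.sitesPerDir (0 + k) := (P.one_lt_sitesPerDir (0 + k)).le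
  have hper : P.sitesPerDir 0 = P.sitesPerDir (0 + k) * P.L ^ k := sitesPerDir_eq_mul_pow hk
  have hy₁ : blkIter k x = y₁ := mem_blockK.1 hx
  have hy₂ : blkIter k x' = y₂ := mem_blockK.1 hx'
  -- coordinatewise
  have hcoord : ∀ μ : Fin P.d, ((P.L ^ k : ℕ) : ℤ) *
      ((B4Sect5Torus.ccoord (B5Ineq137Torus.Nv P (0 + k)) (B5Ineq137Torus.toT y₁) (B5Ineq137Torus.toT y₂) μ : ℕ) : ℤ) ≤
        ((B4Sect5Torus.ccoord (B5Ineq137Torus.Nv P 0) (B5Ineq137Torus.toT x) (B5Ineq137Torus.toT x') μ : ℕ) : ℤ) +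
          (((P.L ^ k : ℕ) : ℤ) - 1) := by
    intro μ
    rw [B4Sect5Torus.ccoord_cast (B5Ineq137Torus.Nv_pos P (0 + k)), B4Sect5Torus.ccoord_cast (B5Ineq137Torus.Nv_pos P 0)]
    show ((P.L ^ k : ℕ) : ℤ) * circAbs (P.sitesPerDir (0 + k)) (((y₁ μ).val : ℤ) - ((y₂ μ).val : ℤ)) ≤
      circAbs (P.sitesPerDir 0) (((x μ).val : ℤ) - ((x' μ).val : ℤ)) + (((P.L ^ k : ℕ) : ℤ) - 1)
    rw [← hy₁, ← hy₂, val_blkIter k hk x μ, val_blkIter k hk x' μ]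
    have e := congrArg (fun N : ℕ => circAbs N (((x μ).val : ℤ) - ((x' μ).val : ℤ))) hper
    rw [e]
    exact circAbs_block_le hNk hLk _ _
  -- the sup over the directions
  unfold B5Ineq137Torus.T B4Sect5Torus.tdist
  have hcast : (((P.L ^ k : ℕ) : ℤ) : ℝ) = (P.L : ℝ) ^ k := by push_cast; rfl
  by_cases hne : (Finset.univ : Finset (Fin P.d)).Nonempty
  · obtain ⟨μ, -, hμ⟩ := Finset.exists_mem_eq_sup _ hne
      (B4Sect5Torus.ccoord (B5Ineq137Torus.Nv P (0 + k)) (B5Ineq137Torus.toT y₁) (B5Ineq137Torus.toT y₂))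
    rw [hμ]
    have h1 := hcoord μ
    have h2 : ((B4Sect5Torus.ccoord (B5Ineq137Torus.Nv P 0) (B5Ineq137Torus.toT x) (B5Ineq137Torus.toT x') μ : ℕ) : ℝ) ≤
        ((Finset.univ.sup (B4Sect5Torus.ccoord (B5Ineq137Torus.Nv P 0) (B5Ineq137Torus.toT x) (B5Ineq137Torus.toT x')) : ℕ) : ℝ) := by
      exact_mod_cast Finset.le_sup (f := B4Sect5Torus.ccoord (B5Ineq137Torus.Nv P 0) (B5Ineq137Torus.toT x) (B5Ineq137Torus.toT x'))
        (Finset.mem_univ μ)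
    have h1' : (((P.L ^ k : ℕ) : ℤ) : ℝ) *
        ((B4Sect5Torus.ccoord (B5Ineq137Torus.Nv P (0 + k)) (B5Ineq137Torus.toT y₁) (B5Ineq137Torus.toT y₂) μ : ℕ) : ℝ) ≤
          ((B4Sect5Torus.ccoord (B5Ineq137Torus.Nv P 0) (B5Ineq137Torus.toT x) (B5Ineq137Torus.toT x') μ : ℕ) : ℝ) +
            ((((P.L ^ k : ℕ) : ℤ) : ℝ) - 1) := by exact_mod_cast h1
    rw [hcast] at h1'
    linarith
  · rw [Finset.not_nonempty_iff_eq_empty] at hne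
    rw [hne, Finset.sup_empty, Finset.sup_empty]
    show ((P.L : ℝ) ^ k) * (((⊥ : ℕ) : ℕ) : ℝ) ≤ (((⊥ : ℕ) : ℕ) : ℝ) + (((P.L : ℝ) ^ k) - 1)
    rw [show ((⊥ : ℕ) : ℕ) = 0 from rfl, Nat.cast_zero, mul_zero, zero_add, sub_nonneg]
    exact_mod_cast hLk

/-- kernel: the block lower bound `max(0, L^k|y₁−y₂|_{T^{(k)}} − (L^k − 1))` is dominated by the fine distance of any two points of the
blocks. [cite: BalabanImbrieJaffe1985, (2.4) p.302, dictionary] -/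
theorem blockLower_le_T {k : ℕ} (hk : 0 + k ≤ P.m + P.K) {y₁ y₂ : Balaban1983to89.Site P (0 + k)} {x x' : Balaban1983to89.Site P 0}
    (hx : x ∈ blockK k y₁) (hx' : x' ∈ blockK k y₂) :
    max 0 (((P.L : ℝ) ^ k) * B5Ineq137Torus.T P (0 + k) y₁ y₂ - (((P.L : ℝ) ^ k) - 1)) ≤ B5Ineq137Torus.T P 0 x x' :=
  max_le (B5Ineq137Torus.T_nonneg P 0 x x') (by linarith [pow_mul_T_block_le hk hx hx'])

/-- kernel: **the exponential form** — `e^{−δε·max(0, L^k|y₁−y₂|_{T^{(k)}} − (L^k−1))} ≤ e^{δ}·e^{−δ(L^kε)|y₁−y₂|_{T^{(k)}}}` for `δ ≥ 0`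
(`L^kε ≤ 1`): a fine-lattice decay at the block lower bound is a decay in the printed unit-lattice distance `L^kε|y₁−y₂|_{T^{(k)}}` up to the
factor `e^{δ}`. [cite: BalabanImbrieJaffe1985, (2.4) p.302, dictionary] -/
theorem exp_blockLower_le {k : ℕ} (hkK : k ≤ P.K) (y₁ y₂ : Balaban1983to89.Site P (0 + k)) {δ : ℝ} (hδ : 0 ≤ δ) :
    Real.exp (-(δ * (P.eps * max 0 (((P.L : ℝ) ^ k) * B5Ineq137Torus.T P (0 + k) y₁ y₂ - (((P.L : ℝ) ^ k) - 1))))) ≤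
      Real.exp δ * Real.exp (-(δ * (P.spacing k * B5Ineq137Torus.T P (0 + k) y₁ y₂))) := by
  have hs1 : P.spacing k ≤ 1 := by rw [← P.spacing_K]; exact B4Ineq116Torus.spacing_le_spacing P hkK
  have hs0 : 0 ≤ P.spacing k := (P.spacing_pos k).le
  have hε : 0 ≤ P.eps := P.eps_pos.le
  have hT : 0 ≤ B5Ineq137Torus.T P (0 + k) y₁ y₂ := B5Ineq137Torus.T_nonneg P (0 + k) y₁ y₂
  rw [← Real.exp_add, Real.exp_le_exp]
  have hm : ((P.L : ℝ) ^ k) * B5Ineq137Torus.T P (0 + k) y₁ y₂ - (((P.L : ℝ) ^ k) - 1) ≤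
      max 0 (((P.L : ℝ) ^ k) * B5Ineq137Torus.T P (0 + k) y₁ y₂ - (((P.L : ℝ) ^ k) - 1)) := le_max_right _ _
  have h5 : P.spacing k * B5Ineq137Torus.T P (0 + k) y₁ y₂ - P.spacing k ≤
      P.eps * max 0 (((P.L : ℝ) ^ k) * B5Ineq137Torus.T P (0 + k) y₁ y₂ - (((P.L : ℝ) ^ k) - 1)) := by
    have h6 := mul_le_mul_of_nonneg_left hm hε
    have e : P.eps * (((P.L : ℝ) ^ k) * B5Ineq137Torus.T P (0 + k) y₁ y₂ - (((P.L : ℝ) ^ k) - 1)) =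
        P.spacing k * B5Ineq137Torus.T P (0 + k) y₁ y₂ - P.spacing k + P.eps := by rw [Params.spacing]; ring
    rw [e] at h6
    linarith
  nlinarith [mul_le_mul_of_nonneg_left h5 hδ, mul_le_mul_of_nonneg_left hs1 hδ]

end BlockMetric

/-! ## §3 The sandwich `Q_k(u)·M·Q_k(u)ᴴ` of (2.34): entries as block sums of row sources, and the scale `A = α_kL^{kd}` -/

section Sandwich

/-- kernel: **the entries of `Q·M·Qᴴ` as a `Q`-weighted sum of `M` applied to the row sources `g_{y₂} = conj Q(y₂,·)`**:
`(QMQᴴ)(y₁,y₂) = Σ_x Q(y₁,x)·(M g_{y₂})(x)`. [cite: BalabanImbrieJaffe1988, (2.34) p.263] -/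
theorem qMq_apply {m n : Type*} [Fintype m] [Fintype n] (Q : Matrix m n ℂ) (M : Matrix n n ℂ) (y₁ y₂ : m) :
    (Q * M * Qᴴ) y₁ y₂ = ∑ x, Q y₁ x * (M *ᵥ fun x' => (starRingEnd ℂ) (Q y₂ x')) x := by
  simp only [Matrix.mul_apply, Matrix.conjTranspose_apply, mulVec, dotProduct, Finset.sum_mul, Complex.star_def]
  rw [Finset.sum_comm]
  exact Finset.sum_congr rfl fun x _ => by rw [Finset.mul_sum]; exact Finset.sum_congr rfl fun x' _ => by ring

/-- kernel: **the entries of `Q_k(u)` have modulus `L^{−kd}` on the block and vanish off it** (the transports `u(Γ^{(k)})` are phases).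
[cite: BalabanImbrieJaffe1985, (2.6) p.303] -/
theorem norm_qMatT_apply {j : ℕ} (U : GaugeField P j U1) (k : ℕ) (y : Balaban1983to89.Site P (j + k)) (x : Balaban1983to89.Site P j) :
    ‖qMatT U k y x‖ = if x ∈ blockK k y then ((P.L : ℝ) ^ (k * P.d))⁻¹ else 0 := by
  rw [qMatT_apply]
  split_ifs with h
  · rw [norm_mul, norm_holCK, mul_one, norm_inv, Complex.norm_pow, Complex.norm_natCast]
  · rw [norm_zero]

/-- kernel: `‖Q_k(u)(y,x)‖ ≤ L^{−kd}` everywhere. [cite: BalabanImbrieJaffe1985, (2.6) p.303] -/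
theorem norm_qMatT_apply_le {j : ℕ} (U : GaugeField P j U1) (k : ℕ) (y : Balaban1983to89.Site P (j + k)) (x : Balaban1983to89.Site P j) :
    ‖qMatT U k y x‖ ≤ ((P.L : ℝ) ^ (k * P.d))⁻¹ := by
  rw [norm_qMatT_apply]
  split_ifs
  · exact le_rfl
  · positivity

/-- kernel: the row source `g_{y₂}(x′) = conj Q_k(u)(y₂,x′)` is bounded by `L^{−kd}` and supported in `B^k(y₂)`. [cite: BalabanImbrieJaffe1985, (2.6) p.303] -/
theorem norm_conj_qMatT_le {j : ℕ} (U : GaugeField P j U1) (k : ℕ) (y : Balaban1983to89.Site P (j + k)) (x : Balaban1983to89.Site P j) :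
    ‖(starRingEnd ℂ) (qMatT U k y x)‖ ≤ ((P.L : ℝ) ^ (k * P.d))⁻¹ := by
  rw [Complex.norm_conj]; exact norm_qMatT_apply_le U k y x

/-- kernel: off the block the row source vanishes. [cite: BalabanImbrieJaffe1985, (2.6) p.303] -/
theorem conj_qMatT_ne_zero {j : ℕ} (U : GaugeField P j U1) (k : ℕ) {y : Balaban1983to89.Site P (j + k)} {x : Balaban1983to89.Site P j}
    (h : (starRingEnd ℂ) (qMatT U k y x) ≠ 0) : x ∈ blockK k y := by
  by_contra hx
  apply h
  rw [qMatT_apply, if_neg hx, map_zero]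

/-- **THE BLOCK-SUM BOUND**: if `‖(M g_{y₂})(x)‖ ≤ B` for every `x ∈ B^k(y₁)`, then `‖(Q_k(u)MQ_k(u)ᴴ)(y₁,y₂)‖ ≤ B` (the `L^{kd}` points of
the block against the weight `L^{−kd}` of `Q_k`). [cite: BalabanImbrieJaffe1988, (2.34) p.263] -/
theorem norm_qMq_apply_le {k : ℕ} (hk : 0 + k ≤ P.m + P.K) (U : GaugeField P 0 U1)
    (M : Matrix (Balaban1983to89.Site P 0) (Balaban1983to89.Site P 0) ℂ) (y₁ y₂ : Balaban1983to89.Site P (0 + k)) {B : ℝ}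
    (hB : ∀ x ∈ blockK k y₁, ‖(M *ᵥ fun x' => (starRingEnd ℂ) (qMatT U k y₂ x')) x‖ ≤ B) :
    ‖(qMatT U k * M * (qMatT U k)ᴴ) y₁ y₂‖ ≤ B := by
  rw [qMq_apply]
  have hLpos : (0 : ℝ) < (P.L : ℝ) ^ (k * P.d) := pow_pos P.cast_L_pos _
  calc ‖∑ x, qMatT U k y₁ x * (M *ᵥ fun x' => (starRingEnd ℂ) (qMatT U k y₂ x')) x‖
      ≤ ∑ x, ‖qMatT U k y₁ x * (M *ᵥ fun x' => (starRingEnd ℂ) (qMatT U k y₂ x')) x‖ := norm_sum_le _ _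
    _ = ∑ x ∈ blockK k y₁, ‖qMatT U k y₁ x * (M *ᵥ fun x' => (starRingEnd ℂ) (qMatT U k y₂ x')) x‖ :=
          (Finset.sum_subset (Finset.subset_univ _) (fun x _ hx => by rw [norm_mul, norm_qMatT_apply, if_neg hx, zero_mul])).symm
    _ ≤ ∑ x ∈ blockK k y₁, ((P.L : ℝ) ^ (k * P.d))⁻¹ * B := Finset.sum_le_sum fun x hx => by
          rw [norm_mul, norm_qMatT_apply, if_pos hx]
          exact mul_le_mul_of_nonneg_left (hB x hx) (by positivity)
    _ = B := by
          rw [Finset.sum_const, card_blockK k hk, nsmul_eq_mul]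
          push_cast
          field_simp

/-- kernel: **the scale identity** `(α_kL^{kd})²·L^{−kd}·(L^kε)²·L^{−kd}·… ` — precisely `A²·(L^kε)²·L^{−kd} = A·a_k` for `A = α_kL^{kd}`,
`α_k = a_k(L^kε)^{−2}` (pv07's `B1RG242Torus.α`): the prefactor of the sandwich bounds in units of the identity coefficient `A` of (2.34).
[cite: BalabanImbrieJaffe1988, (2.34) p.263, dictionary] -/
theorem scale_identity (P : Params) (a : ℝ) (k : ℕ) :
    (B1RG242Torus.α P a k * (P.L : ℝ) ^ (k * P.d)) ^ 2 * (((P.L : ℝ) ^ (k * P.d))⁻¹ * P.spacing k ^ 2) =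
      (B1RG242Torus.α P a k * (P.L : ℝ) ^ (k * P.d)) * B1.aSeq a P.L k := by
  have hL : (P.L : ℝ) ^ (k * P.d) ≠ 0 := (pow_pos P.cast_L_pos _).ne'
  have hs : P.spacing k ^ 2 ≠ 0 := (pow_pos (P.spacing_pos k) 2).ne'
  rw [B1RG242Torus.α]
  field_simp

end Sandwich

/-! ## §4 (2.36) at flat backgrounds: the kernels of `Δ_k(Ω₀,1^h)` and `Δ_{k,loc}(1^h)` in the printed unit-lattice distance -/

section Decay236

/-- kernel: the diagonal term `‖A·1(y₁,y₂)‖ = A·[y₁ = y₂]` for `A ≥ 0`. [cite: BalabanImbrieJaffe1988, (2.34) p.263] -/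
theorem norm_coe_mul_one_apply {m : Type*} [DecidableEq m] {A : ℝ} (hA : 0 ≤ A) (y₁ y₂ : m) :
    ‖(A : ℂ) * (1 : Matrix m m ℂ) y₁ y₂‖ = A * (if y₁ = y₂ then 1 else 0) := by
  rw [Matrix.one_apply, norm_mul, Complex.norm_real, Real.norm_eq_abs, abs_of_nonneg hA]
  split_ifs <;> simp

/-- kernel: the entry of gen 15's `Δ_k(Ω,u) = A·1 − A²·Q_k(u)G_k(Ω,u)Q_k(u)ᴴ`. [cite: BalabanImbrieJaffe1988, (2.35) p.263] -/
theorem deltaRegion_apply {j : ℕ} (a' c' : ℝ) (U : GaugeField P j U1) (k : ℕ) (Ω : Finset (Balaban1983to89.Site P j))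
    (y₁ y₂ : Balaban1983to89.Site P (j + k)) :
    deltaRegion a' c' U k Ω y₁ y₂ = (a' : ℂ) * (1 : Matrix _ _ ℂ) y₁ y₂ - ((a' : ℂ) ^ 2) * (qMatT U k * gBox a' c' U k Ω * (qMatT U k)ᴴ) y₁ y₂ := by
  simp only [deltaRegion, Matrix.sub_apply, Matrix.smul_apply, smul_eq_mul]

/-- kernel: the entry of gen 15's `Δ_{k,loc}(u) = A·1 − A²·Q_k(u)G_{k,loc}(u)Q_k(u)ᴴ` (2.34). [cite: BalabanImbrieJaffe1988, (2.34) p.263] -/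
theorem deltaLocT_apply {j : ℕ} (a' c' : ℝ) (U : GaugeField P j U1) (k : ℕ) {ι : Type*} [Fintype ι]
    (cube : ι → Finset (Balaban1983to89.Site P j)) (lam : ι → Balaban1983to89.Site P j → Balaban1983to89.Site P j → ℝ)
    (ζ'' : Balaban1983to89.Site P j → Balaban1983to89.Site P j → ℝ) (y₁ y₂ : Balaban1983to89.Site P (j + k)) :
    deltaLocT a' c' U k cube lam ζ'' y₁ y₂ =
      (a' : ℂ) * (1 : Matrix _ _ ℂ) y₁ y₂ - ((a' : ℂ) ^ 2) * (qMatT U k * gLocT a' c' U k cube lam ζ'' * (qMatT U k)ᴴ) y₁ y₂ := by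
  simp only [deltaLocT, Matrix.sub_apply, Matrix.smul_apply, smul_eq_mul]

/-- kernel: *"Here we have simply replaced G_k(Ω,u) with G_{k,loc}"* — the difference of the two kernels is the sandwich of the difference:
`Δ_{k,loc}(u;y₁,y₂) − Δ_k(Ω,u;y₁,y₂) = −A²·(Q_k(u)(G_{k,loc}(u) − G_k(Ω,u))Q_k(u)ᴴ)(y₁,y₂)`. [cite: BalabanImbrieJaffe1988, (2.35) p.263] -/
theorem deltaLocT_sub_deltaRegion_apply {j : ℕ} (a' c' : ℝ) (U : GaugeField P j U1) (k : ℕ) {ι : Type*} [Fintype ι]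
    (cube : ι → Finset (Balaban1983to89.Site P j)) (lam : ι → Balaban1983to89.Site P j → Balaban1983to89.Site P j → ℝ)
    (ζ'' : Balaban1983to89.Site P j → Balaban1983to89.Site P j → ℝ) (Ω : Finset (Balaban1983to89.Site P j))
    (y₁ y₂ : Balaban1983to89.Site P (j + k)) :
    deltaLocT a' c' U k cube lam ζ'' y₁ y₂ - deltaRegion a' c' U k Ω y₁ y₂ =
      -(((a' : ℂ) ^ 2) * (qMatT U k * (gLocT a' c' U k cube lam ζ'' - gBox a' c' U k Ω) * (qMatT U k)ᴴ) y₁ y₂) := by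
  rw [deltaLocT_apply, deltaRegion_apply, Matrix.mul_sub, Matrix.sub_mul, Matrix.sub_apply]
  ring

/-- **(2.36) FOR THE REGION FORM `Δ_k(Ω₀,1^h)` AT EVERY PURE-GAUGE BACKGROUND, hypothesis-free** (the comparison object of (2.35), [I] (4.6.4)
with the box propagator; print's `|Δ(x₁,x₂)| ≤ ce^{−c|x₁−x₂|}` shape): there are `δ₀, c₀ > 0` depending on `(d, ℓ, a)` only such that for every
box `Ω₀ = c·L^k + Π_i[0, L^kM₀_i)` that fits and is shorter than the torus, every `h` and ALL unit-lattice points `y₁, y₂ ∈ T^{(k)}`: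
`‖Δ_k(Ω₀,1^h; y₁,y₂)‖ ≤ A·([y₁ = y₂] + a_k·c₀·e^{−δ₀(L^kε)|y₁−y₂|_{T^{(k)}}})`, `A = α_kL^{kd}` the identity coefficient of gen 15's
`deltaRegion` (COUNTING NORMALIZATION: gen 15's matrix is `A/a_k = (L^kε)^{−2}L^{kd}` times the printed kernel — `η^{−d}` at `k = K` —, so
the bracket is the printed, `k`-uniform bound), `a_k = B1.aSeq a L k`, `L^kε|y₁−y₂|_{T^{(k)}}` the printed unit-lattice distance — from §1's
(1.10) with the factor `(L^kε)²` and §3's block-sum bound. [cite: BalabanImbrieJaffe1988, (2.36) p.263] -/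
theorem decay236_region_flat (d ℓ : ℕ) (hℓ : 1 ≤ ℓ) {a : ℝ} (ha : 0 < a) :
    ∃ δ₀ c₀ : ℝ, 0 < δ₀ ∧ 0 < c₀ ∧ ∀ (P : Params) (hPd : P.d = d + 1), P.L = ℓ + 1 →
      ∀ k : ℕ, 1 ≤ k → k ≤ P.K → ∀ (c M0 : Fin (d + 1) → ℕ), (∀ i, 1 ≤ M0 i) →
        (∀ i, c i * P.L ^ k + P.L ^ k * M0 i ≤ P.sitesPerDir 0) → (∀ i, P.L ^ k * M0 i < P.sitesPerDir 0) →
      ∀ (h : GaugeTransf P 0 U1) (y₁ y₂ : Balaban1983to89.Site P (0 + k)),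
        ‖deltaRegion (B1RG242Torus.α P a k * (P.L : ℝ) ^ (k * P.d)) P.eps⁻¹ (gaugeAct h (1 : GaugeField P 0 U1)) k
            (cubeT hPd (P.L ^ k) c fun i => P.L ^ k * M0 i) y₁ y₂‖ ≤
          (B1RG242Torus.α P a k * (P.L : ℝ) ^ (k * P.d)) *
            ((if y₁ = y₂ then 1 else 0) + B1.aSeq a P.L k * c₀ * Real.exp (-(δ₀ * (P.spacing k * B5Ineq137Torus.T P (0 + k) y₁ y₂)))) := by
  obtain ⟨δ₀, c₀, hδ₀, hc₀, H⟩ := decay110_flat_cube_scaled d ℓ hℓ ha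
  refine ⟨δ₀, c₀ * Real.exp δ₀, hδ₀, by positivity, ?_⟩
  intro P hPd hPL k hk1 hkK c M0 hM0 hfit0 hN0 h y₁ y₂
  have hk : 0 + k ≤ P.m + P.K := by omega
  set A := B1RG242Torus.α P a k * (P.L : ℝ) ^ (k * P.d) with hAdef
  have hak : 0 < B1.aSeq a P.L k := B1.aSeq_pos ha (B1RG242Torus.one_lt_cast_L P) hk1
  have hα : 0 < B1RG242Torus.α P a k := mul_pos hak (inv_pos.mpr (pow_pos (P.spacing_pos k) 2))
  have hA0 : 0 ≤ A := (mul_pos hα (pow_pos P.cast_L_pos _)).le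
  set G0 := gBox A P.eps⁻¹ (gaugeAct h (1 : GaugeField P 0 U1)) k (cubeT hPd (P.L ^ k) c fun i => P.L ^ k * M0 i) with hG0def
  set Dl := max 0 (((P.L : ℝ) ^ k) * B5Ineq137Torus.T P (0 + k) y₁ y₂ - (((P.L : ℝ) ^ k) - 1)) with hDldef
  have hDl0 : 0 ≤ Dl := le_max_left _ _
  have hSandwich : ‖(qMatT (gaugeAct h (1 : GaugeField P 0 U1)) k * G0 * (qMatT (gaugeAct h (1 : GaugeField P 0 U1)) k)ᴴ) y₁ y₂‖ ≤
      P.spacing k ^ 2 * (c₀ * Real.exp (-(δ₀ * (P.eps * Dl))) * ((P.L : ℝ) ^ (k * P.d))⁻¹) :=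
    norm_qMq_apply_le hk _ G0 y₁ y₂ fun x hx =>
      H P hPd hPL k hk1 hkK c M0 hM0 hfit0 hN0 h x _ _ Dl (fun x' => norm_conj_qMatT_le _ k y₂ x') hDl0
        (fun x' hx' => blockLower_le_T hk hx (conj_qMatT_ne_zero _ k hx'))
  have hexp := exp_blockLower_le hkK y₁ y₂ hδ₀.le
  rw [← hDldef] at hexp
  rw [deltaRegion_apply]
  calc ‖(A : ℂ) * (1 : Matrix _ _ ℂ) y₁ y₂ -
          ((A : ℂ) ^ 2) * (qMatT (gaugeAct h (1 : GaugeField P 0 U1)) k * G0 * (qMatT (gaugeAct h (1 : GaugeField P 0 U1)) k)ᴴ) y₁ y₂‖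
      ≤ ‖(A : ℂ) * (1 : Matrix _ _ ℂ) y₁ y₂‖ +
          ‖((A : ℂ) ^ 2) * (qMatT (gaugeAct h (1 : GaugeField P 0 U1)) k * G0 * (qMatT (gaugeAct h (1 : GaugeField P 0 U1)) k)ᴴ) y₁ y₂‖ :=
        norm_sub_le _ _
    _ ≤ A * (if y₁ = y₂ then 1 else 0) + A ^ 2 * (P.spacing k ^ 2 * (c₀ * Real.exp (-(δ₀ * (P.eps * Dl))) * ((P.L : ℝ) ^ (k * P.d))⁻¹)) := by
        rw [norm_coe_mul_one_apply hA0, norm_mul, norm_pow, Complex.norm_real, Real.norm_eq_abs, abs_of_nonneg hA0]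
        exact add_le_add le_rfl (mul_le_mul_of_nonneg_left hSandwich (sq_nonneg _))
    _ = A * ((if y₁ = y₂ then 1 else 0) + B1.aSeq a P.L k * c₀ * Real.exp (-(δ₀ * (P.eps * Dl)))) := by
        have e := scale_identity P a k
        rw [← hAdef] at e
        calc A * (if y₁ = y₂ then 1 else 0) + A ^ 2 * (P.spacing k ^ 2 * (c₀ * Real.exp (-(δ₀ * (P.eps * Dl))) * ((P.L : ℝ) ^ (k * P.d))⁻¹))
            = A * (if y₁ = y₂ then 1 else 0) + A ^ 2 * (((P.L : ℝ) ^ (k * P.d))⁻¹ * P.spacing k ^ 2) * (c₀ * Real.exp (-(δ₀ * (P.eps * Dl)))) := by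
              ring
          _ = A * ((if y₁ = y₂ then 1 else 0) + B1.aSeq a P.L k * c₀ * Real.exp (-(δ₀ * (P.eps * Dl)))) := by rw [e]; ring
    _ ≤ A * ((if y₁ = y₂ then 1 else 0) +
          B1.aSeq a P.L k * (c₀ * Real.exp δ₀) * Real.exp (-(δ₀ * (P.spacing k * B5Ineq137Torus.T P (0 + k) y₁ y₂)))) := by
        refine mul_le_mul_of_nonneg_left (add_le_add le_rfl ?_) hA0
        calc B1.aSeq a P.L k * c₀ * Real.exp (-(δ₀ * (P.eps * Dl)))
            ≤ B1.aSeq a P.L k * c₀ * (Real.exp δ₀ * Real.exp (-(δ₀ * (P.spacing k * B5Ineq137Torus.T P (0 + k) y₁ y₂)))) :=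
              mul_le_mul_of_nonneg_left hexp (by positivity)
          _ = B1.aSeq a P.L k * (c₀ * Real.exp δ₀) * Real.exp (-(δ₀ * (P.spacing k * B5Ineq137Torus.T P (0 + k) y₁ y₂))) := by ring

/-- **(2.36) AT EVERY PURE-GAUGE BACKGROUND FOR GEN 15's `Δ_{k,loc}`** (*"|Δ_{k,loc}(u;x₁,x₂)| ≤ ce^{−c|x₁−x₂|}, (2.36)"*, p. 263): for gen 15's
`deltaLocT` over ANY finite family of no-wrap cubes shorter than the torus, real weights `Σ_α|λ_α| ≤ 1`, cut-off `|ζ″| ≤ 1`, every `h`, all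
unit-lattice points `y₁, y₂` and every finite set `S` of labels containing the cubes active on the rows `x ∈ B^k(y₁)` (`ζ″(x,y)λ_α(x,y) ≠ 0 ⟹
α ∈ S`; print: *"at most 2^d terms"*): `‖Δ_{k,loc}(1^h; y₁,y₂)‖ ≤ A·([y₁ = y₂] + #S·a_k·c₀·e^{−δ₀(L^kε)|y₁−y₂|_{T^{(k)}}})` in the counting
normalization (`A = α_kL^{kd}`). [cite: BalabanImbrieJaffe1988, (2.36) p.263] -/
theorem decay236_flat (d ℓ : ℕ) (hℓ : 1 ≤ ℓ) {a : ℝ} (ha : 0 < a) :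
    ∃ δ₀ c₀ : ℝ, 0 < δ₀ ∧ 0 < c₀ ∧ ∀ (P : Params) (hPd : P.d = d + 1), P.L = ℓ + 1 →
      ∀ k : ℕ, 1 ≤ k → k ≤ P.K → ∀ (ι : Type) [Fintype ι] (cube : ι → Finset (Balaban1983to89.Site P 0))
        (lam : ι → Balaban1983to89.Site P 0 → Balaban1983to89.Site P 0 → ℝ)
        (ζ'' : Balaban1983to89.Site P 0 → Balaban1983to89.Site P 0 → ℝ),
        (∀ α, ∃ c M : Fin (d + 1) → ℕ, (∀ i, 1 ≤ M i) ∧ (∀ i, c i * P.L ^ k + P.L ^ k * M i ≤ P.sitesPerDir 0) ∧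
            (∀ i, P.L ^ k * M i < P.sitesPerDir 0) ∧ cube α = cubeT hPd (P.L ^ k) c fun i => P.L ^ k * M i) →
        (∀ x y, ∑ α, |lam α x y| ≤ 1) → (∀ x y, |ζ'' x y| ≤ 1) →
      ∀ (h : GaugeTransf P 0 U1) (y₁ y₂ : Balaban1983to89.Site P (0 + k)) (S : Finset ι),
        (∀ x ∈ blockK k y₁, ∀ α y, ζ'' x y * lam α x y ≠ 0 → α ∈ S) →
        ‖deltaLocT (B1RG242Torus.α P a k * (P.L : ℝ) ^ (k * P.d)) P.eps⁻¹ (gaugeAct h (1 : GaugeField P 0 U1)) k cube lam ζ'' y₁ y₂‖ ≤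
          (B1RG242Torus.α P a k * (P.L : ℝ) ^ (k * P.d)) *
            ((if y₁ = y₂ then 1 else 0) +
              S.card * B1.aSeq a P.L k * c₀ * Real.exp (-(δ₀ * (P.spacing k * B5Ineq137Torus.T P (0 + k) y₁ y₂)))) := by
  obtain ⟨δ₀, c₀, hδ₀, hc₀, H⟩ := opDecay230_flat_scaled d ℓ hℓ ha
  refine ⟨δ₀, c₀ * Real.exp δ₀, hδ₀, by positivity, ?_⟩
  intro P hPd hPL k hk1 hkK ι _ cube lam ζ hcube hlam hζ h y₁ y₂ S hS
  have hk : 0 + k ≤ P.m + P.K := by omega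
  set A := B1RG242Torus.α P a k * (P.L : ℝ) ^ (k * P.d) with hAdef
  have hak : 0 < B1.aSeq a P.L k := B1.aSeq_pos ha (B1RG242Torus.one_lt_cast_L P) hk1
  have hα : 0 < B1RG242Torus.α P a k := mul_pos hak (inv_pos.mpr (pow_pos (P.spacing_pos k) 2))
  have hA0 : 0 ≤ A := (mul_pos hα (pow_pos P.cast_L_pos _)).le
  set Gloc := gLocT A P.eps⁻¹ (gaugeAct h (1 : GaugeField P 0 U1)) k cube lam ζ with hGlocdef
  set Dl := max 0 (((P.L : ℝ) ^ k) * B5Ineq137Torus.T P (0 + k) y₁ y₂ - (((P.L : ℝ) ^ k) - 1)) with hDldef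
  have hDl0 : 0 ≤ Dl := le_max_left _ _
  have hSandwich : ‖(qMatT (gaugeAct h (1 : GaugeField P 0 U1)) k * Gloc * (qMatT (gaugeAct h (1 : GaugeField P 0 U1)) k)ᴴ) y₁ y₂‖ ≤
      P.spacing k ^ 2 * (S.card * (c₀ * Real.exp (-(δ₀ * (P.eps * Dl))) * ((P.L : ℝ) ^ (k * P.d))⁻¹)) :=
    norm_qMq_apply_le hk _ Gloc y₁ y₂ fun x hx =>
      H P hPd hPL k hk1 hkK ι cube lam ζ hcube hlam hζ h x _ _ Dl (fun x' => norm_conj_qMatT_le _ k y₂ x') hDl0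
        (fun x' hx' => blockLower_le_T hk hx (conj_qMatT_ne_zero _ k hx')) S (fun α y hαy _ => hS x hx α y hαy)
  have hexp := exp_blockLower_le hkK y₁ y₂ hδ₀.le
  rw [← hDldef] at hexp
  rw [deltaLocT_apply]
  calc ‖(A : ℂ) * (1 : Matrix _ _ ℂ) y₁ y₂ -
          ((A : ℂ) ^ 2) * (qMatT (gaugeAct h (1 : GaugeField P 0 U1)) k * Gloc * (qMatT (gaugeAct h (1 : GaugeField P 0 U1)) k)ᴴ) y₁ y₂‖
      ≤ ‖(A : ℂ) * (1 : Matrix _ _ ℂ) y₁ y₂‖ +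
          ‖((A : ℂ) ^ 2) * (qMatT (gaugeAct h (1 : GaugeField P 0 U1)) k * Gloc * (qMatT (gaugeAct h (1 : GaugeField P 0 U1)) k)ᴴ) y₁ y₂‖ :=
        norm_sub_le _ _
    _ ≤ A * (if y₁ = y₂ then 1 else 0) +
        A ^ 2 * (P.spacing k ^ 2 * (S.card * (c₀ * Real.exp (-(δ₀ * (P.eps * Dl))) * ((P.L : ℝ) ^ (k * P.d))⁻¹))) := by
        rw [norm_coe_mul_one_apply hA0, norm_mul, norm_pow, Complex.norm_real, Real.norm_eq_abs, abs_of_nonneg hA0]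
        exact add_le_add le_rfl (mul_le_mul_of_nonneg_left hSandwich (sq_nonneg _))
    _ = A * ((if y₁ = y₂ then 1 else 0) + S.card * B1.aSeq a P.L k * c₀ * Real.exp (-(δ₀ * (P.eps * Dl)))) := by
        have e := scale_identity P a k
        rw [← hAdef] at e
        calc A * (if y₁ = y₂ then 1 else 0) +
              A ^ 2 * (P.spacing k ^ 2 * (S.card * (c₀ * Real.exp (-(δ₀ * (P.eps * Dl))) * ((P.L : ℝ) ^ (k * P.d))⁻¹)))
            = A * (if y₁ = y₂ then 1 else 0) +
                A ^ 2 * (((P.L : ℝ) ^ (k * P.d))⁻¹ * P.spacing k ^ 2) * (S.card * (c₀ * Real.exp (-(δ₀ * (P.eps * Dl))))) := by ring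
          _ = A * ((if y₁ = y₂ then 1 else 0) + S.card * B1.aSeq a P.L k * c₀ * Real.exp (-(δ₀ * (P.eps * Dl)))) := by rw [e]; ring
    _ ≤ A * ((if y₁ = y₂ then 1 else 0) +
          S.card * B1.aSeq a P.L k * (c₀ * Real.exp δ₀) * Real.exp (-(δ₀ * (P.spacing k * B5Ineq137Torus.T P (0 + k) y₁ y₂)))) := by
        refine mul_le_mul_of_nonneg_left (add_le_add le_rfl ?_) hA0
        calc S.card * B1.aSeq a P.L k * c₀ * Real.exp (-(δ₀ * (P.eps * Dl)))
            ≤ S.card * B1.aSeq a P.L k * c₀ * (Real.exp δ₀ * Real.exp (-(δ₀ * (P.spacing k * B5Ineq137Torus.T P (0 + k) y₁ y₂)))) :=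
              mul_le_mul_of_nonneg_left hexp (by positivity)
          _ = S.card * B1.aSeq a P.L k * (c₀ * Real.exp δ₀) * Real.exp (-(δ₀ * (P.spacing k * B5Ineq137Torus.T P (0 + k) y₁ y₂))) := by
              ring

end Decay236

/-! ## §5 (2.35) at flat backgrounds: `Δ_{k,loc}(1^h)` against `Δ_k(Ω₀,1^h)` deep inside the box -/

section Close235

/-- **(2.35) AT EVERY PURE-GAUGE BACKGROUND** (*"Hence |Δ_{k,loc}(u;x₁,x₂) − Δ_k(Ω,u;x₁,x₂)| ≤ e^{−cr(e_k)}e^{−c|x₁−x₂|} for dist({x₁,x₂},Ω^c)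
> O(r(e_k)), (2.35)"*, p. 263): there are `δ₀, c₀ > 0` depending on `(d, ℓ, a)` only such that, for every box `Ω₀` that fits and is shorter
than the torus, gen 15's `deltaLocT` over any finite family of cubes NESTED IN `Ω₀` (weights `Σ_α|λ_α| ≤ 1`, cut-off `0 ≤ ζ″ ≤ 1`) against
gen 15's `deltaRegion … Ω₀`, every `h`, radii `R, R₁ ≥ 0`, unit-lattice points `y₁, y₂` such that the hypotheses (i)–(iii) of (2.31) hold ON
EVERY ROW `x ∈ B^k(y₁)` (weights complete where `ζ″(x,·)` lives; active cubes containing `x` and `y` at sup-torus distance `≥ R` from `Ω₀∖□_α`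
— the located form of *"dist({x₁,x₂},Ω^c) > O(r(e_k))"*; `ζ″(x,y) = 1` within `R₁`), and every finite `S` containing the cubes active on those
rows: `‖Δ_{k,loc}(1^h;y₁,y₂) − Δ_k(Ω₀,1^h;y₁,y₂)‖ ≤ A·a_k·c₀(#S·e^{−2δ₀εR} + e^{−(δ₀/2)εR₁})·e^{−(δ₀/2)(L^kε)|y₁−y₂|_{T^{(k)}}}` (`A = α_kL^{kd}`
the counting normalization of gen 15; with `R, R₁ = O(r(e_k))` DATA the bracket is the printed `e^{−cr(e_k)}`) — the entrywise identity
`Δ_{k,loc} − Δ_k(Ω₀) = −A²Q_k(G_{k,loc} − G_k(Ω₀))Q_kᴴ`, §1's (2.31) operator form with the factor `(L^kε)²` on the row sources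
`conj Q_k(y₂,·)`, §3's block-sum bound and §2's block metric. [cite: BalabanImbrieJaffe1988, (2.35) p.263] -/
theorem close235_flat (d ℓ : ℕ) (hℓ : 1 ≤ ℓ) {a : ℝ} (ha : 0 < a) :
    ∃ δ₀ c₀ : ℝ, 0 < δ₀ ∧ 0 < c₀ ∧ ∀ (P : Params) (hPd : P.d = d + 1), P.L = ℓ + 1 →
      ∀ k : ℕ, 1 ≤ k → k ≤ P.K → ∀ (c M0 : Fin (d + 1) → ℕ), (∀ i, 1 ≤ M0 i) →
        (∀ i, c i * P.L ^ k + P.L ^ k * M0 i ≤ P.sitesPerDir 0) → (∀ i, P.L ^ k * M0 i < P.sitesPerDir 0) →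
      ∀ (ι : Type) [Fintype ι] (cube : ι → Finset (Balaban1983to89.Site P 0))
        (lam : ι → Balaban1983to89.Site P 0 → Balaban1983to89.Site P 0 → ℝ)
        (ζ'' : Balaban1983to89.Site P 0 → Balaban1983to89.Site P 0 → ℝ),
        (∀ α, ∃ t M : Fin (d + 1) → ℕ, (∀ i, 1 ≤ M i) ∧ (∀ i, t i + M i ≤ M0 i) ∧
            cube α = cubeT hPd (P.L ^ k) (c + t) fun i => P.L ^ k * M i) →
        (∀ x y, ∑ α, |lam α x y| ≤ 1) → (∀ x y, 0 ≤ ζ'' x y ∧ ζ'' x y ≤ 1) →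
      ∀ (h : GaugeTransf P 0 U1) (R R₁ : ℝ), 0 ≤ R → 0 ≤ R₁ → ∀ (y₁ y₂ : Balaban1983to89.Site P (0 + k)),
        (∀ x ∈ blockK k y₁, ∀ y, ζ'' x y ≠ 0 → ∑ α, lam α x y = 1) →
        (∀ x ∈ blockK k y₁, ∀ α y, ζ'' x y * lam α x y ≠ 0 → x ∈ cube α ∧ y ∈ cube α ∧
            ∀ w ∈ cubeT hPd (P.L ^ k) c (fun i => P.L ^ k * M0 i), w ∉ cube α →
              R ≤ B5Ineq137Torus.T P 0 x w ∧ R ≤ B5Ineq137Torus.T P 0 y w) →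
        (∀ x ∈ blockK k y₁, ∀ y, B5Ineq137Torus.T P 0 x y ≤ R₁ → ζ'' x y = 1) →
      ∀ S : Finset ι, (∀ x ∈ blockK k y₁, ∀ α y, ζ'' x y * lam α x y ≠ 0 → α ∈ S) →
        ‖deltaLocT (B1RG242Torus.α P a k * (P.L : ℝ) ^ (k * P.d)) P.eps⁻¹ (gaugeAct h (1 : GaugeField P 0 U1)) k cube lam ζ'' y₁ y₂ -
            deltaRegion (B1RG242Torus.α P a k * (P.L : ℝ) ^ (k * P.d)) P.eps⁻¹ (gaugeAct h (1 : GaugeField P 0 U1)) k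
              (cubeT hPd (P.L ^ k) c fun i => P.L ^ k * M0 i) y₁ y₂‖ ≤
          (B1RG242Torus.α P a k * (P.L : ℝ) ^ (k * P.d)) * (B1.aSeq a P.L k * c₀ *
            (S.card * Real.exp (-(δ₀ * (P.eps * (2 * R)))) + Real.exp (-(δ₀ / 2 * (P.eps * R₁)))) *
              Real.exp (-(δ₀ / 2 * (P.spacing k * B5Ineq137Torus.T P (0 + k) y₁ y₂)))) := by
  obtain ⟨δ₀, c₀, hδ₀, hc₀, H⟩ := opClose231_flat_scaled d ℓ hℓ ha
  refine ⟨δ₀, c₀ * Real.exp (δ₀ / 2), hδ₀, by positivity, ?_⟩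
  intro P hPd hPL k hk1 hkK c M0 hM0 hfit0 hN0 ι _ cube lam ζ hcube hlam hζ h R R₁ hR hR₁ y₁ y₂ hcomp hdeep hcut S hS
  have hk : 0 + k ≤ P.m + P.K := by omega
  set A := B1RG242Torus.α P a k * (P.L : ℝ) ^ (k * P.d) with hAdef
  have hak : 0 < B1.aSeq a P.L k := B1.aSeq_pos ha (B1RG242Torus.one_lt_cast_L P) hk1
  have hα : 0 < B1RG242Torus.α P a k := mul_pos hak (inv_pos.mpr (pow_pos (P.spacing_pos k) 2))
  have hA0 : 0 ≤ A := (mul_pos hα (pow_pos P.cast_L_pos _)).le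
  set Gloc := gLocT A P.eps⁻¹ (gaugeAct h (1 : GaugeField P 0 U1)) k cube lam ζ with hGlocdef
  set G0 := gBox A P.eps⁻¹ (gaugeAct h (1 : GaugeField P 0 U1)) k (cubeT hPd (P.L ^ k) c fun i => P.L ^ k * M0 i) with hG0def
  set Dl := max 0 (((P.L : ℝ) ^ k) * B5Ineq137Torus.T P (0 + k) y₁ y₂ - (((P.L : ℝ) ^ k) - 1)) with hDldef
  have hDl0 : 0 ≤ Dl := le_max_left _ _
  set E := c₀ * (S.card * Real.exp (-(δ₀ * (P.eps * (2 * R)))) + Real.exp (-(δ₀ / 2 * (P.eps * R₁)))) with hEdef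
  have hE0 : 0 ≤ E := by positivity
  have hSandwich : ‖(qMatT (gaugeAct h (1 : GaugeField P 0 U1)) k * (Gloc - G0) * (qMatT (gaugeAct h (1 : GaugeField P 0 U1)) k)ᴴ) y₁ y₂‖ ≤
      P.spacing k ^ 2 * (E * Real.exp (-(δ₀ / 2 * (P.eps * Dl))) * ((P.L : ℝ) ^ (k * P.d))⁻¹) := by
    refine norm_qMq_apply_le hk _ (Gloc - G0) y₁ y₂ fun x hx => ?_
    rw [Matrix.sub_mulVec, Pi.sub_apply]
    exact H P hPd hPL k hk1 hkK c M0 hM0 hfit0 hN0 ι cube lam ζ hcube hlam hζ h x R R₁ hR hR₁ (hcomp x hx) (hdeep x hx) (hcut x hx)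
      _ _ Dl (fun x' => norm_conj_qMatT_le _ k y₂ x') hDl0 (fun x' hx' => blockLower_le_T hk hx (conj_qMatT_ne_zero _ k hx'))
      S (fun α y hαy _ => hS x hx α y hαy)
  have hexp := exp_blockLower_le hkK y₁ y₂ (half_pos hδ₀).le
  rw [← hDldef] at hexp
  rw [deltaLocT_sub_deltaRegion_apply, norm_neg, norm_mul, norm_pow, Complex.norm_real, Real.norm_eq_abs, abs_of_nonneg hA0]
  have e := scale_identity P a k
  rw [← hAdef] at e
  calc A ^ 2 * ‖(qMatT (gaugeAct h (1 : GaugeField P 0 U1)) k * (Gloc - G0) * (qMatT (gaugeAct h (1 : GaugeField P 0 U1)) k)ᴴ) y₁ y₂‖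
      ≤ A ^ 2 * (P.spacing k ^ 2 * (E * Real.exp (-(δ₀ / 2 * (P.eps * Dl))) * ((P.L : ℝ) ^ (k * P.d))⁻¹)) :=
        mul_le_mul_of_nonneg_left hSandwich (sq_nonneg _)
    _ = A ^ 2 * (((P.L : ℝ) ^ (k * P.d))⁻¹ * P.spacing k ^ 2) * (E * Real.exp (-(δ₀ / 2 * (P.eps * Dl)))) := by ring
    _ = A * B1.aSeq a P.L k * (E * Real.exp (-(δ₀ / 2 * (P.eps * Dl)))) := by rw [e]
    _ ≤ A * B1.aSeq a P.L k * (E * (Real.exp (δ₀ / 2) * Real.exp (-(δ₀ / 2 * (P.spacing k * B5Ineq137Torus.T P (0 + k) y₁ y₂))))) :=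
        mul_le_mul_of_nonneg_left (mul_le_mul_of_nonneg_left hexp hE0) (mul_nonneg hA0 hak.le)
    _ = A * (B1.aSeq a P.L k * (c₀ * Real.exp (δ₀ / 2)) *
          (S.card * Real.exp (-(δ₀ * (P.eps * (2 * R)))) + Real.exp (-(δ₀ / 2 * (P.eps * R₁)))) *
            Real.exp (-(δ₀ / 2 * (P.spacing k * B5Ineq137Torus.T P (0 + k) y₁ y₂)))) := by rw [hEdef]; ring

end Close235

/-! ## §6 (2.37) in the torus metric: the kernel of `Δ_{k,loc}(u)` vanishes one block beyond the range of the cut-off `ζ″` -/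

section Vanishes237

/-- **(2.37), METRIC FORM** (*"Δ_{k,loc}(u;x₁,x₂) = 0 if |x₁ − x₂| ≧ (1/2L) r(e_{k−1}). (2.37)"*, p. 263): for ANY background `u`, if the cut-off
`ζ″(x,x′)` vanishes at fine sup-torus distance `≥ R₀ > 0` ((2.29): `R₀ = (1/4L)r(e_{k−1})/ε`), then gen 15's `Δ_{k,loc}(u;y₁,y₂) = 0` as soon as
`L^k|y₁−y₂|_{T^{(k)}} ≥ R₀ + (L^k − 1)` — the printed radius plus one block (`L^kε` in physical units), by gen 15's combinatorial core
`deltaLocT_apply_eq_zero` and §2's block metric. [cite: BalabanImbrieJaffe1988, (2.37) p.263] -/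
theorem vanishes237_metric {k : ℕ} (hk : 0 + k ≤ P.m + P.K) (a' c' : ℝ) (U : GaugeField P 0 U1) {ι : Type*} [Fintype ι]
    (cube : ι → Finset (Balaban1983to89.Site P 0)) (lam : ι → Balaban1983to89.Site P 0 → Balaban1983to89.Site P 0 → ℝ)
    (ζ'' : Balaban1983to89.Site P 0 → Balaban1983to89.Site P 0 → ℝ) {R₀ : ℝ} (hR₀ : 0 < R₀)
    (hζ0 : ∀ x x', R₀ ≤ B5Ineq137Torus.T P 0 x x' → ζ'' x x' = 0) {y₁ y₂ : Balaban1983to89.Site P (0 + k)}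
    (hfar : R₀ + (((P.L : ℝ) ^ k) - 1) ≤ ((P.L : ℝ) ^ k) * B5Ineq137Torus.T P (0 + k) y₁ y₂) :
    deltaLocT a' c' U k cube lam ζ'' y₁ y₂ = 0 := by
  have hLk : (1 : ℝ) ≤ (P.L : ℝ) ^ k := one_le_pow₀ (by exact_mod_cast P.L_pos)
  have hy : y₁ ≠ y₂ := by
    rintro rfl
    rw [B5Ineq137Torus.T_self, mul_zero] at hfar
    linarith
  exact deltaLocT_apply_eq_zero a' c' U k cube lam ζ'' hy fun x₁ h1 x₂ h2 =>
    hζ0 x₁ x₂ (by linarith [pow_mul_T_block_le hk h1 h2])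

end Vanishes237

/-! ## §7 Level-`k` units (the lane owner's UNITS NOTE): §1, §4 and §5 with the printed exponents `e^{−δ₀D/L^k}` and `e^{−δ₀|y₁−y₂|_{T^{(k)}}}`

The members of §1–§5 (and of the companion file) carry the fine-lattice rate `ε = P.eps` in their exponents (`e^{−δ₀εD}`, `e^{−δ₀(L^kε)|y₁−y₂|}`):
sharp at the last level `k = K` (`L^Kε = 1`) and, for `k < K`, the weakening `1/L^k ≥ ε` (`exp_level_le_exp_eps`) of what [6] prints.  Below,
the SAME zero-field box theorems of [6] (`thm110_zero_box_value`, `delta112_zero_box_value`: exponent `e^{−δ₀D/(ℓ+1)^k}`) are re-read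
WITHOUT that weakening: every member of this section has the exponent `e^{−δ₀D/L^k}` — `D/L^k` is the sup-torus distance in the `η = L^{−k}`-units of
the level-`k` fine lattice `T_η` of the print — and, after the block metric of §2 read in level-`k` units (`exp_blockLower_level_le`), the
kernels of `Δ_k(Ω₀,1^h)`, `Δ_{k,loc}(1^h)` and their difference decay in the unit-lattice distance `|y₁−y₂|_{T^{(k)}}` itself, with constants
depending on `(d, ℓ, a)` only: the printed (2.30)/(2.31)/(2.35)/(2.36) inputs AT EVERY LEVEL `k ≤ K`. -/

section LevelUnits


/-- **[6] (1.10), VALUE MEMBER, FOR THE TORUS CUBE PROPAGATORS AT `u = 1^h`, IN LEVEL-`k` UNITS** (print's `η`-lattice units,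
`η = L^{−k}`: the owner's UNITS NOTE 2026-08-22T16:02Z): `‖(G_k(□,1^h)f)(x)‖ ≤ (L^kε)²·c₀e^{−δ₀D/L^k}F` — p38's zero-field box theorem read
WITHOUT the weakening `e^{−δ₀D/L^k} ≤ e^{−δ₀εD}` of gen 16 / §1, so the rate `δ₀` is the printed, `k`-uniform one in the units of `T_η` at
EVERY level (the `ε`-forms are the case `k = K` and follow for `k < K` from `1/L^k ≥ ε`). [cite: Balaban1983RegularityDecay, (1.10) p.573] -/
theorem decay110_flat_cube_level (d ℓ : ℕ) (hℓ : 1 ≤ ℓ) {a : ℝ} (ha : 0 < a) :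
    ∃ δ₀ c₀ : ℝ, 0 < δ₀ ∧ 0 < c₀ ∧ ∀ (P : Params) (hPd : P.d = d + 1), P.L = ℓ + 1 →
      ∀ k : ℕ, 1 ≤ k → k ≤ P.K → ∀ (c M : Fin (d + 1) → ℕ), (∀ i, 1 ≤ M i) →
        (∀ i, c i * P.L ^ k + P.L ^ k * M i ≤ P.sitesPerDir 0) → (∀ i, P.L ^ k * M i < P.sitesPerDir 0) →
        ∀ (h : GaugeTransf P 0 U1) (x : Balaban1983to89.Site P 0) (f : Balaban1983to89.Site P 0 → ℂ) (F D : ℝ),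
          (∀ y, ‖f y‖ ≤ F) → (∀ y, f y ≠ 0 → D ≤ B5Ineq137Torus.T P 0 x y) →
          ‖(gBox (B1RG242Torus.α P a k * (P.L : ℝ) ^ (k * P.d)) P.eps⁻¹ (gaugeAct h (1 : GaugeField P 0 U1)) k
              (cubeT hPd (P.L ^ k) c fun i => P.L ^ k * M i) *ᵥ f) x‖ ≤ P.spacing k ^ 2 * (c₀ * Real.exp (-(δ₀ * (((P.L : ℝ) ^ k)⁻¹ * D))) * F) := by
  obtain ⟨δ₀, c₀, hδ₀, hc₀, H⟩ := B4Thm110ZeroBox.thm110_zero_box_value d ℓ hℓ a a 0 ha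
  refine ⟨δ₀, 2 * c₀, hδ₀, by positivity, ?_⟩
  intro P hPd hPL k hk1 hkK c M hM hfit hN h x f F D hF hsupp
  have hF0 : 0 ≤ F := (norm_nonneg _).trans (hF x)
  have hk : k ≤ P.m + P.K := hkK.trans (Nat.le_add_left _ _)
  have e1 : P.L ^ k = (ℓ + 1) ^ k := by rw [hPL]
  rw [e1] at hfit hN ⊢
  have hn : (ℓ + 1) ^ k = P.L ^ k := e1.symm
  have hncast : (((ℓ + 1) ^ k : ℕ) : ℝ) = (P.L : ℝ) ^ k := by rw [hn, Nat.cast_pow]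
  have hconv : ∀ E : ℝ, Real.exp (-(δ₀ * E / ((((ℓ + 1) ^ k : ℕ) : ℝ)))) = Real.exp (-(δ₀ * (((P.L : ℝ) ^ k)⁻¹ * E))) := fun E => by
    congr 1
    rw [hncast, div_eq_mul_inv]
    ring
  have hLcast : ((ℓ : ℝ) + 1) = (P.L : ℝ) := by rw [hPL]; push_cast; ring
  have H' := H k hk1 a 0 le_rfl le_rfl le_rfl le_rfl M hM
  rw [hLcast] at H'
  -- the real estimate for a real source `φ` supported like `f`
  have key : ∀ φ : Balaban1983to89.Site P 0 → ℝ, (∀ y, |φ y| ≤ F) → (∀ y, φ y ≠ 0 → D ≤ B5Ineq137Torus.T P 0 x y) →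
      |(gCubeR hPd ((ℓ + 1) ^ k) c M (P.spacing k ^ 2) (B1.aSeq a P.L k) *ᵥ φ) x| ≤
        P.spacing k ^ 2 * (c₀ * Real.exp (-(δ₀ * (((P.L : ℝ) ^ k)⁻¹ * D))) * F) := by
    intro φ hφ hφs
    by_cases hx : x ∈ cubeT hPd ((ℓ + 1) ^ k) c fun i => (ℓ + 1) ^ k * M i
    · obtain ⟨z, hz, rfl⟩ := (mem_cubeT hPd).1 hx
      rw [gCubeR_mulVec_cubePt hPd hfit _ _ φ hz, abs_mul, abs_of_nonneg (sq_nonneg _)]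
      have hB := H' (fun v => φ (cubePt hPd ((ℓ + 1) ^ k) c (v : Fin (d + 1) → ℤ))) F D (fun v => hφ _) ⟨z, hz⟩
        (fun v hv => (hφs _ hv).trans (T_cubePt_le hPd hfit hz v.2))
      rw [hconv D] at hB
      exact mul_le_mul_of_nonneg_left hB (sq_nonneg _)
    · rw [gCubeR_mulVec_of_not_mem hPd _ _ φ hx, abs_zero]
      positivity
  rw [gBox_cube_pureGauge hPd hk1 hk hn hfit hN hM ha h, ← mulVec_mulVec, ← mulVec_mulVec, mulOp_conjTranspose_mulVec, mulOp_mulVec,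
    norm_mul, norm_toC, one_mul]
  set g : Balaban1983to89.Site P 0 → ℂ := fun y => (starRingEnd ℂ) (toC (h y)) * f y with hg
  have hgR : ∀ y, |(g y).re| ≤ F := fun y => ((Complex.abs_re_le_norm _).trans_eq (norm_rot h f y)).trans (hF y)
  have hgI : ∀ y, |(g y).im| ≤ F := fun y => ((Complex.abs_im_le_norm _).trans_eq (norm_rot h f y)).trans (hF y)
  have hsR : ∀ y, (g y).re ≠ 0 → D ≤ B5Ineq137Torus.T P 0 x y := fun y hy =>
    hsupp y fun hf => hy (by simp only [hg, hf, mul_zero, Complex.zero_re])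
  have hsI : ∀ y, (g y).im ≠ 0 → D ≤ B5Ineq137Torus.T P 0 x y := fun y hy =>
    hsupp y fun hf => hy (by simp only [hg, hf, mul_zero, Complex.zero_im])
  have hE2 : P.spacing k ^ 2 * (2 * c₀ * Real.exp (-(δ₀ * (((P.L : ℝ) ^ k)⁻¹ * D))) * F) =
      P.spacing k ^ 2 * (c₀ * Real.exp (-(δ₀ * (((P.L : ℝ) ^ k)⁻¹ * D))) * F) + P.spacing k ^ 2 * (c₀ * Real.exp (-(δ₀ * (((P.L : ℝ) ^ k)⁻¹ * D))) * F) := by ring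
  rw [hE2]
  exact (norm_map_mulVec_le₂ _ g x).trans (add_le_add (key _ hgR hsR) (key _ hgI hsI))

/-- **[6] (1.11)–(1.12) AT `A = 0`, VALUE MEMBER, FOR THE NESTED TORUS CUBES AT `u = 1^h`, IN LEVEL-`k` UNITS**: for `x ∈ □ ⊂ Ω₀`, `f`
supported in `□`, `‖(G_k(□,1^h)f)(x) − (G_k(Ω₀,1^h)f)(x)‖ ≤ (L^kε)²·c₀e^{−δ₀D/L^k}e^{−δ₀(D_b+D_f)/L^k}F` — r01/b04's exponent kept as printed
(no `1/L^k ≥ ε` weakening; any reals `D, D_b, D_f` dominated by the sup-torus distances, as in `delta112_zero_box_value`).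
[cite: Balaban1983RegularityDecay, (1.11)–(1.12) p.573] -/
theorem close112_flat_cube_level (d ℓ : ℕ) (hℓ : 1 ≤ ℓ) {a : ℝ} (ha : 0 < a) :
    ∃ δ₀ c₀ : ℝ, 0 < δ₀ ∧ 0 < c₀ ∧ ∀ (P : Params) (hPd : P.d = d + 1), P.L = ℓ + 1 →
      ∀ k : ℕ, 1 ≤ k → k ≤ P.K → ∀ (c M0 t M : Fin (d + 1) → ℕ), (∀ i, 1 ≤ M i) → (∀ i, t i + M i ≤ M0 i) →
        (∀ i, c i * P.L ^ k + P.L ^ k * M0 i ≤ P.sitesPerDir 0) → (∀ i, P.L ^ k * M0 i < P.sitesPerDir 0) →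
        ∀ (h : GaugeTransf P 0 U1) (x : Balaban1983to89.Site P 0), x ∈ cubeT hPd (P.L ^ k) (c + t) (fun i => P.L ^ k * M i) →
        ∀ (f : Balaban1983to89.Site P 0 → ℂ) (F D Db Df : ℝ), (∀ y, ‖f y‖ ≤ F) →
          (∀ y, y ∉ cubeT hPd (P.L ^ k) (c + t) (fun i => P.L ^ k * M i) → f y = 0) →
          (∀ y, f y ≠ 0 → D ≤ B5Ineq137Torus.T P 0 x y) →
          (∀ w ∈ cubeT hPd (P.L ^ k) c (fun i => P.L ^ k * M0 i), w ∉ cubeT hPd (P.L ^ k) (c + t) (fun i => P.L ^ k * M i) →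
            Db ≤ B5Ineq137Torus.T P 0 x w) →
          (∀ y, f y ≠ 0 → ∀ w ∈ cubeT hPd (P.L ^ k) c (fun i => P.L ^ k * M0 i),
            w ∉ cubeT hPd (P.L ^ k) (c + t) (fun i => P.L ^ k * M i) → Df ≤ B5Ineq137Torus.T P 0 y w) →
          ‖(gBox (B1RG242Torus.α P a k * (P.L : ℝ) ^ (k * P.d)) P.eps⁻¹ (gaugeAct h (1 : GaugeField P 0 U1)) k
                (cubeT hPd (P.L ^ k) (c + t) fun i => P.L ^ k * M i) *ᵥ f) x -
            (gBox (B1RG242Torus.α P a k * (P.L : ℝ) ^ (k * P.d)) P.eps⁻¹ (gaugeAct h (1 : GaugeField P 0 U1)) k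
                (cubeT hPd (P.L ^ k) c fun i => P.L ^ k * M0 i) *ᵥ f) x‖ ≤
            P.spacing k ^ 2 * (c₀ * Real.exp (-(δ₀ * (((P.L : ℝ) ^ k)⁻¹ * D))) * Real.exp (-(δ₀ * (((P.L : ℝ) ^ k)⁻¹ * (Db + Df)))) * F) := by
  obtain ⟨δ₀, c₀, hδ₀, hc₀, H⟩ := delta112_zero_box_value d ℓ hℓ a a 0 ha
  refine ⟨δ₀, 2 * c₀, hδ₀, by positivity, ?_⟩
  intro P hPd hPL k hk1 hkK c M0 t M hM hnest hfit0 hN0 h x hx f F D Db Df hF hfs hsD hsDb hsDf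
  have hk : k ≤ P.m + P.K := hkK.trans (Nat.le_add_left _ _)
  have e1 : P.L ^ k = (ℓ + 1) ^ k := by rw [hPL]
  rw [e1] at hfit0 hN0 hx hfs hsDb hsDf ⊢
  have hn : (ℓ + 1) ^ k = P.L ^ k := e1.symm
  have hfit := fit_of_nested hnest hfit0
  have hN := short_of_nested hnest hN0
  have hM0 := one_le_of_nested hnest hM
  have hF0 : 0 ≤ F := (norm_nonneg _).trans (hF x)
  have hncast : (((ℓ + 1) ^ k : ℕ) : ℝ) = (P.L : ℝ) ^ k := by rw [hn, Nat.cast_pow]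
  have hconv : ∀ E : ℝ, Real.exp (-(δ₀ * E / ((((ℓ + 1) ^ k : ℕ) : ℝ)))) = Real.exp (-(δ₀ * (((P.L : ℝ) ^ k)⁻¹ * E))) := fun E => by
    congr 1
    rw [hncast, div_eq_mul_inv]
    ring
  have hLcast : ((ℓ : ℝ) + 1) = (P.L : ℝ) := by rw [hPL]; push_cast; ring
  have H' := H k hk1 a 0 le_rfl le_rfl le_rfl le_rfl M M0 (fun i => (t i : ℤ)) (fits_of_nested hnest) hM
  rw [hLcast] at H'
  obtain ⟨z, hz, rfl⟩ := (mem_cubeT hPd).1 hx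
  have hz0 := add_mem_boxDom_nested (n := (ℓ + 1) ^ k) hnest hz
  have key : ∀ φ : Balaban1983to89.Site P 0 → ℝ, (∀ y, |φ y| ≤ F) →
      (∀ y, y ∉ cubeT hPd ((ℓ + 1) ^ k) (c + t) (fun i => (ℓ + 1) ^ k * M i) → φ y = 0) →
      (∀ y, φ y ≠ 0 → D ≤ B5Ineq137Torus.T P 0 (cubePt hPd ((ℓ + 1) ^ k) (c + t) z) y) →
      (∀ y, φ y ≠ 0 → ∀ w ∈ cubeT hPd ((ℓ + 1) ^ k) c (fun i => (ℓ + 1) ^ k * M0 i),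
        w ∉ cubeT hPd ((ℓ + 1) ^ k) (c + t) (fun i => (ℓ + 1) ^ k * M i) → Df ≤ B5Ineq137Torus.T P 0 y w) →
      |(gCubeR hPd ((ℓ + 1) ^ k) (c + t) M (P.spacing k ^ 2) (B1.aSeq a P.L k) *ᵥ φ) (cubePt hPd ((ℓ + 1) ^ k) (c + t) z) -
          (gCubeR hPd ((ℓ + 1) ^ k) c M0 (P.spacing k ^ 2) (B1.aSeq a P.L k) *ᵥ φ) (cubePt hPd ((ℓ + 1) ^ k) (c + t) z)| ≤
        P.spacing k ^ 2 * (c₀ * Real.exp (-(δ₀ * (((P.L : ℝ) ^ k)⁻¹ * D))) * Real.exp (-(δ₀ * (((P.L : ℝ) ^ k)⁻¹ * (Db + Df)))) * F) := by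
    intro φ hφ hφ0 hφD hφDf
    rw [gCubeR_sub_nested_cubePt hPd hfit0 hnest _ _ φ hφ0 hz, abs_mul, abs_of_nonneg (sq_nonneg _)]
    have hB := H' (fun w => φ (cubePt hPd ((ℓ + 1) ^ k) (c + t) (w : Fin (d + 1) → ℤ))) F (fun w => hφ _) ⟨z, hz⟩ D Db Df
      (fun w hw => (hφD _ hw).trans (T_cubePt_le hPd hfit hz w.2))
      (fun y' hy' => by
        have hw : cubePt hPd ((ℓ + 1) ^ k) c (y' : Fin (d + 1) → ℤ) ∈ cubeT hPd ((ℓ + 1) ^ k) c (fun i => (ℓ + 1) ^ k * M0 i) :=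
          cubePt_mem_cubeT hPd y'.2
        have hw' : cubePt hPd ((ℓ + 1) ^ k) c (y' : Fin (d + 1) → ℤ) ∉ cubeT hPd ((ℓ + 1) ^ k) (c + t) (fun i => (ℓ + 1) ^ k * M i) :=
          fun hm => hy' (sub_mem_of_cubePt_mem hPd hfit0 hnest y'.2 hm)
        have h1 := hsDb _ hw hw'
        rw [cubePt_nested hPd] at h1
        exact h1.trans (T_cubePt_le hPd hfit0 hz0 y'.2))
      (fun w hw y' hy' => by
        have hv : cubePt hPd ((ℓ + 1) ^ k) c (y' : Fin (d + 1) → ℤ) ∈ cubeT hPd ((ℓ + 1) ^ k) c (fun i => (ℓ + 1) ^ k * M0 i) :=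
          cubePt_mem_cubeT hPd y'.2
        have hv' : cubePt hPd ((ℓ + 1) ^ k) c (y' : Fin (d + 1) → ℤ) ∉ cubeT hPd ((ℓ + 1) ^ k) (c + t) (fun i => (ℓ + 1) ^ k * M i) :=
          fun hm => hy' (sub_mem_of_cubePt_mem hPd hfit0 hnest y'.2 hm)
        have h1 := hφDf _ hw _ hv hv'
        rw [cubePt_nested hPd] at h1
        exact h1.trans (T_cubePt_le hPd hfit0 (add_mem_boxDom_nested hnest w.2) y'.2))
    have hE : Real.exp (-(δ₀ * Db / ((((ℓ + 1) ^ k : ℕ) : ℝ)) + δ₀ * Df / ((((ℓ + 1) ^ k : ℕ) : ℝ)))) =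
        Real.exp (-(δ₀ * (((P.L : ℝ) ^ k)⁻¹ * (Db + Df)))) := by
      congr 1
      rw [hncast, div_eq_mul_inv, div_eq_mul_inv]
      ring
    rw [hconv D, hE] at hB
    exact mul_le_mul_of_nonneg_left hB (sq_nonneg _)
  rw [gBox_cube_pureGauge hPd hk1 hk hn hfit hN hM ha h, gBox_cube_pureGauge hPd hk1 hk hn hfit0 hN0 hM0 ha h, ← mulVec_mulVec,
    ← mulVec_mulVec, ← mulVec_mulVec, ← mulVec_mulVec, mulOp_conjTranspose_mulVec, mulOp_mulVec, mulOp_mulVec, ← mul_sub, norm_mul,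
    norm_toC, one_mul]
  set g : Balaban1983to89.Site P 0 → ℂ := fun y => (starRingEnd ℂ) (toC (h y)) * f y with hg
  have hgR : ∀ y, |(g y).re| ≤ F := fun y => ((Complex.abs_re_le_norm _).trans_eq (norm_rot h f y)).trans (hF y)
  have hgI : ∀ y, |(g y).im| ≤ F := fun y => ((Complex.abs_im_le_norm _).trans_eq (norm_rot h f y)).trans (hF y)
  have hg0 : ∀ y, f y = 0 → g y = 0 := fun y hf => by simp only [hg, hf, mul_zero]
  have hR0 : ∀ y, y ∉ cubeT hPd ((ℓ + 1) ^ k) (c + t) (fun i => (ℓ + 1) ^ k * M i) → (g y).re = 0 := fun y hy => by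
    rw [hg0 y (hfs y hy), Complex.zero_re]
  have hI0 : ∀ y, y ∉ cubeT hPd ((ℓ + 1) ^ k) (c + t) (fun i => (ℓ + 1) ^ k * M i) → (g y).im = 0 := fun y hy => by
    rw [hg0 y (hfs y hy), Complex.zero_im]
  have hRne : ∀ y, (g y).re ≠ 0 → f y ≠ 0 := fun y hy hf => hy (by rw [hg0 y hf, Complex.zero_re])
  have hIne : ∀ y, (g y).im ≠ 0 → f y ≠ 0 := fun y hy hf => hy (by rw [hg0 y hf, Complex.zero_im])
  have hE2 : P.spacing k ^ 2 * (2 * c₀ * Real.exp (-(δ₀ * (((P.L : ℝ) ^ k)⁻¹ * D))) * Real.exp (-(δ₀ * (((P.L : ℝ) ^ k)⁻¹ * (Db + Df)))) * F) =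
      P.spacing k ^ 2 * (c₀ * Real.exp (-(δ₀ * (((P.L : ℝ) ^ k)⁻¹ * D))) * Real.exp (-(δ₀ * (((P.L : ℝ) ^ k)⁻¹ * (Db + Df)))) * F) +
        P.spacing k ^ 2 * (c₀ * Real.exp (-(δ₀ * (((P.L : ℝ) ^ k)⁻¹ * D))) * Real.exp (-(δ₀ * (((P.L : ℝ) ^ k)⁻¹ * (Db + Df)))) * F) := by ring
  rw [hE2]
  exact (norm_sub_map_mulVec_le₂ _ _ g _).trans (add_le_add
    (key _ hgR hR0 (fun y hy => hsD y (hRne y hy)) (fun y hy => hsDf y (hRne y hy)))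
    (key _ hgI hI0 (fun y hy => hsD y (hIne y hy)) (fun y hy => hsDf y (hIne y hy))))


/-- **(2.30) AT `u = 1^h`, OPERATOR FORM, IN LEVEL-`k` UNITS**: `‖(G_{k,loc}(1^h)f)(x)‖ ≤ (L^kε)²·#S·c₀e^{−δ₀D/L^k}‖f‖_∞` for `f` supported at
sup-torus distance `≥ D` from `x` and `S ∋` the cubes active on row `x` against `supp f` — the printed (2.30) input at every level `k`
(`D/L^k` = the distance in `η`-units, `η = L^{-k}`). [cite: BalabanImbrieJaffe1988, (2.30) p.263] -/
theorem opDecay230_flat_level (d ℓ : ℕ) (hℓ : 1 ≤ ℓ) {a : ℝ} (ha : 0 < a) :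
    ∃ δ₀ c₀ : ℝ, 0 < δ₀ ∧ 0 < c₀ ∧ ∀ (P : Params) (hPd : P.d = d + 1), P.L = ℓ + 1 →
      ∀ k : ℕ, 1 ≤ k → k ≤ P.K → ∀ (ι : Type) [Fintype ι] (cube : ι → Finset (Balaban1983to89.Site P 0))
        (lam : ι → Balaban1983to89.Site P 0 → Balaban1983to89.Site P 0 → ℝ)
        (ζ'' : Balaban1983to89.Site P 0 → Balaban1983to89.Site P 0 → ℝ),
        (∀ α, ∃ c M : Fin (d + 1) → ℕ, (∀ i, 1 ≤ M i) ∧ (∀ i, c i * P.L ^ k + P.L ^ k * M i ≤ P.sitesPerDir 0) ∧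
            (∀ i, P.L ^ k * M i < P.sitesPerDir 0) ∧ cube α = cubeT hPd (P.L ^ k) c fun i => P.L ^ k * M i) →
        (∀ x y, ∑ α, |lam α x y| ≤ 1) → (∀ x y, |ζ'' x y| ≤ 1) →
      ∀ (h : GaugeTransf P 0 U1) (x : Balaban1983to89.Site P 0) (f : Balaban1983to89.Site P 0 → ℂ) (F D : ℝ),
        (∀ y, ‖f y‖ ≤ F) → (∀ y, f y ≠ 0 → D ≤ B5Ineq137Torus.T P 0 x y) →
      ∀ S : Finset ι, (∀ α y, ζ'' x y * lam α x y ≠ 0 → f y ≠ 0 → α ∈ S) →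
        ‖(gLocT (B1RG242Torus.α P a k * (P.L : ℝ) ^ (k * P.d)) P.eps⁻¹ (gaugeAct h (1 : GaugeField P 0 U1)) k cube lam ζ'' *ᵥ f) x‖ ≤
          P.spacing k ^ 2 * (S.card * (c₀ * Real.exp (-(δ₀ * (((P.L : ℝ) ^ k)⁻¹ * D))) * F)) := by
  obtain ⟨δ₀, c₀, hδ₀, hc₀, H⟩ := decay110_flat_cube_level d ℓ hℓ ha
  refine ⟨δ₀, c₀, hδ₀, hc₀, ?_⟩
  intro P hPd hPL k hk1 hkK ι _ cube lam ζ hcube hlam hζ h x f F D hF hsupp S hS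
  rw [gLocT_mulVec_apply]
  have hterm : ∀ α, ‖(gBox (B1RG242Torus.α P a k * (P.L : ℝ) ^ (k * P.d)) P.eps⁻¹ (gaugeAct h (1 : GaugeField P 0 U1)) k (cube α) *ᵥ
      fun y => (ζ x y : ℂ) * (lam α x y : ℂ) * f y) x‖ ≤ P.spacing k ^ 2 * (c₀ * Real.exp (-(δ₀ * (((P.L : ℝ) ^ k)⁻¹ * D))) * F) := by
    intro α
    obtain ⟨c', M, hM, hfit, hN, hc⟩ := hcube α
    rw [hc]
    exact H P hPd hPL k hk1 hkK c' M hM hfit hN h x _ F D (fun y => norm_rowSource_le (hζ x y) (abs_lam_le_one hlam α x y) hF y)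
      (fun y hy => hsupp y (rowSource_ne_zero hy).2)
  have hzero : ∀ α, α ∉ S → (gBox (B1RG242Torus.α P a k * (P.L : ℝ) ^ (k * P.d)) P.eps⁻¹ (gaugeAct h (1 : GaugeField P 0 U1)) k (cube α) *ᵥ
      fun y => (ζ x y : ℂ) * (lam α x y : ℂ) * f y) x = 0 := by
    intro α hα
    have h0 : (fun y => (ζ x y : ℂ) * (lam α x y : ℂ) * f y) = 0 := by
      funext y
      by_contra hne
      exact hα (hS α y (rowSource_ne_zero hne).1 (rowSource_ne_zero hne).2)
    rw [h0, mulVec_zero, Pi.zero_apply]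
  rw [← Finset.sum_subset (Finset.subset_univ S) (fun α _ hα => hzero α hα)]
  calc ‖∑ α ∈ S, (gBox (B1RG242Torus.α P a k * (P.L : ℝ) ^ (k * P.d)) P.eps⁻¹ (gaugeAct h (1 : GaugeField P 0 U1)) k (cube α) *ᵥ
          fun y => (ζ x y : ℂ) * (lam α x y : ℂ) * f y) x‖
      ≤ ∑ α ∈ S, ‖(gBox (B1RG242Torus.α P a k * (P.L : ℝ) ^ (k * P.d)) P.eps⁻¹ (gaugeAct h (1 : GaugeField P 0 U1)) k (cube α) *ᵥ
          fun y => (ζ x y : ℂ) * (lam α x y : ℂ) * f y) x‖ := norm_sum_le _ _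
    _ ≤ ∑ α ∈ S, P.spacing k ^ 2 * (c₀ * Real.exp (-(δ₀ * (((P.L : ℝ) ^ k)⁻¹ * D))) * F) := Finset.sum_le_sum fun α _ => hterm α
    _ = P.spacing k ^ 2 * (S.card * (c₀ * Real.exp (-(δ₀ * (((P.L : ℝ) ^ k)⁻¹ * D))) * F)) := by rw [Finset.sum_const, nsmul_eq_mul]; ring

/-- **(2.31) AT `u = 1^h`, OPERATOR FORM, IN LEVEL-`k` UNITS**: under the row-`x` hypotheses (i)–(iii) of the companion file's (2.31),
`‖(G_{k,loc}(1^h)f − G_k(Ω₀,1^h)f)(x)‖ ≤ (L^kε)²·c₀(#S·e^{−2δ₀R/L^k} + e^{−(δ₀/2)R₁/L^k})e^{−(δ₀/2)D/L^k}‖f‖_∞`; at the printed radii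
`R, R₁ = r(e_k)L^k` (fine-lattice units) the bracket is `#S·e^{−2δ₀r(e_k)} + e^{−(δ₀/2)r(e_k)}` = print's `e^{−cr(e_k)}` AT EVERY LEVEL `k`
(the owner's UNITS NOTE). [cite: BalabanImbrieJaffe1988, (2.31) p.263] -/
theorem opClose231_flat_level (d ℓ : ℕ) (hℓ : 1 ≤ ℓ) {a : ℝ} (ha : 0 < a) :
    ∃ δ₀ c₀ : ℝ, 0 < δ₀ ∧ 0 < c₀ ∧ ∀ (P : Params) (hPd : P.d = d + 1), P.L = ℓ + 1 →
      ∀ k : ℕ, 1 ≤ k → k ≤ P.K → ∀ (c M0 : Fin (d + 1) → ℕ), (∀ i, 1 ≤ M0 i) →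
        (∀ i, c i * P.L ^ k + P.L ^ k * M0 i ≤ P.sitesPerDir 0) → (∀ i, P.L ^ k * M0 i < P.sitesPerDir 0) →
      ∀ (ι : Type) [Fintype ι] (cube : ι → Finset (Balaban1983to89.Site P 0))
        (lam : ι → Balaban1983to89.Site P 0 → Balaban1983to89.Site P 0 → ℝ)
        (ζ'' : Balaban1983to89.Site P 0 → Balaban1983to89.Site P 0 → ℝ),
        (∀ α, ∃ t M : Fin (d + 1) → ℕ, (∀ i, 1 ≤ M i) ∧ (∀ i, t i + M i ≤ M0 i) ∧
            cube α = cubeT hPd (P.L ^ k) (c + t) fun i => P.L ^ k * M i) →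
        (∀ x y, ∑ α, |lam α x y| ≤ 1) → (∀ x y, 0 ≤ ζ'' x y ∧ ζ'' x y ≤ 1) →
      ∀ (h : GaugeTransf P 0 U1) (x : Balaban1983to89.Site P 0) (R R₁ : ℝ), 0 ≤ R → 0 ≤ R₁ →
        (∀ y, ζ'' x y ≠ 0 → ∑ α, lam α x y = 1) →
        (∀ α y, ζ'' x y * lam α x y ≠ 0 → x ∈ cube α ∧ y ∈ cube α ∧
            ∀ w ∈ cubeT hPd (P.L ^ k) c (fun i => P.L ^ k * M0 i), w ∉ cube α →
              R ≤ B5Ineq137Torus.T P 0 x w ∧ R ≤ B5Ineq137Torus.T P 0 y w) →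
        (∀ y, B5Ineq137Torus.T P 0 x y ≤ R₁ → ζ'' x y = 1) →
      ∀ (f : Balaban1983to89.Site P 0 → ℂ) (F D : ℝ), (∀ y, ‖f y‖ ≤ F) → 0 ≤ D → (∀ y, f y ≠ 0 → D ≤ B5Ineq137Torus.T P 0 x y) →
      ∀ S : Finset ι, (∀ α y, ζ'' x y * lam α x y ≠ 0 → f y ≠ 0 → α ∈ S) →
        ‖(gLocT (B1RG242Torus.α P a k * (P.L : ℝ) ^ (k * P.d)) P.eps⁻¹ (gaugeAct h (1 : GaugeField P 0 U1)) k cube lam ζ'' *ᵥ f) x -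
            (gBox (B1RG242Torus.α P a k * (P.L : ℝ) ^ (k * P.d)) P.eps⁻¹ (gaugeAct h (1 : GaugeField P 0 U1)) k
              (cubeT hPd (P.L ^ k) c fun i => P.L ^ k * M0 i) *ᵥ f) x‖ ≤
          P.spacing k ^ 2 * (c₀ * (S.card * Real.exp (-(δ₀ * (((P.L : ℝ) ^ k)⁻¹ * (2 * R)))) + Real.exp (-(δ₀ / 2 * (((P.L : ℝ) ^ k)⁻¹ * R₁)))) *
            Real.exp (-(δ₀ / 2 * (((P.L : ℝ) ^ k)⁻¹ * D))) * F) := by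
  obtain ⟨δ₁, c₁, hδ₁, hc₁, H1⟩ := close112_flat_cube_level d ℓ hℓ ha
  obtain ⟨δ₂, c₂, hδ₂, hc₂, H2⟩ := decay110_flat_cube_level d ℓ hℓ ha
  refine ⟨min δ₁ δ₂, max c₁ c₂, lt_min hδ₁ hδ₂, lt_max_of_lt_left hc₁, ?_⟩
  intro P hPd hPL k hk1 hkK c M0 hM0 hfit0 hN0 ι _ cube lam ζ hcube hlam hζ h x R R₁ hR hR₁ hcomp hdeep hcut f F D hF hD hsupp S hS
  set δ := min δ₁ δ₂ with hδdef
  set C := max c₁ c₂ with hCdef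
  have hδ1 : δ ≤ δ₁ := min_le_left _ _
  have hδ2 : δ ≤ δ₂ := min_le_right _ _
  have hδ0 : 0 ≤ δ := (lt_min hδ₁ hδ₂).le
  have hC1 : c₁ ≤ C := le_max_left _ _
  have hC2 : c₂ ≤ C := le_max_right _ _
  have hC0 : 0 ≤ C := hc₁.le.trans hC1
  have hε : 0 < ((P.L : ℝ) ^ k)⁻¹ := inv_pos.mpr (pow_pos P.cast_L_pos _)
  have hF0 : 0 ≤ F := (norm_nonneg _).trans (hF x)
  have hs0 : 0 ≤ P.spacing k ^ 2 := sq_nonneg _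
  have hζ1 : ∀ y, |ζ x y| ≤ 1 := fun y => abs_le.2 ⟨by linarith [(hζ x y).1], (hζ x y).2⟩
  set G0 := gBox (B1RG242Torus.α P a k * (P.L : ℝ) ^ (k * P.d)) P.eps⁻¹ (gaugeAct h (1 : GaugeField P 0 U1)) k
    (cubeT hPd (P.L ^ k) c fun i => P.L ^ k * M0 i) with hG0def
  rw [gLocT_sub_mulVec_apply _ _ _ _ cube lam ζ G0 f x hcomp]
  set B := P.spacing k ^ 2 * (c₁ * Real.exp (-(δ₁ * (((P.L : ℝ) ^ k)⁻¹ * D))) * Real.exp (-(δ₁ * (((P.L : ℝ) ^ k)⁻¹ * (R + R)))) * F) with hBdef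
  have hB0 : 0 ≤ B := by positivity
  have hterm : ∀ α, ‖((gBox (B1RG242Torus.α P a k * (P.L : ℝ) ^ (k * P.d)) P.eps⁻¹ (gaugeAct h (1 : GaugeField P 0 U1)) k (cube α) - G0) *ᵥ
      fun y => (ζ x y : ℂ) * (lam α x y : ℂ) * f y) x‖ ≤ B := by
    intro α
    by_cases hex : ∃ y, ζ x y * lam α x y ≠ 0
    · obtain ⟨y₀, hy₀⟩ := hex
      obtain ⟨hxα, -, hwx⟩ := hdeep α y₀ hy₀
      obtain ⟨t, M, hM, hnest, hc⟩ := hcube α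
      have hyα : ∀ y, (ζ x y : ℂ) * (lam α x y : ℂ) * f y ≠ 0 → y ∈ cubeT hPd (P.L ^ k) (c + t) (fun i => P.L ^ k * M i) :=
        fun y hy => hc ▸ (hdeep α y (rowSource_ne_zero hy).1).2.1
      have hwy : ∀ y, (ζ x y : ℂ) * (lam α x y : ℂ) * f y ≠ 0 →
          ∀ w ∈ cubeT hPd (P.L ^ k) c (fun i => P.L ^ k * M0 i), w ∉ cubeT hPd (P.L ^ k) (c + t) (fun i => P.L ^ k * M i) →
            R ≤ B5Ineq137Torus.T P 0 y w :=
        fun y hy w hw hw' => ((hdeep α y (rowSource_ne_zero hy).1).2.2 w hw (hc ▸ hw')).2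
      rw [hc] at hxα hwx
      rw [Matrix.sub_mulVec, Pi.sub_apply, hc]
      exact H1 P hPd hPL k hk1 hkK c M0 t M hM hnest hfit0 hN0 h x hxα _ F D R R
        (fun y => norm_rowSource_le (hζ1 y) (abs_lam_le_one hlam α x y) hF y)
        (fun y hy => by by_contra hne; exact hy (hyα y hne)) (fun y hy => hsupp y (rowSource_ne_zero hy).2)
        (fun w hw hw' => (hwx w hw hw').1) hwy
    · push Not at hex
      have h0 : (fun y => (ζ x y : ℂ) * (lam α x y : ℂ) * f y) = 0 := by
        funext y; rw [← Complex.ofReal_mul, hex y, Complex.ofReal_zero, zero_mul]; rfl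
      rw [h0, mulVec_zero, Pi.zero_apply, norm_zero]
      exact hB0
  have hzero : ∀ α, α ∉ S → ((gBox (B1RG242Torus.α P a k * (P.L : ℝ) ^ (k * P.d)) P.eps⁻¹ (gaugeAct h (1 : GaugeField P 0 U1)) k (cube α)
      - G0) *ᵥ fun y => (ζ x y : ℂ) * (lam α x y : ℂ) * f y) x = 0 := by
    intro α hα
    have h0 : (fun y => (ζ x y : ℂ) * (lam α x y : ℂ) * f y) = 0 := by
      funext y
      by_contra hne
      exact hα (hS α y (rowSource_ne_zero hne).1 (rowSource_ne_zero hne).2)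
    rw [h0, mulVec_zero, Pi.zero_apply]
  have hsum : ‖∑ α, ((gBox (B1RG242Torus.α P a k * (P.L : ℝ) ^ (k * P.d)) P.eps⁻¹ (gaugeAct h (1 : GaugeField P 0 U1)) k (cube α) - G0) *ᵥ
      fun y => (ζ x y : ℂ) * (lam α x y : ℂ) * f y) x‖ ≤ S.card * B := by
    rw [← Finset.sum_subset (Finset.subset_univ S) (fun α _ hα => hzero α hα)]
    calc ‖∑ α ∈ S, ((gBox (B1RG242Torus.α P a k * (P.L : ℝ) ^ (k * P.d)) P.eps⁻¹ (gaugeAct h (1 : GaugeField P 0 U1)) k (cube α) - G0) *ᵥ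
            fun y => (ζ x y : ℂ) * (lam α x y : ℂ) * f y) x‖
        ≤ ∑ α ∈ S, ‖((gBox (B1RG242Torus.α P a k * (P.L : ℝ) ^ (k * P.d)) P.eps⁻¹ (gaugeAct h (1 : GaugeField P 0 U1)) k (cube α) - G0) *ᵥ
            fun y => (ζ x y : ℂ) * (lam α x y : ℂ) * f y) x‖ := norm_sum_le _ _
      _ ≤ ∑ α ∈ S, B := Finset.sum_le_sum fun α _ => hterm α
      _ = S.card * B := by rw [Finset.sum_const, nsmul_eq_mul]
  have htail : ‖(G0 *ᵥ fun y => ((ζ x y : ℂ) - 1) * f y) x‖ ≤ P.spacing k ^ 2 * (c₂ * Real.exp (-(δ₂ * (((P.L : ℝ) ^ k)⁻¹ * max D R₁))) * F) := by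
    refine H2 P hPd hPL k hk1 hkK c M0 hM0 hfit0 hN0 h x _ F (max D R₁) (fun y => ?_) (fun y hy => ?_)
    · have hz1 : ‖(ζ x y : ℂ) - 1‖ ≤ 1 := by
        rw [← Complex.ofReal_one, ← Complex.ofReal_sub, Complex.norm_real, Real.norm_eq_abs, abs_le]
        constructor <;> linarith [(hζ x y).1, (hζ x y).2]
      calc ‖((ζ x y : ℂ) - 1) * f y‖ = ‖(ζ x y : ℂ) - 1‖ * ‖f y‖ := norm_mul _ _
        _ ≤ 1 * F := mul_le_mul hz1 (hF y) (norm_nonneg _) zero_le_one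
        _ = F := one_mul F
    · have hf : f y ≠ 0 := fun hf => hy (by rw [hf, mul_zero])
      have hz : ζ x y ≠ 1 := fun h1 => hy (by rw [h1]; push_cast; rw [sub_self, zero_mul])
      exact max_le (hsupp y hf) (le_of_lt (lt_of_not_ge fun hle => hz (hcut y hle)))
  have hεD : 0 ≤ ((P.L : ℝ) ^ k)⁻¹ * D := mul_nonneg hε.le hD
  have hsum' : (S.card : ℝ) * B ≤
      P.spacing k ^ 2 * (C * (S.card * Real.exp (-(δ * (((P.L : ℝ) ^ k)⁻¹ * (2 * R))))) * Real.exp (-(δ / 2 * (((P.L : ℝ) ^ k)⁻¹ * D))) * F) := by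
    have h1 : c₁ * Real.exp (-(δ₁ * (((P.L : ℝ) ^ k)⁻¹ * D))) * Real.exp (-(δ₁ * (((P.L : ℝ) ^ k)⁻¹ * (R + R)))) * F ≤
        C * Real.exp (-(δ * (((P.L : ℝ) ^ k)⁻¹ * (2 * R)))) * Real.exp (-(δ / 2 * (((P.L : ℝ) ^ k)⁻¹ * D))) * F := by
      rw [mul_assoc c₁, mul_comm (Real.exp _) (Real.exp _), ← mul_assoc c₁]
      refine mul_le_mul_of_nonneg_right (mul_le_mul (mul_le_mul hC1 ?_ (Real.exp_pos _).le hC0) ?_ (Real.exp_pos _).le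
        (by positivity)) hF0
      · rw [show R + R = 2 * R by ring]
        exact exp_le_exp_of_rate₂ hδ1 (by positivity)
      · exact exp_le_exp_of_rate₂ (by linarith) hεD
    calc (S.card : ℝ) * B = P.spacing k ^ 2 * (S.card * (c₁ * Real.exp (-(δ₁ * (((P.L : ℝ) ^ k)⁻¹ * D))) * Real.exp (-(δ₁ * (((P.L : ℝ) ^ k)⁻¹ * (R + R)))) * F)) := by
          rw [hBdef]; ring
      _ ≤ P.spacing k ^ 2 * (S.card * (C * Real.exp (-(δ * (((P.L : ℝ) ^ k)⁻¹ * (2 * R)))) * Real.exp (-(δ / 2 * (((P.L : ℝ) ^ k)⁻¹ * D))) * F)) :=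
          mul_le_mul_of_nonneg_left (mul_le_mul_of_nonneg_left h1 (Nat.cast_nonneg _)) hs0
      _ = P.spacing k ^ 2 * (C * (S.card * Real.exp (-(δ * (((P.L : ℝ) ^ k)⁻¹ * (2 * R))))) * Real.exp (-(δ / 2 * (((P.L : ℝ) ^ k)⁻¹ * D))) * F) := by ring
  have htail' : P.spacing k ^ 2 * (c₂ * Real.exp (-(δ₂ * (((P.L : ℝ) ^ k)⁻¹ * max D R₁))) * F) ≤
      P.spacing k ^ 2 * (C * Real.exp (-(δ / 2 * (((P.L : ℝ) ^ k)⁻¹ * R₁))) * Real.exp (-(δ / 2 * (((P.L : ℝ) ^ k)⁻¹ * D))) * F) := by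
    refine mul_le_mul_of_nonneg_left (mul_le_mul_of_nonneg_right ?_ hF0) hs0
    rw [mul_assoc C, ← Real.exp_add]
    refine mul_le_mul hC2 (Real.exp_le_exp.2 ?_) (Real.exp_pos _).le hC0
    have hm1 : D ≤ max D R₁ := le_max_left _ _
    have hm2 : R₁ ≤ max D R₁ := le_max_right _ _
    have hm0 : 0 ≤ ((P.L : ℝ) ^ k)⁻¹ * max D R₁ := mul_nonneg hε.le (hD.trans hm1)
    nlinarith [mul_le_mul_of_nonneg_left hm1 hε.le, mul_le_mul_of_nonneg_left hm2 hε.le, mul_nonneg hδ0 hm0,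
      mul_le_mul_of_nonneg_right hδ2 hm0]
  calc ‖∑ α, ((gBox (B1RG242Torus.α P a k * (P.L : ℝ) ^ (k * P.d)) P.eps⁻¹ (gaugeAct h (1 : GaugeField P 0 U1)) k (cube α) - G0) *ᵥ
            fun y => (ζ x y : ℂ) * (lam α x y : ℂ) * f y) x + (G0 *ᵥ fun y => ((ζ x y : ℂ) - 1) * f y) x‖
      ≤ S.card * B + P.spacing k ^ 2 * (c₂ * Real.exp (-(δ₂ * (((P.L : ℝ) ^ k)⁻¹ * max D R₁))) * F) :=
        (norm_add_le _ _).trans (add_le_add hsum htail)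
    _ ≤ P.spacing k ^ 2 * (C * (S.card * Real.exp (-(δ * (((P.L : ℝ) ^ k)⁻¹ * (2 * R))))) * Real.exp (-(δ / 2 * (((P.L : ℝ) ^ k)⁻¹ * D))) * F) +
        P.spacing k ^ 2 * (C * Real.exp (-(δ / 2 * (((P.L : ℝ) ^ k)⁻¹ * R₁))) * Real.exp (-(δ / 2 * (((P.L : ℝ) ^ k)⁻¹ * D))) * F) := add_le_add hsum' htail'
    _ = P.spacing k ^ 2 * (C * (S.card * Real.exp (-(δ * (((P.L : ℝ) ^ k)⁻¹ * (2 * R)))) + Real.exp (-(δ / 2 * (((P.L : ℝ) ^ k)⁻¹ * R₁)))) *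
        Real.exp (-(δ / 2 * (((P.L : ℝ) ^ k)⁻¹ * D))) * F) := by ring

/-- **[6] (1.10), KERNEL FORM, IN LEVEL-`k` UNITS**: `‖G_k(□,1^h;x,y)‖ ≤ (L^kε)²·c₀e^{−δ₀|x−y|_T/L^k}` (gen 16's `decay110_flat_cube_kernel`
with the printed exponent: `|x−y|_T/L^k` = the sup-torus distance in `η`-units). [cite: Balaban1983RegularityDecay, (1.10) p.573] -/
theorem decay110_flat_cube_kernel_level (d ℓ : ℕ) (hℓ : 1 ≤ ℓ) {a : ℝ} (ha : 0 < a) :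
    ∃ δ₀ c₀ : ℝ, 0 < δ₀ ∧ 0 < c₀ ∧ ∀ (P : Params) (hPd : P.d = d + 1), P.L = ℓ + 1 →
      ∀ k : ℕ, 1 ≤ k → k ≤ P.K → ∀ (c M : Fin (d + 1) → ℕ), (∀ i, 1 ≤ M i) →
        (∀ i, c i * P.L ^ k + P.L ^ k * M i ≤ P.sitesPerDir 0) → (∀ i, P.L ^ k * M i < P.sitesPerDir 0) →
        ∀ (h : GaugeTransf P 0 U1) (x y : Balaban1983to89.Site P 0),
          ‖gBox (B1RG242Torus.α P a k * (P.L : ℝ) ^ (k * P.d)) P.eps⁻¹ (gaugeAct h (1 : GaugeField P 0 U1)) k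
              (cubeT hPd (P.L ^ k) c fun i => P.L ^ k * M i) x y‖ ≤
            P.spacing k ^ 2 * (c₀ * Real.exp (-(δ₀ * (((P.L : ℝ) ^ k)⁻¹ * B5Ineq137Torus.T P 0 x y)))) := by
  obtain ⟨δ₀, c₀, hδ₀, hc₀, H⟩ := decay110_flat_cube_level d ℓ hℓ ha
  refine ⟨δ₀, c₀, hδ₀, hc₀, ?_⟩
  intro P hPd hPL k hk1 hkK c M hM hfit hN h x y
  have h1 := H P hPd hPL k hk1 hkK c M hM hfit hN h x (Pi.single y 1) 1 (B5Ineq137Torus.T P 0 x y)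
    (fun z => by by_cases hz : z = y <;> simp [hz])
    (fun z hz => by
      by_cases hzy : z = y
      · rw [hzy]
      · exact absurd (by simp [hzy]) hz)
  rwa [mulVec_single_one, col_apply, mul_one] at h1

/-- **[6] (1.11)–(1.12) AT `A = 0`, KERNEL FORM, IN LEVEL-`k` UNITS**: for `x, y ∈ □ ⊂ Ω₀` and reals `R_x, R_y` dominated by the sup-torus
distances from `x`, resp. `y`, to `Ω₀∖□`: `‖G_k(□,1^h;x,y) − G_k(Ω₀,1^h;x,y)‖ ≤ (L^kε)²·c₀e^{−δ₀|x−y|_T/L^k}e^{−δ₀(R_x+R_y)/L^k}` (the companion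
file's `close112_flat_cube_kernel` with the printed exponents). [cite: Balaban1983RegularityDecay, (1.11)–(1.12) p.573] -/
theorem close112_flat_cube_kernel_level (d ℓ : ℕ) (hℓ : 1 ≤ ℓ) {a : ℝ} (ha : 0 < a) :
    ∃ δ₀ c₀ : ℝ, 0 < δ₀ ∧ 0 < c₀ ∧ ∀ (P : Params) (hPd : P.d = d + 1), P.L = ℓ + 1 →
      ∀ k : ℕ, 1 ≤ k → k ≤ P.K → ∀ (c M0 t M : Fin (d + 1) → ℕ), (∀ i, 1 ≤ M i) → (∀ i, t i + M i ≤ M0 i) →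
        (∀ i, c i * P.L ^ k + P.L ^ k * M0 i ≤ P.sitesPerDir 0) → (∀ i, P.L ^ k * M0 i < P.sitesPerDir 0) →
        ∀ (h : GaugeTransf P 0 U1) (x y : Balaban1983to89.Site P 0),
          x ∈ cubeT hPd (P.L ^ k) (c + t) (fun i => P.L ^ k * M i) → y ∈ cubeT hPd (P.L ^ k) (c + t) (fun i => P.L ^ k * M i) →
        ∀ (Rx Ry : ℝ),
          (∀ w ∈ cubeT hPd (P.L ^ k) c (fun i => P.L ^ k * M0 i), w ∉ cubeT hPd (P.L ^ k) (c + t) (fun i => P.L ^ k * M i) →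
            Rx ≤ B5Ineq137Torus.T P 0 x w ∧ Ry ≤ B5Ineq137Torus.T P 0 y w) →
          ‖gBox (B1RG242Torus.α P a k * (P.L : ℝ) ^ (k * P.d)) P.eps⁻¹ (gaugeAct h (1 : GaugeField P 0 U1)) k
                (cubeT hPd (P.L ^ k) (c + t) fun i => P.L ^ k * M i) x y -
            gBox (B1RG242Torus.α P a k * (P.L : ℝ) ^ (k * P.d)) P.eps⁻¹ (gaugeAct h (1 : GaugeField P 0 U1)) k
                (cubeT hPd (P.L ^ k) c fun i => P.L ^ k * M0 i) x y‖ ≤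
            P.spacing k ^ 2 * (c₀ * Real.exp (-(δ₀ * (((P.L : ℝ) ^ k)⁻¹ * B5Ineq137Torus.T P 0 x y))) *
              Real.exp (-(δ₀ * (((P.L : ℝ) ^ k)⁻¹ * (Rx + Ry))))) := by
  obtain ⟨δ₀, c₀, hδ₀, hc₀, H⟩ := close112_flat_cube_level d ℓ hℓ ha
  refine ⟨δ₀, c₀, hδ₀, hc₀, ?_⟩
  intro P hPd hPL k hk1 hkK c M0 t M hM hnest hfit0 hN0 h x y hx hy Rx Ry hR
  have h1 := H P hPd hPL k hk1 hkK c M0 t M hM hnest hfit0 hN0 h x hx (Pi.single y 1) 1 (B5Ineq137Torus.T P 0 x y) Rx Ry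
    (fun z => by by_cases hz : z = y <;> simp [hz])
    (fun z hz => by
      by_cases hzy : z = y
      · exact absurd (hzy ▸ hy) hz
      · simp [hzy])
    (fun z hz => by
      by_cases hzy : z = y
      · rw [hzy]
      · exact absurd (by simp [hzy]) hz)
    (fun w hw hw' => (hR w hw hw').1)
    (fun z hz w hw hw' => by
      by_cases hzy : z = y
      · rw [hzy]; exact (hR w hw hw').2
      · exact absurd (by simp [hzy]) hz)
  rwa [mulVec_single_one, mulVec_single_one, col_apply, col_apply, mul_one] at h1

/-- **(2.31) AT `u = 1^h`, KERNEL FORM, IN LEVEL-`k` UNITS** (the companion file's `close231_flat_kernel` with the printed exponents; the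
owner's UNITS NOTE: *"e^{−2δ₀R/L^k} = e^{−2δ₀r(e_k)} at R = r(e_k)L^k"*): under the row-`x` hypotheses (i)–(iii) of (2.31), for every `y`,
`‖G_{k,loc}(1^h;x,y) − G_k(Ω₀,1^h;x,y)‖ ≤ (L^kε)²·c₀(e^{−2δ₀R/L^k} + e^{−(δ₀/2)R₁/L^k})·e^{−(δ₀/2)|x−y|_T/L^k}` — the printed (2.31) kernel input of
p02's operator step AT EVERY LEVEL `k`. [cite: BalabanImbrieJaffe1988, (2.31) p.263] -/
theorem close231_flat_kernel_level (d ℓ : ℕ) (hℓ : 1 ≤ ℓ) {a : ℝ} (ha : 0 < a) :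
    ∃ δ₀ c₀ : ℝ, 0 < δ₀ ∧ 0 < c₀ ∧ ∀ (P : Params) (hPd : P.d = d + 1), P.L = ℓ + 1 →
      ∀ k : ℕ, 1 ≤ k → k ≤ P.K → ∀ (c M0 : Fin (d + 1) → ℕ), (∀ i, 1 ≤ M0 i) →
        (∀ i, c i * P.L ^ k + P.L ^ k * M0 i ≤ P.sitesPerDir 0) → (∀ i, P.L ^ k * M0 i < P.sitesPerDir 0) →
      ∀ (ι : Type) [Fintype ι] (cube : ι → Finset (Balaban1983to89.Site P 0))
        (lam : ι → Balaban1983to89.Site P 0 → Balaban1983to89.Site P 0 → ℝ)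
        (ζ'' : Balaban1983to89.Site P 0 → Balaban1983to89.Site P 0 → ℝ),
        (∀ α, ∃ t M : Fin (d + 1) → ℕ, (∀ i, 1 ≤ M i) ∧ (∀ i, t i + M i ≤ M0 i) ∧
            cube α = cubeT hPd (P.L ^ k) (c + t) fun i => P.L ^ k * M i) →
        (∀ x y, ∑ α, |lam α x y| ≤ 1) → (∀ x y, 0 ≤ ζ'' x y ∧ ζ'' x y ≤ 1) →
      ∀ (h : GaugeTransf P 0 U1) (x : Balaban1983to89.Site P 0) (R R₁ : ℝ), 0 ≤ R → 0 ≤ R₁ →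
        (∀ y, ζ'' x y ≠ 0 → ∑ α, lam α x y = 1) →
        (∀ α y, ζ'' x y * lam α x y ≠ 0 → x ∈ cube α ∧ y ∈ cube α ∧
            ∀ w ∈ cubeT hPd (P.L ^ k) c (fun i => P.L ^ k * M0 i), w ∉ cube α →
              R ≤ B5Ineq137Torus.T P 0 x w ∧ R ≤ B5Ineq137Torus.T P 0 y w) →
        (∀ y, B5Ineq137Torus.T P 0 x y ≤ R₁ → ζ'' x y = 1) →
      ∀ y : Balaban1983to89.Site P 0,
        ‖gLocT (B1RG242Torus.α P a k * (P.L : ℝ) ^ (k * P.d)) P.eps⁻¹ (gaugeAct h (1 : GaugeField P 0 U1)) k cube lam ζ'' x y -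
            gBox (B1RG242Torus.α P a k * (P.L : ℝ) ^ (k * P.d)) P.eps⁻¹ (gaugeAct h (1 : GaugeField P 0 U1)) k
              (cubeT hPd (P.L ^ k) c fun i => P.L ^ k * M0 i) x y‖ ≤
          P.spacing k ^ 2 * (c₀ * (Real.exp (-(δ₀ * (((P.L : ℝ) ^ k)⁻¹ * (2 * R)))) + Real.exp (-(δ₀ / 2 * (((P.L : ℝ) ^ k)⁻¹ * R₁)))) *
            Real.exp (-(δ₀ / 2 * (((P.L : ℝ) ^ k)⁻¹ * B5Ineq137Torus.T P 0 x y)))) := by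
  obtain ⟨δ₁, c₁, hδ₁, hc₁, H1⟩ := close112_flat_cube_kernel_level d ℓ hℓ ha
  obtain ⟨δ₂, c₂, hδ₂, hc₂, H2⟩ := decay110_flat_cube_kernel_level d ℓ hℓ ha
  refine ⟨min δ₁ δ₂, max c₁ c₂, lt_min hδ₁ hδ₂, lt_max_of_lt_left hc₁, ?_⟩
  intro P hPd hPL k hk1 hkK c M0 hM0 hfit0 hN0 ι _ cube lam ζ hcube hlam hζ h x R R₁ hR hR₁ hcomp hdeep hcut y
  set δ := min δ₁ δ₂ with hδdef
  set C := max c₁ c₂ with hCdef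
  have hδ1 : δ ≤ δ₁ := min_le_left _ _
  have hδ2 : δ ≤ δ₂ := min_le_right _ _
  have hδ0 : 0 ≤ δ := (lt_min hδ₁ hδ₂).le
  have hC1 : c₁ ≤ C := le_max_left _ _
  have hC2 : c₂ ≤ C := le_max_right _ _
  have hC0 : 0 ≤ C := hc₁.le.trans hC1
  have hε : 0 < ((P.L : ℝ) ^ k)⁻¹ := inv_pos.mpr (pow_pos P.cast_L_pos _)
  have hs0 : 0 ≤ P.spacing k ^ 2 := sq_nonneg _
  set Txy := B5Ineq137Torus.T P 0 x y with hTdef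
  have hT0 : 0 ≤ Txy := B5Ineq137Torus.T_nonneg P 0 x y
  set G0 := gBox (B1RG242Torus.α P a k * (P.L : ℝ) ^ (k * P.d)) P.eps⁻¹ (gaugeAct h (1 : GaugeField P 0 U1)) k
    (cubeT hPd (P.L ^ k) c fun i => P.L ^ k * M0 i) with hG0def
  -- the entry of the outer box propagator ((1.10), gen 16)
  have hG0 : ‖G0 x y‖ ≤ P.spacing k ^ 2 * (c₂ * Real.exp (-(δ₂ * (((P.L : ℝ) ^ k)⁻¹ * Txy)))) :=
    H2 P hPd hPL k hk1 hkK c M0 hM0 hfit0 hN0 h x y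
  -- the active cubes are close to the outer box at (x,y) ((1.11)–(1.12), §3)
  have hGa : ∀ α, ζ x y * lam α x y ≠ 0 →
      ‖gBox (B1RG242Torus.α P a k * (P.L : ℝ) ^ (k * P.d)) P.eps⁻¹ (gaugeAct h (1 : GaugeField P 0 U1)) k (cube α) x y - G0 x y‖ ≤
        P.spacing k ^ 2 * (c₁ * Real.exp (-(δ₁ * (((P.L : ℝ) ^ k)⁻¹ * Txy))) * Real.exp (-(δ₁ * (((P.L : ℝ) ^ k)⁻¹ * (R + R))))) := by
    intro α hα
    obtain ⟨hxα, hyα, hw⟩ := hdeep α y hα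
    obtain ⟨t, M, hM, hnest, hc⟩ := hcube α
    rw [hc] at hxα hyα hw
    rw [hc]
    exact H1 P hPd hPL k hk1 hkK c M0 t M hM hnest hfit0 hN0 h x y hxα hyα R R hw
  rw [gLocT_sub_eq _ _ _ _ cube lam ζ G0 (hcomp y)]
  -- term 1: the convex combination of the differences
  set B := P.spacing k ^ 2 * (c₁ * Real.exp (-(δ₁ * (((P.L : ℝ) ^ k)⁻¹ * Txy))) * Real.exp (-(δ₁ * (((P.L : ℝ) ^ k)⁻¹ * (R + R))))) with hBdef
  have hB0 : 0 ≤ B := by positivity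
  have h1 : ‖(ζ x y : ℂ) * ∑ α, (lam α x y : ℂ) *
      (gBox (B1RG242Torus.α P a k * (P.L : ℝ) ^ (k * P.d)) P.eps⁻¹ (gaugeAct h (1 : GaugeField P 0 U1)) k (cube α) x y - G0 x y)‖ ≤ B := by
    have hz1 : |ζ x y| ≤ 1 := abs_le.2 ⟨by linarith [(hζ x y).1], (hζ x y).2⟩
    calc ‖(ζ x y : ℂ) * ∑ α, (lam α x y : ℂ) *
          (gBox (B1RG242Torus.α P a k * (P.L : ℝ) ^ (k * P.d)) P.eps⁻¹ (gaugeAct h (1 : GaugeField P 0 U1)) k (cube α) x y - G0 x y)‖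
        ≤ |ζ x y| * ∑ α, |lam α x y| *
          ‖gBox (B1RG242Torus.α P a k * (P.L : ℝ) ^ (k * P.d)) P.eps⁻¹ (gaugeAct h (1 : GaugeField P 0 U1)) k (cube α) x y - G0 x y‖ := by
            rw [norm_mul, Complex.norm_real, Real.norm_eq_abs]
            refine mul_le_mul_of_nonneg_left ((norm_sum_le _ _).trans (Finset.sum_le_sum fun α _ => ?_)) (abs_nonneg _)
            rw [norm_mul, Complex.norm_real, Real.norm_eq_abs]
      _ = ∑ α, |ζ x y * lam α x y| *
          ‖gBox (B1RG242Torus.α P a k * (P.L : ℝ) ^ (k * P.d)) P.eps⁻¹ (gaugeAct h (1 : GaugeField P 0 U1)) k (cube α) x y - G0 x y‖ := by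
            rw [Finset.mul_sum]
            exact Finset.sum_congr rfl fun α _ => by rw [abs_mul, mul_assoc]
      _ ≤ ∑ α, |ζ x y * lam α x y| * B := Finset.sum_le_sum fun α _ => by
            by_cases hα : ζ x y * lam α x y = 0
            · rw [hα, abs_zero, zero_mul, zero_mul]
            · exact mul_le_mul_of_nonneg_left (hGa α hα) (abs_nonneg _)
      _ = |ζ x y| * (∑ α, |lam α x y|) * B := by
            rw [Finset.mul_sum, Finset.sum_mul]
            exact Finset.sum_congr rfl fun α _ => by rw [abs_mul]
      _ ≤ 1 * 1 * B := mul_le_mul_of_nonneg_right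
            (mul_le_mul hz1 (hlam x y) (Finset.sum_nonneg fun α _ => abs_nonneg _) zero_le_one) hB0
      _ = B := by ring
  -- term 2: the tail of the outer propagator beyond `R₁`
  have h2 : ‖((ζ x y : ℂ) - 1) * G0 x y‖ ≤
      P.spacing k ^ 2 * (c₂ * Real.exp (-(δ₂ / 2 * (((P.L : ℝ) ^ k)⁻¹ * R₁))) * Real.exp (-(δ₂ / 2 * (((P.L : ℝ) ^ k)⁻¹ * Txy)))) := by
    by_cases hT1 : Txy ≤ R₁
    · rw [hcut y hT1]
      push_cast
      rw [sub_self, zero_mul, norm_zero]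
      positivity
    · rw [not_le] at hT1
      have hz1 : ‖(ζ x y : ℂ) - 1‖ ≤ 1 := by
        rw [← Complex.ofReal_one, ← Complex.ofReal_sub, Complex.norm_real, Real.norm_eq_abs, abs_le]
        constructor <;> linarith [(hζ x y).1, (hζ x y).2]
      calc ‖((ζ x y : ℂ) - 1) * G0 x y‖ = ‖(ζ x y : ℂ) - 1‖ * ‖G0 x y‖ := norm_mul _ _
        _ ≤ 1 * (P.spacing k ^ 2 * (c₂ * Real.exp (-(δ₂ * (((P.L : ℝ) ^ k)⁻¹ * Txy))))) :=
            mul_le_mul hz1 hG0 (norm_nonneg _) zero_le_one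
        _ ≤ P.spacing k ^ 2 * (c₂ * Real.exp (-(δ₂ / 2 * (((P.L : ℝ) ^ k)⁻¹ * R₁))) * Real.exp (-(δ₂ / 2 * (((P.L : ℝ) ^ k)⁻¹ * Txy)))) := by
            rw [one_mul, mul_assoc c₂, ← Real.exp_add]
            refine mul_le_mul_of_nonneg_left (mul_le_mul_of_nonneg_left (Real.exp_le_exp.2 ?_) hc₂.le) hs0
            have : ((P.L : ℝ) ^ k)⁻¹ * R₁ ≤ ((P.L : ℝ) ^ k)⁻¹ * Txy := mul_le_mul_of_nonneg_left hT1.le hε.le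
            nlinarith
  -- assemble with the common rate `δ = min δ₁ δ₂` and constant `C = max c₁ c₂`
  have hεT : 0 ≤ ((P.L : ℝ) ^ k)⁻¹ * Txy := mul_nonneg hε.le hT0
  have h1' : B ≤ P.spacing k ^ 2 * (C * Real.exp (-(δ * (((P.L : ℝ) ^ k)⁻¹ * (2 * R)))) * Real.exp (-(δ / 2 * (((P.L : ℝ) ^ k)⁻¹ * Txy)))) := by
    rw [hBdef, mul_assoc c₁, mul_assoc C, mul_comm (Real.exp (-(δ₁ * (((P.L : ℝ) ^ k)⁻¹ * Txy)))) (Real.exp _)]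
    refine mul_le_mul_of_nonneg_left
      (mul_le_mul hC1 (mul_le_mul ?_ ?_ (Real.exp_pos _).le (Real.exp_pos _).le) (by positivity) hC0) hs0
    · rw [show R + R = 2 * R by ring]
      exact exp_le_exp_of_rate₂ hδ1 (by positivity)
    · exact exp_le_exp_of_rate₂ (by linarith) hεT
  have h2' : P.spacing k ^ 2 * (c₂ * Real.exp (-(δ₂ / 2 * (((P.L : ℝ) ^ k)⁻¹ * R₁))) * Real.exp (-(δ₂ / 2 * (((P.L : ℝ) ^ k)⁻¹ * Txy)))) ≤
      P.spacing k ^ 2 * (C * Real.exp (-(δ / 2 * (((P.L : ℝ) ^ k)⁻¹ * R₁))) * Real.exp (-(δ / 2 * (((P.L : ℝ) ^ k)⁻¹ * Txy)))) :=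
    mul_le_mul_of_nonneg_left
      (mul_le_mul (mul_le_mul hC2 (exp_le_exp_of_rate₂ (by linarith) (by positivity)) (Real.exp_pos _).le hC0)
        (exp_le_exp_of_rate₂ (by linarith) hεT) (Real.exp_pos _).le (by positivity)) hs0
  calc ‖(ζ x y : ℂ) * ∑ α, (lam α x y : ℂ) *
          (gBox (B1RG242Torus.α P a k * (P.L : ℝ) ^ (k * P.d)) P.eps⁻¹ (gaugeAct h (1 : GaugeField P 0 U1)) k (cube α) x y - G0 x y) +
        ((ζ x y : ℂ) - 1) * G0 x y‖
      ≤ B + P.spacing k ^ 2 * (c₂ * Real.exp (-(δ₂ / 2 * (((P.L : ℝ) ^ k)⁻¹ * R₁))) * Real.exp (-(δ₂ / 2 * (((P.L : ℝ) ^ k)⁻¹ * Txy)))) :=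
        (norm_add_le _ _).trans (add_le_add h1 h2)
    _ ≤ P.spacing k ^ 2 * (C * Real.exp (-(δ * (((P.L : ℝ) ^ k)⁻¹ * (2 * R)))) * Real.exp (-(δ / 2 * (((P.L : ℝ) ^ k)⁻¹ * Txy)))) +
        P.spacing k ^ 2 * (C * Real.exp (-(δ / 2 * (((P.L : ℝ) ^ k)⁻¹ * R₁))) * Real.exp (-(δ / 2 * (((P.L : ℝ) ^ k)⁻¹ * Txy)))) :=
        add_le_add h1' h2'
    _ = P.spacing k ^ 2 * (C * (Real.exp (-(δ * (((P.L : ℝ) ^ k)⁻¹ * (2 * R)))) + Real.exp (-(δ / 2 * (((P.L : ℝ) ^ k)⁻¹ * R₁)))) *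
        Real.exp (-(δ / 2 * (((P.L : ℝ) ^ k)⁻¹ * Txy)))) := by
        ring

/-- kernel: **the exponential form in level-`k` units** — `e^{−δ·max(0, L^k|y₁−y₂|_{T^{(k)}} − (L^k−1))/L^k} ≤ e^{δ}·e^{−δ|y₁−y₂|_{T^{(k)}}}` for
`δ ≥ 0`: a level-`k` decay at the block lower bound is a decay in the printed unit-lattice distance `|y₁−y₂|_{T^{(k)}}` itself (no `L^kε`).
[cite: BalabanImbrieJaffe1985, (2.4) p.302, dictionary] -/
theorem exp_blockLower_level_le {k : ℕ} (y₁ y₂ : Balaban1983to89.Site P (0 + k)) {δ : ℝ} (hδ : 0 ≤ δ) :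
    Real.exp (-(δ * (((P.L : ℝ) ^ k)⁻¹ * max 0 (((P.L : ℝ) ^ k) * B5Ineq137Torus.T P (0 + k) y₁ y₂ - (((P.L : ℝ) ^ k) - 1))))) ≤
      Real.exp δ * Real.exp (-(δ * B5Ineq137Torus.T P (0 + k) y₁ y₂)) := by
  have hLk : (0 : ℝ) < (P.L : ℝ) ^ k := pow_pos P.cast_L_pos _
  have hs : 0 ≤ ((P.L : ℝ) ^ k)⁻¹ := (inv_pos.mpr hLk).le
  rw [← Real.exp_add, Real.exp_le_exp]
  have hm : ((P.L : ℝ) ^ k) * B5Ineq137Torus.T P (0 + k) y₁ y₂ - (((P.L : ℝ) ^ k) - 1) ≤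
      max 0 (((P.L : ℝ) ^ k) * B5Ineq137Torus.T P (0 + k) y₁ y₂ - (((P.L : ℝ) ^ k) - 1)) := le_max_right _ _
  have h5 : B5Ineq137Torus.T P (0 + k) y₁ y₂ - 1 ≤
      ((P.L : ℝ) ^ k)⁻¹ * max 0 (((P.L : ℝ) ^ k) * B5Ineq137Torus.T P (0 + k) y₁ y₂ - (((P.L : ℝ) ^ k) - 1)) := by
    have h6 := mul_le_mul_of_nonneg_left hm hs
    have e : ((P.L : ℝ) ^ k)⁻¹ * (((P.L : ℝ) ^ k) * B5Ineq137Torus.T P (0 + k) y₁ y₂ - (((P.L : ℝ) ^ k) - 1)) =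
        B5Ineq137Torus.T P (0 + k) y₁ y₂ - 1 + ((P.L : ℝ) ^ k)⁻¹ := by field_simp; ring
    rw [e] at h6
    linarith
  nlinarith [mul_le_mul_of_nonneg_left h5 hδ]

/-- **(2.36) FOR THE REGION FORM `Δ_k(Ω₀,1^h)`, IN LEVEL-`k` UNITS** (hypothesis-free; the printed shape `|Δ(x₁,x₂)| ≤ ce^{−c|x₁−x₂|}` with
`|x₁−x₂|` the UNIT-LATTICE distance `|y₁−y₂|_{T^{(k)}}` itself, no factor `L^kε`): `‖Δ_k(Ω₀,1^h; y₁,y₂)‖ ≤ A·([y₁ = y₂] +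
a_k·c₀·e^{−δ₀|y₁−y₂|_{T^{(k)}}})`, `A = α_kL^{kd}` gen 15's counting normalization (see §5), `a_k = B1.aSeq a L k` — from §7's (1.10) in
level-`k` units, §3's block-sum bound and the level-`k` block metric `exp_blockLower_level_le`. [cite: BalabanImbrieJaffe1988, (2.36) p.263] -/
theorem decay236_region_flat_level (d ℓ : ℕ) (hℓ : 1 ≤ ℓ) {a : ℝ} (ha : 0 < a) :
    ∃ δ₀ c₀ : ℝ, 0 < δ₀ ∧ 0 < c₀ ∧ ∀ (P : Params) (hPd : P.d = d + 1), P.L = ℓ + 1 →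
      ∀ k : ℕ, 1 ≤ k → k ≤ P.K → ∀ (c M0 : Fin (d + 1) → ℕ), (∀ i, 1 ≤ M0 i) →
        (∀ i, c i * P.L ^ k + P.L ^ k * M0 i ≤ P.sitesPerDir 0) → (∀ i, P.L ^ k * M0 i < P.sitesPerDir 0) →
      ∀ (h : GaugeTransf P 0 U1) (y₁ y₂ : Balaban1983to89.Site P (0 + k)),
        ‖deltaRegion (B1RG242Torus.α P a k * (P.L : ℝ) ^ (k * P.d)) P.eps⁻¹ (gaugeAct h (1 : GaugeField P 0 U1)) k
            (cubeT hPd (P.L ^ k) c fun i => P.L ^ k * M0 i) y₁ y₂‖ ≤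
          (B1RG242Torus.α P a k * (P.L : ℝ) ^ (k * P.d)) *
            ((if y₁ = y₂ then 1 else 0) + B1.aSeq a P.L k * c₀ * Real.exp (-(δ₀ * (B5Ineq137Torus.T P (0 + k) y₁ y₂)))) := by
  obtain ⟨δ₀, c₀, hδ₀, hc₀, H⟩ := decay110_flat_cube_level d ℓ hℓ ha
  refine ⟨δ₀, c₀ * Real.exp δ₀, hδ₀, by positivity, ?_⟩
  intro P hPd hPL k hk1 hkK c M0 hM0 hfit0 hN0 h y₁ y₂
  have hk : 0 + k ≤ P.m + P.K := by omega
  set A := B1RG242Torus.α P a k * (P.L : ℝ) ^ (k * P.d) with hAdef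
  have hak : 0 < B1.aSeq a P.L k := B1.aSeq_pos ha (B1RG242Torus.one_lt_cast_L P) hk1
  have hα : 0 < B1RG242Torus.α P a k := mul_pos hak (inv_pos.mpr (pow_pos (P.spacing_pos k) 2))
  have hA0 : 0 ≤ A := (mul_pos hα (pow_pos P.cast_L_pos _)).le
  set G0 := gBox A P.eps⁻¹ (gaugeAct h (1 : GaugeField P 0 U1)) k (cubeT hPd (P.L ^ k) c fun i => P.L ^ k * M0 i) with hG0def
  set Dl := max 0 (((P.L : ℝ) ^ k) * B5Ineq137Torus.T P (0 + k) y₁ y₂ - (((P.L : ℝ) ^ k) - 1)) with hDldef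
  have hSandwich : ‖(qMatT (gaugeAct h (1 : GaugeField P 0 U1)) k * G0 * (qMatT (gaugeAct h (1 : GaugeField P 0 U1)) k)ᴴ) y₁ y₂‖ ≤
      P.spacing k ^ 2 * (c₀ * Real.exp (-(δ₀ * (((P.L : ℝ) ^ k)⁻¹ * Dl))) * ((P.L : ℝ) ^ (k * P.d))⁻¹) :=
    norm_qMq_apply_le hk _ G0 y₁ y₂ fun x hx =>
      H P hPd hPL k hk1 hkK c M0 hM0 hfit0 hN0 h x _ _ Dl (fun x' => norm_conj_qMatT_le _ k y₂ x')
        (fun x' hx' => blockLower_le_T hk hx (conj_qMatT_ne_zero _ k hx'))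
  have hexp := exp_blockLower_level_le y₁ y₂ hδ₀.le
  rw [← hDldef] at hexp
  rw [deltaRegion_apply]
  calc ‖(A : ℂ) * (1 : Matrix _ _ ℂ) y₁ y₂ -
          ((A : ℂ) ^ 2) * (qMatT (gaugeAct h (1 : GaugeField P 0 U1)) k * G0 * (qMatT (gaugeAct h (1 : GaugeField P 0 U1)) k)ᴴ) y₁ y₂‖
      ≤ ‖(A : ℂ) * (1 : Matrix _ _ ℂ) y₁ y₂‖ +
          ‖((A : ℂ) ^ 2) * (qMatT (gaugeAct h (1 : GaugeField P 0 U1)) k * G0 * (qMatT (gaugeAct h (1 : GaugeField P 0 U1)) k)ᴴ) y₁ y₂‖ :=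
        norm_sub_le _ _
    _ ≤ A * (if y₁ = y₂ then 1 else 0) + A ^ 2 * (P.spacing k ^ 2 * (c₀ * Real.exp (-(δ₀ * (((P.L : ℝ) ^ k)⁻¹ * Dl))) * ((P.L : ℝ) ^ (k * P.d))⁻¹)) := by
        rw [norm_coe_mul_one_apply hA0, norm_mul, norm_pow, Complex.norm_real, Real.norm_eq_abs, abs_of_nonneg hA0]
        exact add_le_add le_rfl (mul_le_mul_of_nonneg_left hSandwich (sq_nonneg _))
    _ = A * ((if y₁ = y₂ then 1 else 0) + B1.aSeq a P.L k * c₀ * Real.exp (-(δ₀ * (((P.L : ℝ) ^ k)⁻¹ * Dl)))) := by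
        have e := scale_identity P a k
        rw [← hAdef] at e
        calc A * (if y₁ = y₂ then 1 else 0) + A ^ 2 * (P.spacing k ^ 2 * (c₀ * Real.exp (-(δ₀ * (((P.L : ℝ) ^ k)⁻¹ * Dl))) * ((P.L : ℝ) ^ (k * P.d))⁻¹))
            = A * (if y₁ = y₂ then 1 else 0) + A ^ 2 * (((P.L : ℝ) ^ (k * P.d))⁻¹ * P.spacing k ^ 2) * (c₀ * Real.exp (-(δ₀ * (((P.L : ℝ) ^ k)⁻¹ * Dl)))) := by
              ring
          _ = A * ((if y₁ = y₂ then 1 else 0) + B1.aSeq a P.L k * c₀ * Real.exp (-(δ₀ * (((P.L : ℝ) ^ k)⁻¹ * Dl)))) := by rw [e]; ring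
    _ ≤ A * ((if y₁ = y₂ then 1 else 0) +
          B1.aSeq a P.L k * (c₀ * Real.exp δ₀) * Real.exp (-(δ₀ * (B5Ineq137Torus.T P (0 + k) y₁ y₂)))) := by
        refine mul_le_mul_of_nonneg_left (add_le_add le_rfl ?_) hA0
        calc B1.aSeq a P.L k * c₀ * Real.exp (-(δ₀ * (((P.L : ℝ) ^ k)⁻¹ * Dl)))
            ≤ B1.aSeq a P.L k * c₀ * (Real.exp δ₀ * Real.exp (-(δ₀ * (B5Ineq137Torus.T P (0 + k) y₁ y₂)))) :=
              mul_le_mul_of_nonneg_left hexp (by positivity)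
          _ = B1.aSeq a P.L k * (c₀ * Real.exp δ₀) * Real.exp (-(δ₀ * (B5Ineq137Torus.T P (0 + k) y₁ y₂))) := by ring

/-- **(2.36) FOR GEN 15's `Δ_{k,loc}(1^h)`, IN LEVEL-`k` UNITS** (*"|Δ_{k,loc}(u;x₁,x₂)| ≤ ce^{−c|x₁−x₂|}, (2.36)"*, p. 263, with the
unit-lattice distance itself): for ANY finite family of no-wrap cubes shorter than the torus, weights `Σ_α|λ_α| ≤ 1`, `|ζ″| ≤ 1`, every `h`,
all `y₁, y₂ ∈ T^{(k)}` and every finite `S` containing the cubes active on the rows `x ∈ B^k(y₁)`: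
`‖Δ_{k,loc}(1^h; y₁,y₂)‖ ≤ A·([y₁ = y₂] + #S·a_k·c₀·e^{−δ₀|y₁−y₂|_{T^{(k)}}})`, `A = α_kL^{kd}`. [cite: BalabanImbrieJaffe1988, (2.36) p.263] -/
theorem decay236_flat_level (d ℓ : ℕ) (hℓ : 1 ≤ ℓ) {a : ℝ} (ha : 0 < a) :
    ∃ δ₀ c₀ : ℝ, 0 < δ₀ ∧ 0 < c₀ ∧ ∀ (P : Params) (hPd : P.d = d + 1), P.L = ℓ + 1 →
      ∀ k : ℕ, 1 ≤ k → k ≤ P.K → ∀ (ι : Type) [Fintype ι] (cube : ι → Finset (Balaban1983to89.Site P 0))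
        (lam : ι → Balaban1983to89.Site P 0 → Balaban1983to89.Site P 0 → ℝ)
        (ζ'' : Balaban1983to89.Site P 0 → Balaban1983to89.Site P 0 → ℝ),
        (∀ α, ∃ c M : Fin (d + 1) → ℕ, (∀ i, 1 ≤ M i) ∧ (∀ i, c i * P.L ^ k + P.L ^ k * M i ≤ P.sitesPerDir 0) ∧
            (∀ i, P.L ^ k * M i < P.sitesPerDir 0) ∧ cube α = cubeT hPd (P.L ^ k) c fun i => P.L ^ k * M i) →
        (∀ x y, ∑ α, |lam α x y| ≤ 1) → (∀ x y, |ζ'' x y| ≤ 1) →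
      ∀ (h : GaugeTransf P 0 U1) (y₁ y₂ : Balaban1983to89.Site P (0 + k)) (S : Finset ι),
        (∀ x ∈ blockK k y₁, ∀ α y, ζ'' x y * lam α x y ≠ 0 → α ∈ S) →
        ‖deltaLocT (B1RG242Torus.α P a k * (P.L : ℝ) ^ (k * P.d)) P.eps⁻¹ (gaugeAct h (1 : GaugeField P 0 U1)) k cube lam ζ'' y₁ y₂‖ ≤
          (B1RG242Torus.α P a k * (P.L : ℝ) ^ (k * P.d)) *
            ((if y₁ = y₂ then 1 else 0) +
              S.card * B1.aSeq a P.L k * c₀ * Real.exp (-(δ₀ * (B5Ineq137Torus.T P (0 + k) y₁ y₂)))) := by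
  obtain ⟨δ₀, c₀, hδ₀, hc₀, H⟩ := opDecay230_flat_level d ℓ hℓ ha
  refine ⟨δ₀, c₀ * Real.exp δ₀, hδ₀, by positivity, ?_⟩
  intro P hPd hPL k hk1 hkK ι _ cube lam ζ hcube hlam hζ h y₁ y₂ S hS
  have hk : 0 + k ≤ P.m + P.K := by omega
  set A := B1RG242Torus.α P a k * (P.L : ℝ) ^ (k * P.d) with hAdef
  have hak : 0 < B1.aSeq a P.L k := B1.aSeq_pos ha (B1RG242Torus.one_lt_cast_L P) hk1
  have hα : 0 < B1RG242Torus.α P a k := mul_pos hak (inv_pos.mpr (pow_pos (P.spacing_pos k) 2))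
  have hA0 : 0 ≤ A := (mul_pos hα (pow_pos P.cast_L_pos _)).le
  set Gloc := gLocT A P.eps⁻¹ (gaugeAct h (1 : GaugeField P 0 U1)) k cube lam ζ with hGlocdef
  set Dl := max 0 (((P.L : ℝ) ^ k) * B5Ineq137Torus.T P (0 + k) y₁ y₂ - (((P.L : ℝ) ^ k) - 1)) with hDldef
  have hSandwich : ‖(qMatT (gaugeAct h (1 : GaugeField P 0 U1)) k * Gloc * (qMatT (gaugeAct h (1 : GaugeField P 0 U1)) k)ᴴ) y₁ y₂‖ ≤
      P.spacing k ^ 2 * (S.card * (c₀ * Real.exp (-(δ₀ * (((P.L : ℝ) ^ k)⁻¹ * Dl))) * ((P.L : ℝ) ^ (k * P.d))⁻¹)) :=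
    norm_qMq_apply_le hk _ Gloc y₁ y₂ fun x hx =>
      H P hPd hPL k hk1 hkK ι cube lam ζ hcube hlam hζ h x _ _ Dl (fun x' => norm_conj_qMatT_le _ k y₂ x')
        (fun x' hx' => blockLower_le_T hk hx (conj_qMatT_ne_zero _ k hx')) S (fun α y hαy _ => hS x hx α y hαy)
  have hexp := exp_blockLower_level_le y₁ y₂ hδ₀.le
  rw [← hDldef] at hexp
  rw [deltaLocT_apply]
  calc ‖(A : ℂ) * (1 : Matrix _ _ ℂ) y₁ y₂ -
          ((A : ℂ) ^ 2) * (qMatT (gaugeAct h (1 : GaugeField P 0 U1)) k * Gloc * (qMatT (gaugeAct h (1 : GaugeField P 0 U1)) k)ᴴ) y₁ y₂‖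
      ≤ ‖(A : ℂ) * (1 : Matrix _ _ ℂ) y₁ y₂‖ +
          ‖((A : ℂ) ^ 2) * (qMatT (gaugeAct h (1 : GaugeField P 0 U1)) k * Gloc * (qMatT (gaugeAct h (1 : GaugeField P 0 U1)) k)ᴴ) y₁ y₂‖ :=
        norm_sub_le _ _
    _ ≤ A * (if y₁ = y₂ then 1 else 0) +
        A ^ 2 * (P.spacing k ^ 2 * (S.card * (c₀ * Real.exp (-(δ₀ * (((P.L : ℝ) ^ k)⁻¹ * Dl))) * ((P.L : ℝ) ^ (k * P.d))⁻¹))) := by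
        rw [norm_coe_mul_one_apply hA0, norm_mul, norm_pow, Complex.norm_real, Real.norm_eq_abs, abs_of_nonneg hA0]
        exact add_le_add le_rfl (mul_le_mul_of_nonneg_left hSandwich (sq_nonneg _))
    _ = A * ((if y₁ = y₂ then 1 else 0) + S.card * B1.aSeq a P.L k * c₀ * Real.exp (-(δ₀ * (((P.L : ℝ) ^ k)⁻¹ * Dl)))) := by
        have e := scale_identity P a k
        rw [← hAdef] at e
        calc A * (if y₁ = y₂ then 1 else 0) +
              A ^ 2 * (P.spacing k ^ 2 * (S.card * (c₀ * Real.exp (-(δ₀ * (((P.L : ℝ) ^ k)⁻¹ * Dl))) * ((P.L : ℝ) ^ (k * P.d))⁻¹)))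
            = A * (if y₁ = y₂ then 1 else 0) +
                A ^ 2 * (((P.L : ℝ) ^ (k * P.d))⁻¹ * P.spacing k ^ 2) * (S.card * (c₀ * Real.exp (-(δ₀ * (((P.L : ℝ) ^ k)⁻¹ * Dl))))) := by ring
          _ = A * ((if y₁ = y₂ then 1 else 0) + S.card * B1.aSeq a P.L k * c₀ * Real.exp (-(δ₀ * (((P.L : ℝ) ^ k)⁻¹ * Dl)))) := by rw [e]; ring
    _ ≤ A * ((if y₁ = y₂ then 1 else 0) +
          S.card * B1.aSeq a P.L k * (c₀ * Real.exp δ₀) * Real.exp (-(δ₀ * (B5Ineq137Torus.T P (0 + k) y₁ y₂)))) := by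
        refine mul_le_mul_of_nonneg_left (add_le_add le_rfl ?_) hA0
        calc S.card * B1.aSeq a P.L k * c₀ * Real.exp (-(δ₀ * (((P.L : ℝ) ^ k)⁻¹ * Dl)))
            ≤ S.card * B1.aSeq a P.L k * c₀ * (Real.exp δ₀ * Real.exp (-(δ₀ * (B5Ineq137Torus.T P (0 + k) y₁ y₂)))) :=
              mul_le_mul_of_nonneg_left hexp (by positivity)
          _ = S.card * B1.aSeq a P.L k * (c₀ * Real.exp δ₀) * Real.exp (-(δ₀ * (B5Ineq137Torus.T P (0 + k) y₁ y₂))) := by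
              ring

/-- **(2.35) FOR GEN 15's `Δ_{k,loc}(1^h)` AGAINST `Δ_k(Ω₀,1^h)`, IN LEVEL-`k` UNITS** (*"Hence |Δ_{k,loc}(u;x₁,x₂) − Δ_k(Ω,u;x₁,x₂)| ≤
e^{−cr(e_k)}e^{−c|x₁−x₂|} for dist({x₁,x₂},Ω^c) > O(r(e_k)), (2.35)"*, p. 263): under the hypotheses of §6's `close235_flat` (cubes nested in
the box `Ω₀`, `Σ_α|λ_α| ≤ 1`, `0 ≤ ζ″ ≤ 1`, the row hypotheses (i)–(iii) of (2.31) on every row `x ∈ B^k(y₁)`, `S ∋` the active cubes):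
`‖Δ_{k,loc}(1^h;y₁,y₂) − Δ_k(Ω₀,1^h;y₁,y₂)‖ ≤ A·a_k·c₀(#S·e^{−2δ₀R/L^k} + e^{−(δ₀/2)R₁/L^k})·e^{−(δ₀/2)|y₁−y₂|_{T^{(k)}}}` — at the printed
radii `R, R₁ = r(e_k)L^k` this is `A·a_k·c(#S)·e^{−c r(e_k)}·e^{−c|y₁−y₂|}` AT EVERY LEVEL `k`, the printed (2.35) (UNITS NOTE of the lane
owner, 2026-08-22). [cite: BalabanImbrieJaffe1988, (2.35) p.263] -/
theorem close235_flat_level (d ℓ : ℕ) (hℓ : 1 ≤ ℓ) {a : ℝ} (ha : 0 < a) :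
    ∃ δ₀ c₀ : ℝ, 0 < δ₀ ∧ 0 < c₀ ∧ ∀ (P : Params) (hPd : P.d = d + 1), P.L = ℓ + 1 →
      ∀ k : ℕ, 1 ≤ k → k ≤ P.K → ∀ (c M0 : Fin (d + 1) → ℕ), (∀ i, 1 ≤ M0 i) →
        (∀ i, c i * P.L ^ k + P.L ^ k * M0 i ≤ P.sitesPerDir 0) → (∀ i, P.L ^ k * M0 i < P.sitesPerDir 0) →
      ∀ (ι : Type) [Fintype ι] (cube : ι → Finset (Balaban1983to89.Site P 0))
        (lam : ι → Balaban1983to89.Site P 0 → Balaban1983to89.Site P 0 → ℝ)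
        (ζ'' : Balaban1983to89.Site P 0 → Balaban1983to89.Site P 0 → ℝ),
        (∀ α, ∃ t M : Fin (d + 1) → ℕ, (∀ i, 1 ≤ M i) ∧ (∀ i, t i + M i ≤ M0 i) ∧
            cube α = cubeT hPd (P.L ^ k) (c + t) fun i => P.L ^ k * M i) →
        (∀ x y, ∑ α, |lam α x y| ≤ 1) → (∀ x y, 0 ≤ ζ'' x y ∧ ζ'' x y ≤ 1) →
      ∀ (h : GaugeTransf P 0 U1) (R R₁ : ℝ), 0 ≤ R → 0 ≤ R₁ → ∀ (y₁ y₂ : Balaban1983to89.Site P (0 + k)),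
        (∀ x ∈ blockK k y₁, ∀ y, ζ'' x y ≠ 0 → ∑ α, lam α x y = 1) →
        (∀ x ∈ blockK k y₁, ∀ α y, ζ'' x y * lam α x y ≠ 0 → x ∈ cube α ∧ y ∈ cube α ∧
            ∀ w ∈ cubeT hPd (P.L ^ k) c (fun i => P.L ^ k * M0 i), w ∉ cube α →
              R ≤ B5Ineq137Torus.T P 0 x w ∧ R ≤ B5Ineq137Torus.T P 0 y w) →
        (∀ x ∈ blockK k y₁, ∀ y, B5Ineq137Torus.T P 0 x y ≤ R₁ → ζ'' x y = 1) →
      ∀ S : Finset ι, (∀ x ∈ blockK k y₁, ∀ α y, ζ'' x y * lam α x y ≠ 0 → α ∈ S) →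
        ‖deltaLocT (B1RG242Torus.α P a k * (P.L : ℝ) ^ (k * P.d)) P.eps⁻¹ (gaugeAct h (1 : GaugeField P 0 U1)) k cube lam ζ'' y₁ y₂ -
            deltaRegion (B1RG242Torus.α P a k * (P.L : ℝ) ^ (k * P.d)) P.eps⁻¹ (gaugeAct h (1 : GaugeField P 0 U1)) k
              (cubeT hPd (P.L ^ k) c fun i => P.L ^ k * M0 i) y₁ y₂‖ ≤
          (B1RG242Torus.α P a k * (P.L : ℝ) ^ (k * P.d)) * (B1.aSeq a P.L k * c₀ *
            (S.card * Real.exp (-(δ₀ * (((P.L : ℝ) ^ k)⁻¹ * (2 * R)))) + Real.exp (-(δ₀ / 2 * (((P.L : ℝ) ^ k)⁻¹ * R₁)))) *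
              Real.exp (-(δ₀ / 2 * (B5Ineq137Torus.T P (0 + k) y₁ y₂)))) := by
  obtain ⟨δ₀, c₀, hδ₀, hc₀, H⟩ := opClose231_flat_level d ℓ hℓ ha
  refine ⟨δ₀, c₀ * Real.exp (δ₀ / 2), hδ₀, by positivity, ?_⟩
  intro P hPd hPL k hk1 hkK c M0 hM0 hfit0 hN0 ι _ cube lam ζ hcube hlam hζ h R R₁ hR hR₁ y₁ y₂ hcomp hdeep hcut S hS
  have hk : 0 + k ≤ P.m + P.K := by omega
  set A := B1RG242Torus.α P a k * (P.L : ℝ) ^ (k * P.d) with hAdef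
  have hak : 0 < B1.aSeq a P.L k := B1.aSeq_pos ha (B1RG242Torus.one_lt_cast_L P) hk1
  have hα : 0 < B1RG242Torus.α P a k := mul_pos hak (inv_pos.mpr (pow_pos (P.spacing_pos k) 2))
  have hA0 : 0 ≤ A := (mul_pos hα (pow_pos P.cast_L_pos _)).le
  set Gloc := gLocT A P.eps⁻¹ (gaugeAct h (1 : GaugeField P 0 U1)) k cube lam ζ with hGlocdef
  set G0 := gBox A P.eps⁻¹ (gaugeAct h (1 : GaugeField P 0 U1)) k (cubeT hPd (P.L ^ k) c fun i => P.L ^ k * M0 i) with hG0def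
  set Dl := max 0 (((P.L : ℝ) ^ k) * B5Ineq137Torus.T P (0 + k) y₁ y₂ - (((P.L : ℝ) ^ k) - 1)) with hDldef
  have hDl0 : 0 ≤ Dl := le_max_left _ _
  set E := c₀ * (S.card * Real.exp (-(δ₀ * (((P.L : ℝ) ^ k)⁻¹ * (2 * R)))) + Real.exp (-(δ₀ / 2 * (((P.L : ℝ) ^ k)⁻¹ * R₁)))) with hEdef
  have hE0 : 0 ≤ E := by positivity
  have hSandwich : ‖(qMatT (gaugeAct h (1 : GaugeField P 0 U1)) k * (Gloc - G0) * (qMatT (gaugeAct h (1 : GaugeField P 0 U1)) k)ᴴ) y₁ y₂‖ ≤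
      P.spacing k ^ 2 * (E * Real.exp (-(δ₀ / 2 * (((P.L : ℝ) ^ k)⁻¹ * Dl))) * ((P.L : ℝ) ^ (k * P.d))⁻¹) := by
    refine norm_qMq_apply_le hk _ (Gloc - G0) y₁ y₂ fun x hx => ?_
    rw [Matrix.sub_mulVec, Pi.sub_apply]
    exact H P hPd hPL k hk1 hkK c M0 hM0 hfit0 hN0 ι cube lam ζ hcube hlam hζ h x R R₁ hR hR₁ (hcomp x hx) (hdeep x hx) (hcut x hx)
      _ _ Dl (fun x' => norm_conj_qMatT_le _ k y₂ x') hDl0 (fun x' hx' => blockLower_le_T hk hx (conj_qMatT_ne_zero _ k hx'))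
      S (fun α y hαy _ => hS x hx α y hαy)
  have hexp := exp_blockLower_level_le y₁ y₂ (half_pos hδ₀).le
  rw [← hDldef] at hexp
  rw [deltaLocT_sub_deltaRegion_apply, norm_neg, norm_mul, norm_pow, Complex.norm_real, Real.norm_eq_abs, abs_of_nonneg hA0]
  have e := scale_identity P a k
  rw [← hAdef] at e
  calc A ^ 2 * ‖(qMatT (gaugeAct h (1 : GaugeField P 0 U1)) k * (Gloc - G0) * (qMatT (gaugeAct h (1 : GaugeField P 0 U1)) k)ᴴ) y₁ y₂‖
      ≤ A ^ 2 * (P.spacing k ^ 2 * (E * Real.exp (-(δ₀ / 2 * (((P.L : ℝ) ^ k)⁻¹ * Dl))) * ((P.L : ℝ) ^ (k * P.d))⁻¹)) :=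
        mul_le_mul_of_nonneg_left hSandwich (sq_nonneg _)
    _ = A ^ 2 * (((P.L : ℝ) ^ (k * P.d))⁻¹ * P.spacing k ^ 2) * (E * Real.exp (-(δ₀ / 2 * (((P.L : ℝ) ^ k)⁻¹ * Dl)))) := by ring
    _ = A * B1.aSeq a P.L k * (E * Real.exp (-(δ₀ / 2 * (((P.L : ℝ) ^ k)⁻¹ * Dl)))) := by rw [e]
    _ ≤ A * B1.aSeq a P.L k * (E * (Real.exp (δ₀ / 2) * Real.exp (-(δ₀ / 2 * (B5Ineq137Torus.T P (0 + k) y₁ y₂))))) :=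
        mul_le_mul_of_nonneg_left (mul_le_mul_of_nonneg_left hexp hE0) (mul_nonneg hA0 hak.le)
    _ = A * (B1.aSeq a P.L k * (c₀ * Real.exp (δ₀ / 2)) *
          (S.card * Real.exp (-(δ₀ * (((P.L : ℝ) ^ k)⁻¹ * (2 * R)))) + Real.exp (-(δ₀ / 2 * (((P.L : ℝ) ^ k)⁻¹ * R₁)))) *
            Real.exp (-(δ₀ / 2 * (B5Ineq137Torus.T P (0 + k) y₁ y₂)))) := by rw [hEdef]; ring

/-- kernel: a difference version of the real/imaginary part split — `‖z − w‖ ≤ |Re z − Re w| + |Im z − Im w|`. [folklore] -/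
private theorem norm_sub_le_re_im₂ (z w : ℂ) : ‖z - w‖ ≤ |z.re - w.re| + |z.im - w.im| := by
  have h := Complex.norm_le_abs_re_add_abs_im (z - w)
  rwa [Complex.sub_re, Complex.sub_im] at h

/-- **[6] (1.10), COVARIANT-DERIVATIVE MEMBER, FOR THE TORUS CUBE PROPAGATORS AT `u = 1^h`, IN LEVEL-`k` UNITS** (gen 16's
`decay110_flat_cube_deriv` with the printed exponent and scale): on every bond `⟨x, x+e_μ⟩` of the cube,
`‖ε⁻¹(u_b(G_k(□,1^h)f)(b₊) − (G_k(□,1^h)f)(b₋))‖ ≤ (L^kε)·c₀e^{−δ₀D/L^k}F` — p38's `thm110_zero_box_deriv_value` (the `η`-difference quotient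
`(ℓ+1)^k·(Gf(z+e_μ) − Gf(z))`) read without the weakenings `L^kε ≤ 1`, `1/L^k ≥ ε` (`ε⁻¹(L^kε)² = (L^kε)·L^k`).
[cite: Balaban1983RegularityDecay, (1.10) p.573] -/
theorem decay110_flat_cube_deriv_level (d ℓ : ℕ) (hℓ : 1 ≤ ℓ) {a : ℝ} (ha : 0 < a) :
    ∃ δ₀ c₀ : ℝ, 0 < δ₀ ∧ 0 < c₀ ∧ ∀ (P : Params) (hPd : P.d = d + 1), P.L = ℓ + 1 →
      ∀ k : ℕ, 1 ≤ k → k ≤ P.K → ∀ (c M : Fin (d + 1) → ℕ), (∀ i, 1 ≤ M i) →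
        (∀ i, c i * P.L ^ k + P.L ^ k * M i ≤ P.sitesPerDir 0) → (∀ i, P.L ^ k * M i < P.sitesPerDir 0) →
        ∀ (h : GaugeTransf P 0 U1) (x : Balaban1983to89.Site P 0) (f : Balaban1983to89.Site P 0 → ℂ) (F D : ℝ),
          (∀ y, ‖f y‖ ≤ F) → (∀ y, f y ≠ 0 → D ≤ B5Ineq137Torus.T P 0 x y) →
          ∀ μ : Fin P.d, x ∈ cubeT hPd (P.L ^ k) c (fun i => P.L ^ k * M i) →
            x.shift μ ∈ cubeT hPd (P.L ^ k) c (fun i => P.L ^ k * M i) →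
            ‖covD P.eps⁻¹ (cfg (gaugeAct h (1 : GaugeField P 0 U1)))
                (gBox (B1RG242Torus.α P a k * (P.L : ℝ) ^ (k * P.d)) P.eps⁻¹ (gaugeAct h (1 : GaugeField P 0 U1)) k
                  (cubeT hPd (P.L ^ k) c fun i => P.L ^ k * M i) *ᵥ f) ⟨x, μ⟩‖ ≤
              P.spacing k * (c₀ * Real.exp (-(δ₀ * (((P.L : ℝ) ^ k)⁻¹ * D))) * F) := by
  obtain ⟨δ₀, c₀, hδ₀, hc₀, H⟩ := B4Thm110ZeroBoxDeriv.thm110_zero_box_deriv_value d ℓ hℓ a a 0 ha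
  refine ⟨δ₀, 2 * c₀, hδ₀, by positivity, ?_⟩
  intro P hPd hPL k hk1 hkK c M hM hfit hN h x f F D hF hsupp μ hx hxe
  have hk : k ≤ P.m + P.K := hkK.trans (Nat.le_add_left _ _)
  have e1 : P.L ^ k = (ℓ + 1) ^ k := by rw [hPL]
  rw [e1] at hfit hN hx hxe ⊢
  have hn : (ℓ + 1) ^ k = P.L ^ k := e1.symm
  have hncast : (((ℓ + 1) ^ k : ℕ) : ℝ) = (P.L : ℝ) ^ k := by rw [hn]; push_cast; rfl
  have hnpos : (0 : ℝ) < (((ℓ + 1) ^ k : ℕ) : ℝ) := by positivity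
  -- the exponent of [6] in level-`k` units: `D/(ℓ+1)^k = D/L^k`
  have hconv : ∀ E : ℝ, Real.exp (-(δ₀ * E / ((((ℓ + 1) ^ k : ℕ) : ℝ)))) = Real.exp (-(δ₀ * (((P.L : ℝ) ^ k)⁻¹ * E))) := fun E => by
    congr 1
    rw [hncast, div_eq_mul_inv]
    ring
  -- the scales: `ε⁻¹·(L^kε)² = (L^kε)·L^k`
  have hscale : P.eps⁻¹ * P.spacing k ^ 2 = P.spacing k * (((ℓ + 1) ^ k : ℕ) : ℝ) := by
    rw [hncast, Params.spacing]
    have hε : P.eps ≠ 0 := P.eps_pos.ne'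
    field_simp
  -- [6]'s box theorem, read with `L = ℓ + 1`
  have hLcast : ((ℓ : ℝ) + 1) = (P.L : ℝ) := by rw [hPL]; push_cast; ring
  have H' := H k hk1 a 0 le_rfl le_rfl le_rfl le_rfl M hM
  rw [hLcast] at H'
  -- the two end-points of the bond in the box
  obtain ⟨z, hz, rfl⟩ := (mem_cubeT hPd).1 hx
  have hze : z + Pi.single (Fin.cast hPd μ) 1 ∈ boxDom (fun i => (ℓ + 1) ^ k * M i) := (shift_cubePt_mem_iff hPd hN hz μ).1 hxe
  have hshift : (cubePt hPd ((ℓ + 1) ^ k) c z).shift μ = cubePt hPd ((ℓ + 1) ^ k) c (z + Pi.single (Fin.cast hPd μ) 1) := by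
    rw [cubePt_add_single]
    congr 1
  -- the real estimate for a real source `φ` supported like `f`
  have key : ∀ φ : Balaban1983to89.Site P 0 → ℝ, (∀ y, |φ y| ≤ F) →
      (∀ y, φ y ≠ 0 → D ≤ B5Ineq137Torus.T P 0 (cubePt hPd ((ℓ + 1) ^ k) c z) y) →
      P.eps⁻¹ * |(gCubeR hPd ((ℓ + 1) ^ k) c M (P.spacing k ^ 2) (B1.aSeq a P.L k) *ᵥ φ)
            (cubePt hPd ((ℓ + 1) ^ k) c (z + Pi.single (Fin.cast hPd μ) 1)) -
          (gCubeR hPd ((ℓ + 1) ^ k) c M (P.spacing k ^ 2) (B1.aSeq a P.L k) *ᵥ φ) (cubePt hPd ((ℓ + 1) ^ k) c z)| ≤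
        P.spacing k * (c₀ * Real.exp (-(δ₀ * (((P.L : ℝ) ^ k)⁻¹ * D))) * F) := by
    intro φ hφ hφs
    rw [gCubeR_mulVec_cubePt hPd hfit _ _ φ hze, gCubeR_mulVec_cubePt hPd hfit _ _ φ hz, ← mul_sub, abs_mul,
      abs_of_nonneg (sq_nonneg _), ← mul_assoc, hscale, mul_assoc, ← abs_of_pos hnpos, ← abs_mul]
    have hB := H' (fun v => φ (cubePt hPd ((ℓ + 1) ^ k) c (v : Fin (d + 1) → ℤ))) F D (fun v => hφ _) (Fin.cast hPd μ)
      ⟨z, hz⟩ ⟨z + Pi.single (Fin.cast hPd μ) 1, hze⟩ rfl (fun v hv => (hφs _ hv).trans (T_cubePt_le hPd hfit hz v.2))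
    rw [hconv D] at hB
    exact mul_le_mul_of_nonneg_left hB (P.spacing_pos k).le
  -- pure gauge, the bridge, and the real/imaginary split of `h̄f`
  rw [covD_gBox_cube_pureGauge hPd hk1 hk hn hfit hN hM ha, norm_mul, norm_toC, one_mul, norm_mul, Complex.norm_real,
    Real.norm_eq_abs, abs_of_pos (inv_pos.mpr P.eps_pos)]
  set g : Balaban1983to89.Site P 0 → ℂ := fun y => (starRingEnd ℂ) (toC (h y)) * f y with hg
  have hgR : ∀ y, |(g y).re| ≤ F := fun y => ((Complex.abs_re_le_norm _).trans_eq (norm_rot h f y)).trans (hF y)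
  have hgI : ∀ y, |(g y).im| ≤ F := fun y => ((Complex.abs_im_le_norm _).trans_eq (norm_rot h f y)).trans (hF y)
  have hsR : ∀ y, (g y).re ≠ 0 → D ≤ B5Ineq137Torus.T P 0 (cubePt hPd ((ℓ + 1) ^ k) c z) y := fun y hy =>
    hsupp y fun hf => hy (by simp only [hg, hf, mul_zero, Complex.zero_re])
  have hsI : ∀ y, (g y).im ≠ 0 → D ≤ B5Ineq137Torus.T P 0 (cubePt hPd ((ℓ + 1) ^ k) c z) y := fun y hy =>
    hsupp y fun hf => hy (by simp only [hg, hf, mul_zero, Complex.zero_im])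
  have hE2 : P.spacing k * (2 * c₀ * Real.exp (-(δ₀ * (((P.L : ℝ) ^ k)⁻¹ * D))) * F) =
      P.spacing k * (c₀ * Real.exp (-(δ₀ * (((P.L : ℝ) ^ k)⁻¹ * D))) * F) +
        P.spacing k * (c₀ * Real.exp (-(δ₀ * (((P.L : ℝ) ^ k)⁻¹ * D))) * F) := by ring
  rw [hE2]
  have hsrc : (⟨cubePt hPd ((ℓ + 1) ^ k) c z, μ⟩ : PBond P 0).src = cubePt hPd ((ℓ + 1) ^ k) c z := rfl
  have htgt : (⟨cubePt hPd ((ℓ + 1) ^ k) c z, μ⟩ : PBond P 0).tgt = cubePt hPd ((ℓ + 1) ^ k) c (z + Pi.single (Fin.cast hPd μ) 1) :=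
    hshift
  rw [hsrc, htgt]
  refine (mul_le_mul_of_nonneg_left (norm_sub_le_re_im₂ _ _) (inv_pos.mpr P.eps_pos).le).trans ?_
  rw [re_map_mulVec₂, re_map_mulVec₂, im_map_mulVec₂, im_map_mulVec₂, mul_add]
  exact add_le_add (key _ hgR hsR) (key _ hgI hsI)

/-- **[6] (1.11)–(1.12) AT `A = 0`, COVARIANT-DERIVATIVE MEMBER, FOR THE NESTED TORUS CUBES AT `u = 1^h`, IN LEVEL-`k` UNITS** (the companion
file's `close112_flat_cube_deriv` with the printed exponents and scale): on every bond of the inner cube,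
`‖ε⁻¹(u_b(G_□f)(b₊) − (G_□f)(b₋)) − ε⁻¹(u_b(G_{Ω₀}f)(b₊) − (G_{Ω₀}f)(b₋))‖ ≤ (L^kε)·c₀e^{−δ₀D/L^k}e^{−δ₀(D_b+D_f)/L^k}F` — r01/b04's
`delta112_zero_box_deriv` by name. [cite: Balaban1983RegularityDecay, (1.11)–(1.12) p.573] -/
theorem close112_flat_cube_deriv_level (d ℓ : ℕ) (hℓ : 1 ≤ ℓ) {a : ℝ} (ha : 0 < a) :
    ∃ δ₀ c₀ : ℝ, 0 < δ₀ ∧ 0 < c₀ ∧ ∀ (P : Params) (hPd : P.d = d + 1), P.L = ℓ + 1 →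
      ∀ k : ℕ, 1 ≤ k → k ≤ P.K → ∀ (c M0 t M : Fin (d + 1) → ℕ), (∀ i, 1 ≤ M i) → (∀ i, t i + M i ≤ M0 i) →
        (∀ i, c i * P.L ^ k + P.L ^ k * M0 i ≤ P.sitesPerDir 0) → (∀ i, P.L ^ k * M0 i < P.sitesPerDir 0) →
        ∀ (h : GaugeTransf P 0 U1) (x : Balaban1983to89.Site P 0) (μ : Fin P.d),
          x ∈ cubeT hPd (P.L ^ k) (c + t) (fun i => P.L ^ k * M i) → x.shift μ ∈ cubeT hPd (P.L ^ k) (c + t) (fun i => P.L ^ k * M i) →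
        ∀ (f : Balaban1983to89.Site P 0 → ℂ) (F D Db Df : ℝ), (∀ y, ‖f y‖ ≤ F) →
          (∀ y, y ∉ cubeT hPd (P.L ^ k) (c + t) (fun i => P.L ^ k * M i) → f y = 0) →
          (∀ y, f y ≠ 0 → D ≤ B5Ineq137Torus.T P 0 x y) →
          (∀ w ∈ cubeT hPd (P.L ^ k) c (fun i => P.L ^ k * M0 i), w ∉ cubeT hPd (P.L ^ k) (c + t) (fun i => P.L ^ k * M i) →
            Db ≤ B5Ineq137Torus.T P 0 x w) →
          (∀ y, f y ≠ 0 → ∀ w ∈ cubeT hPd (P.L ^ k) c (fun i => P.L ^ k * M0 i),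
            w ∉ cubeT hPd (P.L ^ k) (c + t) (fun i => P.L ^ k * M i) → Df ≤ B5Ineq137Torus.T P 0 y w) →
          ‖covD P.eps⁻¹ (cfg (gaugeAct h (1 : GaugeField P 0 U1)))
                (gBox (B1RG242Torus.α P a k * (P.L : ℝ) ^ (k * P.d)) P.eps⁻¹ (gaugeAct h (1 : GaugeField P 0 U1)) k
                  (cubeT hPd (P.L ^ k) (c + t) fun i => P.L ^ k * M i) *ᵥ f) ⟨x, μ⟩ -
            covD P.eps⁻¹ (cfg (gaugeAct h (1 : GaugeField P 0 U1)))
                (gBox (B1RG242Torus.α P a k * (P.L : ℝ) ^ (k * P.d)) P.eps⁻¹ (gaugeAct h (1 : GaugeField P 0 U1)) k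
                  (cubeT hPd (P.L ^ k) c fun i => P.L ^ k * M0 i) *ᵥ f) ⟨x, μ⟩‖ ≤
            P.spacing k * (c₀ * Real.exp (-(δ₀ * (((P.L : ℝ) ^ k)⁻¹ * D))) * Real.exp (-(δ₀ * (((P.L : ℝ) ^ k)⁻¹ * (Db + Df)))) * F) := by
  obtain ⟨δ₀, c₀, hδ₀, hc₀, H⟩ := B4Delta112ZeroBox.delta112_zero_box_deriv d ℓ hℓ a a 0 ha
  refine ⟨δ₀, 2 * c₀, hδ₀, by positivity, ?_⟩
  intro P hPd hPL k hk1 hkK c M0 t M hM hnest hfit0 hN0 h x μ hx hxe f F D Db Df hF hfs hsD hsDb hsDf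
  have hk : k ≤ P.m + P.K := hkK.trans (Nat.le_add_left _ _)
  have e1 : P.L ^ k = (ℓ + 1) ^ k := by rw [hPL]
  rw [e1] at hfit0 hN0 hx hxe hfs hsDb hsDf ⊢
  have hn : (ℓ + 1) ^ k = P.L ^ k := e1.symm
  have hfit := fit_of_nested hnest hfit0
  have hN := short_of_nested hnest hN0
  have hM0 := one_le_of_nested hnest hM
  have hncast : (((ℓ + 1) ^ k : ℕ) : ℝ) = (P.L : ℝ) ^ k := by rw [hn]; push_cast; rfl
  have hnpos : (0 : ℝ) < (((ℓ + 1) ^ k : ℕ) : ℝ) := by positivity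
  have hconv : ∀ E : ℝ, Real.exp (-(δ₀ * E / ((((ℓ + 1) ^ k : ℕ) : ℝ)))) = Real.exp (-(δ₀ * (((P.L : ℝ) ^ k)⁻¹ * E))) := fun E => by
    congr 1
    rw [hncast, div_eq_mul_inv]
    ring
  have hscale : P.eps⁻¹ * P.spacing k ^ 2 = P.spacing k * (((ℓ + 1) ^ k : ℕ) : ℝ) := by
    rw [hncast, Params.spacing]
    have hε : P.eps ≠ 0 := P.eps_pos.ne'
    field_simp
  have hLcast : ((ℓ : ℝ) + 1) = (P.L : ℝ) := by rw [hPL]; push_cast; ring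
  have H' := H k hk1 a 0 le_rfl le_rfl le_rfl le_rfl M M0 (fun i => (t i : ℤ)) (fits_of_nested hnest) hM
  rw [hLcast] at H'
  -- the two end-points of the bond in the inner box
  obtain ⟨z, hz, rfl⟩ := (mem_cubeT hPd).1 hx
  have hz0 := add_mem_boxDom_nested (n := (ℓ + 1) ^ k) hnest hz
  have hze : z + Pi.single (Fin.cast hPd μ) 1 ∈ boxDom (fun i => (ℓ + 1) ^ k * M i) := (shift_cubePt_mem_iff hPd hN hz μ).1 hxe
  have hshift : (cubePt hPd ((ℓ + 1) ^ k) (c + t) z).shift μ = cubePt hPd ((ℓ + 1) ^ k) (c + t) (z + Pi.single (Fin.cast hPd μ) 1) := by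
    rw [cubePt_add_single]
    congr 1
  -- the real estimate for a real source `φ` supported in the inner cube like `f`
  have key : ∀ φ : Balaban1983to89.Site P 0 → ℝ, (∀ y, |φ y| ≤ F) →
      (∀ y, y ∉ cubeT hPd ((ℓ + 1) ^ k) (c + t) (fun i => (ℓ + 1) ^ k * M i) → φ y = 0) →
      (∀ y, φ y ≠ 0 → D ≤ B5Ineq137Torus.T P 0 (cubePt hPd ((ℓ + 1) ^ k) (c + t) z) y) →
      (∀ y, φ y ≠ 0 → ∀ w ∈ cubeT hPd ((ℓ + 1) ^ k) c (fun i => (ℓ + 1) ^ k * M0 i),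
        w ∉ cubeT hPd ((ℓ + 1) ^ k) (c + t) (fun i => (ℓ + 1) ^ k * M i) → Df ≤ B5Ineq137Torus.T P 0 y w) →
      P.eps⁻¹ * |((gCubeR hPd ((ℓ + 1) ^ k) (c + t) M (P.spacing k ^ 2) (B1.aSeq a P.L k) *ᵥ φ)
              (cubePt hPd ((ℓ + 1) ^ k) (c + t) (z + Pi.single (Fin.cast hPd μ) 1)) -
            (gCubeR hPd ((ℓ + 1) ^ k) c M0 (P.spacing k ^ 2) (B1.aSeq a P.L k) *ᵥ φ)
              (cubePt hPd ((ℓ + 1) ^ k) (c + t) (z + Pi.single (Fin.cast hPd μ) 1))) -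
          ((gCubeR hPd ((ℓ + 1) ^ k) (c + t) M (P.spacing k ^ 2) (B1.aSeq a P.L k) *ᵥ φ) (cubePt hPd ((ℓ + 1) ^ k) (c + t) z) -
            (gCubeR hPd ((ℓ + 1) ^ k) c M0 (P.spacing k ^ 2) (B1.aSeq a P.L k) *ᵥ φ) (cubePt hPd ((ℓ + 1) ^ k) (c + t) z))| ≤
        P.spacing k * (c₀ * Real.exp (-(δ₀ * (((P.L : ℝ) ^ k)⁻¹ * D))) * Real.exp (-(δ₀ * (((P.L : ℝ) ^ k)⁻¹ * (Db + Df)))) * F) := by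
    intro φ hφ hφ0 hφD hφDf
    rw [gCubeR_sub_nested_cubePt hPd hfit0 hnest _ _ φ hφ0 hze, gCubeR_sub_nested_cubePt hPd hfit0 hnest _ _ φ hφ0 hz, ← mul_sub,
      abs_mul, abs_of_nonneg (sq_nonneg _), ← mul_assoc, hscale, mul_assoc, ← abs_of_pos hnpos, ← abs_mul]
    have hB := H' (fun w => φ (cubePt hPd ((ℓ + 1) ^ k) (c + t) (w : Fin (d + 1) → ℤ))) F (fun w => hφ _) (Fin.cast hPd μ)
      ⟨z, hz⟩ ⟨z + Pi.single (Fin.cast hPd μ) 1, hze⟩ rfl D Db Df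
      (fun w hw => (hφD _ hw).trans (T_cubePt_le hPd hfit hz w.2))
      (fun y' hy' => by
        have hw : cubePt hPd ((ℓ + 1) ^ k) c (y' : Fin (d + 1) → ℤ) ∈ cubeT hPd ((ℓ + 1) ^ k) c (fun i => (ℓ + 1) ^ k * M0 i) :=
          cubePt_mem_cubeT hPd y'.2
        have hw' : cubePt hPd ((ℓ + 1) ^ k) c (y' : Fin (d + 1) → ℤ) ∉ cubeT hPd ((ℓ + 1) ^ k) (c + t) (fun i => (ℓ + 1) ^ k * M i) :=
          fun hm => hy' (sub_mem_of_cubePt_mem hPd hfit0 hnest y'.2 hm)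
        have h1 := hsDb _ hw hw'
        rw [cubePt_nested hPd] at h1
        exact h1.trans (T_cubePt_le hPd hfit0 hz0 y'.2))
      (fun w hw y' hy' => by
        have hv : cubePt hPd ((ℓ + 1) ^ k) c (y' : Fin (d + 1) → ℤ) ∈ cubeT hPd ((ℓ + 1) ^ k) c (fun i => (ℓ + 1) ^ k * M0 i) :=
          cubePt_mem_cubeT hPd y'.2
        have hv' : cubePt hPd ((ℓ + 1) ^ k) c (y' : Fin (d + 1) → ℤ) ∉ cubeT hPd ((ℓ + 1) ^ k) (c + t) (fun i => (ℓ + 1) ^ k * M i) :=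
          fun hm => hy' (sub_mem_of_cubePt_mem hPd hfit0 hnest y'.2 hm)
        have h1 := hφDf _ hw _ hv hv'
        rw [cubePt_nested hPd] at h1
        exact h1.trans (T_cubePt_le hPd hfit0 (add_mem_boxDom_nested hnest w.2) y'.2))
    have hE : Real.exp (-(δ₀ * Db / ((((ℓ + 1) ^ k : ℕ) : ℝ)) + δ₀ * Df / ((((ℓ + 1) ^ k : ℕ) : ℝ)))) =
        Real.exp (-(δ₀ * (((P.L : ℝ) ^ k)⁻¹ * (Db + Df)))) := by
      congr 1
      rw [hncast, div_eq_mul_inv, div_eq_mul_inv]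
      ring
    rw [hconv D, hE] at hB
    exact mul_le_mul_of_nonneg_left hB (P.spacing_pos k).le
  -- pure gauge on both cubes, the bridge, and the real/imaginary split of `h̄f`
  rw [covD_gBox_cube_pureGauge hPd hk1 hk hn hfit hN hM ha, covD_gBox_cube_pureGauge hPd hk1 hk hn hfit0 hN0 hM0 ha, ← mul_sub, norm_mul,
    norm_toC, one_mul, ← mul_sub, norm_mul, Complex.norm_real, Real.norm_eq_abs, abs_of_pos (inv_pos.mpr P.eps_pos)]
  set g : Balaban1983to89.Site P 0 → ℂ := fun y => (starRingEnd ℂ) (toC (h y)) * f y with hg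
  have hgR : ∀ y, |(g y).re| ≤ F := fun y => ((Complex.abs_re_le_norm _).trans_eq (norm_rot h f y)).trans (hF y)
  have hgI : ∀ y, |(g y).im| ≤ F := fun y => ((Complex.abs_im_le_norm _).trans_eq (norm_rot h f y)).trans (hF y)
  have hg0 : ∀ y, f y = 0 → g y = 0 := fun y hf => by simp only [hg, hf, mul_zero]
  have hR0 : ∀ y, y ∉ cubeT hPd ((ℓ + 1) ^ k) (c + t) (fun i => (ℓ + 1) ^ k * M i) → (g y).re = 0 := fun y hy => by
    rw [hg0 y (hfs y hy), Complex.zero_re]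
  have hI0 : ∀ y, y ∉ cubeT hPd ((ℓ + 1) ^ k) (c + t) (fun i => (ℓ + 1) ^ k * M i) → (g y).im = 0 := fun y hy => by
    rw [hg0 y (hfs y hy), Complex.zero_im]
  have hRne : ∀ y, (g y).re ≠ 0 → f y ≠ 0 := fun y hy hf => hy (by rw [hg0 y hf, Complex.zero_re])
  have hIne : ∀ y, (g y).im ≠ 0 → f y ≠ 0 := fun y hy hf => hy (by rw [hg0 y hf, Complex.zero_im])
  have hE2 : P.spacing k * (2 * c₀ * Real.exp (-(δ₀ * (((P.L : ℝ) ^ k)⁻¹ * D))) *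
      Real.exp (-(δ₀ * (((P.L : ℝ) ^ k)⁻¹ * (Db + Df)))) * F) =
      P.spacing k * (c₀ * Real.exp (-(δ₀ * (((P.L : ℝ) ^ k)⁻¹ * D))) * Real.exp (-(δ₀ * (((P.L : ℝ) ^ k)⁻¹ * (Db + Df)))) * F) +
        P.spacing k * (c₀ * Real.exp (-(δ₀ * (((P.L : ℝ) ^ k)⁻¹ * D))) * Real.exp (-(δ₀ * (((P.L : ℝ) ^ k)⁻¹ * (Db + Df)))) * F) := by
    ring
  rw [hE2]
  have hsrc : (⟨cubePt hPd ((ℓ + 1) ^ k) (c + t) z, μ⟩ : PBond P 0).src = cubePt hPd ((ℓ + 1) ^ k) (c + t) z := rfl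
  have htgt : (⟨cubePt hPd ((ℓ + 1) ^ k) (c + t) z, μ⟩ : PBond P 0).tgt =
      cubePt hPd ((ℓ + 1) ^ k) (c + t) (z + Pi.single (Fin.cast hPd μ) 1) := hshift
  rw [hsrc, htgt]
  set As := (gCubeR hPd ((ℓ + 1) ^ k) (c + t) M (P.spacing k ^ 2) (B1.aSeq a P.L k)).map Complex.ofRealHom with hAs
  set Ab := (gCubeR hPd ((ℓ + 1) ^ k) c M0 (P.spacing k ^ 2) (B1.aSeq a P.L k)).map Complex.ofRealHom with hAb
  have hre : (As *ᵥ g) (cubePt hPd ((ℓ + 1) ^ k) (c + t) (z + Pi.single (Fin.cast hPd μ) 1)) - (As *ᵥ g) (cubePt hPd ((ℓ + 1) ^ k) (c + t) z) -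
      ((Ab *ᵥ g) (cubePt hPd ((ℓ + 1) ^ k) (c + t) (z + Pi.single (Fin.cast hPd μ) 1)) - (Ab *ᵥ g) (cubePt hPd ((ℓ + 1) ^ k) (c + t) z)) =
      ((As *ᵥ g) (cubePt hPd ((ℓ + 1) ^ k) (c + t) (z + Pi.single (Fin.cast hPd μ) 1)) -
          (Ab *ᵥ g) (cubePt hPd ((ℓ + 1) ^ k) (c + t) (z + Pi.single (Fin.cast hPd μ) 1))) -
        ((As *ᵥ g) (cubePt hPd ((ℓ + 1) ^ k) (c + t) z) - (Ab *ᵥ g) (cubePt hPd ((ℓ + 1) ^ k) (c + t) z)) := by ring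
  rw [hre]
  refine (mul_le_mul_of_nonneg_left (norm_sub_le_re_im₂ _ _) (inv_pos.mpr P.eps_pos).le).trans ?_
  rw [hAs, hAb, Complex.sub_re, Complex.sub_re, Complex.sub_im, Complex.sub_im, re_map_mulVec₂, re_map_mulVec₂, re_map_mulVec₂,
    re_map_mulVec₂, im_map_mulVec₂, im_map_mulVec₂, im_map_mulVec₂, im_map_mulVec₂, mul_add]
  exact add_le_add
    (key _ hgR hR0 (fun y hy => hsD y (hRne y hy)) (fun y hy => hsDf y (hRne y hy)))
    (key _ hgI hI0 (fun y hy => hsD y (hIne y hy)) (fun y hy => hsDf y (hIne y hy)))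

/-- **KERNEL DECAY OF (2.27) `G̃_k(1^h) = Σ_α λ_αG_k(□_α,1^h)`, IN LEVEL-`k` UNITS** (gen 16's `decay_gTilde_flat_kernel` with the printed
exponent): over ANY finite family of no-wrap cubes shorter than the torus and real weights `Σ_α|λ_α| ≤ 1`,
`‖G̃_k(1^h; x₁, x₂)‖ ≤ (L^kε)²·c₀e^{−δ₀|x₁−x₂|_T/L^k}`. [cite: BalabanImbrieJaffe1988, (2.27) p.263] -/
theorem decay_gTilde_flat_kernel_level (d ℓ : ℕ) (hℓ : 1 ≤ ℓ) {a : ℝ} (ha : 0 < a) :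
    ∃ δ₀ c₀ : ℝ, 0 < δ₀ ∧ 0 < c₀ ∧ ∀ (P : Params) (hPd : P.d = d + 1), P.L = ℓ + 1 →
      ∀ k : ℕ, 1 ≤ k → k ≤ P.K → ∀ (ι : Type) [Fintype ι] (cube : ι → Finset (Balaban1983to89.Site P 0))
        (lam : ι → Balaban1983to89.Site P 0 → Balaban1983to89.Site P 0 → ℝ),
        (∀ α, ∃ c M : Fin (d + 1) → ℕ, (∀ i, 1 ≤ M i) ∧ (∀ i, c i * P.L ^ k + P.L ^ k * M i ≤ P.sitesPerDir 0) ∧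
            (∀ i, P.L ^ k * M i < P.sitesPerDir 0) ∧ cube α = cubeT hPd (P.L ^ k) c fun i => P.L ^ k * M i) →
        (∀ x y, ∑ α, |lam α x y| ≤ 1) →
        ∀ (h : GaugeTransf P 0 U1) (x y : Balaban1983to89.Site P 0),
          ‖BIJ88DeltaLoc234Torus.gTilde (B1RG242Torus.α P a k * (P.L : ℝ) ^ (k * P.d)) P.eps⁻¹ (gaugeAct h (1 : GaugeField P 0 U1)) k
              cube lam x y‖ ≤ P.spacing k ^ 2 * (c₀ * Real.exp (-(δ₀ * (((P.L : ℝ) ^ k)⁻¹ * B5Ineq137Torus.T P 0 x y)))) := by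
  obtain ⟨δ₀, c₀, hδ₀, hc₀, H⟩ := decay110_flat_cube_kernel_level d ℓ hℓ ha
  refine ⟨δ₀, c₀, hδ₀, hc₀, ?_⟩
  intro P hPd hPL k hk1 hkK ι _ cube lam hcube hlam h x y
  rw [BIJ88DeltaLoc234Torus.gTilde_apply]
  have hB : ∀ α, ‖gBox (B1RG242Torus.α P a k * (P.L : ℝ) ^ (k * P.d)) P.eps⁻¹ (gaugeAct h (1 : GaugeField P 0 U1)) k (cube α) x y‖ ≤
      P.spacing k ^ 2 * (c₀ * Real.exp (-(δ₀ * (((P.L : ℝ) ^ k)⁻¹ * B5Ineq137Torus.T P 0 x y)))) := fun α => by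
    obtain ⟨c, M, hM, hfit, hN, hc⟩ := hcube α
    rw [hc]
    exact H P hPd hPL k hk1 hkK c M hM hfit hN h x y
  have hE : 0 ≤ P.spacing k ^ 2 * (c₀ * Real.exp (-(δ₀ * (((P.L : ℝ) ^ k)⁻¹ * B5Ineq137Torus.T P 0 x y)))) := by positivity
  calc ‖∑ α, (lam α x y : ℂ) *
          gBox (B1RG242Torus.α P a k * (P.L : ℝ) ^ (k * P.d)) P.eps⁻¹ (gaugeAct h (1 : GaugeField P 0 U1)) k (cube α) x y‖
      ≤ ∑ α, ‖(lam α x y : ℂ) *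
          gBox (B1RG242Torus.α P a k * (P.L : ℝ) ^ (k * P.d)) P.eps⁻¹ (gaugeAct h (1 : GaugeField P 0 U1)) k (cube α) x y‖ :=
        norm_sum_le _ _
    _ ≤ ∑ α, |lam α x y| * (P.spacing k ^ 2 * (c₀ * Real.exp (-(δ₀ * (((P.L : ℝ) ^ k)⁻¹ * B5Ineq137Torus.T P 0 x y))))) := by
        refine sum_le_sum fun α _ => ?_
        rw [norm_mul, Complex.norm_real, Real.norm_eq_abs]
        exact mul_le_mul_of_nonneg_left (hB α) (abs_nonneg _)
    _ = (∑ α, |lam α x y|) * (P.spacing k ^ 2 * (c₀ * Real.exp (-(δ₀ * (((P.L : ℝ) ^ k)⁻¹ * B5Ineq137Torus.T P 0 x y))))) := by rw [Finset.sum_mul]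
    _ ≤ 1 * (P.spacing k ^ 2 * (c₀ * Real.exp (-(δ₀ * (((P.L : ℝ) ^ k)⁻¹ * B5Ineq137Torus.T P 0 x y))))) := mul_le_mul_of_nonneg_right (hlam x y) hE
    _ = P.spacing k ^ 2 * (c₀ * Real.exp (-(δ₀ * (((P.L : ℝ) ^ k)⁻¹ * B5Ineq137Torus.T P 0 x y)))) := one_mul _

/-- **KERNEL DECAY OF (2.28) `G_{k,loc}(1^h) = ζ″G̃_k(1^h)`, IN LEVEL-`k` UNITS** (gen 16's `decay_gLocT_flat_kernel` with the printed
exponent): `‖G_{k,loc}(1^h; x₁, x₂)‖ ≤ (L^kε)²·c₀e^{−δ₀|x₁−x₂|_T/L^k}` for any real cut-off `|ζ″| ≤ 1`. [cite: BalabanImbrieJaffe1988, (2.28) p.263] -/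
theorem decay_gLocT_flat_kernel_level (d ℓ : ℕ) (hℓ : 1 ≤ ℓ) {a : ℝ} (ha : 0 < a) :
    ∃ δ₀ c₀ : ℝ, 0 < δ₀ ∧ 0 < c₀ ∧ ∀ (P : Params) (hPd : P.d = d + 1), P.L = ℓ + 1 →
      ∀ k : ℕ, 1 ≤ k → k ≤ P.K → ∀ (ι : Type) [Fintype ι] (cube : ι → Finset (Balaban1983to89.Site P 0))
        (lam : ι → Balaban1983to89.Site P 0 → Balaban1983to89.Site P 0 → ℝ)
        (ζ'' : Balaban1983to89.Site P 0 → Balaban1983to89.Site P 0 → ℝ),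
        (∀ α, ∃ c M : Fin (d + 1) → ℕ, (∀ i, 1 ≤ M i) ∧ (∀ i, c i * P.L ^ k + P.L ^ k * M i ≤ P.sitesPerDir 0) ∧
            (∀ i, P.L ^ k * M i < P.sitesPerDir 0) ∧ cube α = cubeT hPd (P.L ^ k) c fun i => P.L ^ k * M i) →
        (∀ x y, ∑ α, |lam α x y| ≤ 1) → (∀ x y, |ζ'' x y| ≤ 1) →
        ∀ (h : GaugeTransf P 0 U1) (x y : Balaban1983to89.Site P 0),
          ‖BIJ88DeltaLoc234Torus.gLocT (B1RG242Torus.α P a k * (P.L : ℝ) ^ (k * P.d)) P.eps⁻¹ (gaugeAct h (1 : GaugeField P 0 U1)) k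
              cube lam ζ'' x y‖ ≤ P.spacing k ^ 2 * (c₀ * Real.exp (-(δ₀ * (((P.L : ℝ) ^ k)⁻¹ * B5Ineq137Torus.T P 0 x y)))) := by
  obtain ⟨δ₀, c₀, hδ₀, hc₀, H⟩ := decay_gTilde_flat_kernel_level d ℓ hℓ ha
  refine ⟨δ₀, c₀, hδ₀, hc₀, ?_⟩
  intro P hPd hPL k hk1 hkK ι _ cube lam ζ'' hcube hlam hζ h x y
  rw [BIJ88DeltaLoc234Torus.gLocT_apply, norm_mul, Complex.norm_real, Real.norm_eq_abs]
  have hG := H P hPd hPL k hk1 hkK ι cube lam hcube hlam h x y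
  calc |ζ'' x y| * ‖BIJ88DeltaLoc234Torus.gTilde (B1RG242Torus.α P a k * (P.L : ℝ) ^ (k * P.d)) P.eps⁻¹
          (gaugeAct h (1 : GaugeField P 0 U1)) k cube lam x y‖
      ≤ 1 * (P.spacing k ^ 2 * (c₀ * Real.exp (-(δ₀ * (((P.L : ℝ) ^ k)⁻¹ * B5Ineq137Torus.T P 0 x y))))) := mul_le_mul (hζ x y) hG (norm_nonneg _) zero_le_one
    _ = P.spacing k ^ 2 * (c₀ * Real.exp (-(δ₀ * (((P.L : ℝ) ^ k)⁻¹ * B5Ineq137Torus.T P 0 x y)))) := one_mul _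

end LevelUnits


end

end Literature.MathematicalPhysics.QuantumFieldTheory.BalabanImbrieJaffe1984to88.BIJ88DeltaLocFlatClose235
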